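import Summits.CriticalPhenomena.PercolationContinuityZ3.Theorems.PercNearOneGluingAdditiveGluingConeAssembly
import Summits.CriticalPhenomena.PercolationContinuityZ3.Theorems.PercNearOneGluingAdditiveGluingBlockGoodLeaves
import Summits.CriticalPhenomena.PercolationContinuityZ3.Theorems.PercNearOneGluingAdditiveGluingSigmaRecursion
import Summits.CriticalPhenomena.PercolationContinuityZ3.Theorems.PercNearOneGluingAdditiveGluingToolHijackBHK
import Summits.CriticalPhenomena.PercolationContinuityZ3.Theorems.PercNearOneGluingAdditiveGluingToolHijackSplitBHK
import Summits.CriticalPhenomena.PercolationContinuityZ3.Theorems.PercNearOneGluingAdditiveGluingToolDeadWinnerAttracts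
import Summits.CriticalPhenomena.PercolationContinuityZ3.Theorems.PercNearOneGluingAdditiveGluingToolGainIdentity
import Summits.CriticalPhenomena.PercolationContinuityZ3.Theorems.PercNearOneGluingAdditiveGluingToolHijackRide
import Summits.CriticalPhenomena.PercolationContinuityZ3.Theorems.PercNearOneGluingAdditiveGluingBystanderReach
import Summits.CriticalPhenomena.PercolationContinuityZ3.Theorems.PercNearOneGluingAdditiveGluingBystanderDesignated
import Summits.CriticalPhenomena.PercolationContinuityZ3.Theorems.PercNearOneGluingAdditiveGluingPeelGlueTransfer
import Summits.CriticalPhenomena.PercolationContinuityZ3.Theorems.PercNearOneGluingAdditiveGluingBystanderGood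
import Summits.CriticalPhenomena.PercolationContinuityZ3.Theorems.PercNearOneGluingAdditiveGluingRelayLayersNoDrift
import Summits.CriticalPhenomena.PercolationContinuityZ3.Theorems.PercNearOneGluingAdditiveGluingCone7Assembly
import Summits.CriticalPhenomena.PercolationContinuityZ3.Theorems.PercNearOneGluingAdditiveGluingIsolatedBlock
import Summits.CriticalPhenomena.PercolationContinuityZ3.Theorems.PercNearOneGluingAdditiveGluingBystanderKernel
import Summits.CriticalPhenomena.PercolationContinuityZ3.Theorems.PercNearOneGluingAdditiveGluingWholeBlockKernel
import HarnessLib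

/-!
# Line `peel` — official skeleton v5 (lead c5, 2026-08-17): bystander attachment is REAL; residuals = the POCKET-FREE relay-layer
# certificate (new) and the DOUBLE-DRIFT kernel (v4), either closes the crux

Crux (FIXED, by name): `Summit.CriticalPhenomena.PercolationContinuityZ3.Theses.PercNearOneGluing.AdditiveGluing`.

Composition idea unchanged (peel/cone: block goodness of the bad glued blocks of the star-killed weighting `u` at its minimiser `a₀`,
grown one vertex at a time; v3's cone step `conePeel` ⇒ crux is LANDED: `coneLine_additiveGluing_of`, …ConeAssembly.lean p170268).
RESHAPE v3 → v4 (LeadMath-c5 §F): un-gluing the BYSTANDER `x` (σ-identities `stub_bystanderReach/Designated/Pockets_c5`, waves of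
this lead) shows that for ANY designation `d ≠ x`, `insert x T` is `d`-good in `u` as soon as every layer block `T ∪ B` (`B` = an
open star of `x` of positive mass) is `d`-good in `u − x` (`stub_bystanderGood_c5` below — a REAL theorem once the pocket identity
lands: `blockGood_insert_of_unglued`, work/BystanderGood.lean).  Taking `d := a'` a minimiser of `μ_{u−x}(· ↔ b)`, every layer block is
good by the induction hypothesis (bad blocks: the cone chain in the smaller weighting `u − x`) or by the Lemma-5 leaf
`blockGood_leaf_lemma5`, so `insert x T` is `a'`-good in `u`, and `a₀`-goodness follows UNLESS
`τ_{u/(T∪x)}(a') < τ_{u/(T∪x)}(a₀)` ("double drift": `a'` is below `a₀` in `u − x`, above in `u`, below again after gluing).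
Hence the registered residual `stub_coneDoubleDrift`: the cone step under the extra hypotheses (i) `a' ∈ argmin_A μ_{u−x}(· ↔ b)`,
(ii) strict double drift, (iii) `a'`-goodness of `insert x T` in `u` already in hand.  Numerics (lab/t18–t22): double drift w.r.t. `x`
in ≈ 1 % of exact instances n ≤ 8; 0 cone violations there; the `a'`-margin paid the drift ≥ 25× in every case found.
Real proofs: `blockGood_of_target_mem`, `coneChain_local` (the chain inside one weighting), `conePeel_of_doubleDrift` (strong
induction on the number of positive-degree vertices: isolated bystander / layers / leaf / drift split), `additiveGluing_closed`
(crux by name via the landed `coneLine_additiveGluing_of`), and the v2/v3 routes kept (`stub_pairGamma`, `additiveGluing_closed'`).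
[cite: KozmaNitzan2024, §3.2 Definition p. 12, Thms 4–5 pp. 12–14, Lemma 5 p. 13, Question 7 & 9 p. 36]
-/

namespace Summit.CriticalPhenomena.PercolationContinuityZ3.Cruxes.AdditiveGluing.Peel

open MeasureTheory Set
open Literature.Probability.LatticeModels (prodBernoulli)
open Literature.Probability.Percolation (BondConfig openConn openConnIn openGraph openCluster)
open Summit.CriticalPhenomena.PercolationContinuityZ3.Theorems
open scoped BigOperators Classical

noncomputable section

/-! ## STUBS -/

/-- **STUB `stub_coneDoubleDrift` (load-bearing; the residual of the cone step after bystander attachment).**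
The cone growth step `T ↦ insert x T` at `a₀ = argmin_A μ_u(· ↔ b)` in the only case the real proof below does not reach: for EVERY
non-isolated vertex `x'` of `insert x T`, every minimiser `a'` of the `x'`-star-killed two-point function `μ_{u−x'}(· ↔ b)` strictly
overtakes `a₀` after gluing `insert x T` ("total double drift"), with the `a'`-goodness of `insert x T` in `u` for every such pair
`(x', a')` (proved by bystander attachment) handed in.  Numerics (lab/t20–t21): ≈ 0.1 % of exact bad instances n ≤ 8; 0 violations.
[cite: KozmaNitzan2024, §3.2 pp. 12–14, Question 7 & 9 p. 36] -/
theorem stub_coneDoubleDrift :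
    ∀ (n : ℕ) (u : Sym2 (Fin n) → unitInterval) (A T : Finset (Fin n)) (b a₀ x : Fin n) (hb : b ∈ A),
      Disjoint T A → T.Nonempty → x ∉ A → x ∉ T → a₀ ∈ A → 4 ≤ A.card →
      (∀ a ∈ A, (prodBernoulli u).real (openConn a₀ b) ≤ (prodBernoulli u).real (openConn a b)) →
      (∀ v ∈ insert x T, (prodBernoulli u).real (openConn v b) < (prodBernoulli u).real (openConn a₀ b)) →
      (∀ w' : Sym2 (Fin n) → unitInterval,
        (Finset.univ.filter (fun v : Fin n => ∃ y : Fin n, 0 < (w' s(y, v) : ℝ))).card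
          ≤ (Finset.univ.filter (fun v : Fin n => ∃ y : Fin n, 0 < (u s(y, v) : ℝ))).card →
        ∀ (A' : Finset (Fin n)) (o' b' : Fin n), b' ∈ A' → o' ∉ A' →
        ∀ (t : ℝ) (sel : Finset (Fin n) → Fin n), (∀ W, sel W ∈ A') →
          (∀ a ∈ A', 1 - t ≤ (prodBernoulli w').real (openConn a b')) →
          (prodBernoulli w').real ((⋃ a ∈ A', openConn o' a) ∩ (openConn o' b')ᶜ)
            + ∑ W ∈ (Finset.univ : Finset (Finset (Fin n))).filter (fun W => o' ∈ W ∧ Disjoint W A'),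
                (prodBernoulli w').real {ω : BondConfig (Fin n) | openCluster ω o' = (W : Set (Fin n))}
                  * (prodBernoulli w').real (openConnIn ((W : Set (Fin n))ᶜ) (sel W) b')ᶜ
            ≤ t) →
      (prodBernoulli u).real (openConn a₀ b)
          + (prodBernoulli u).real
              ((openConn a₀ b)ᶜ ∩ (⋃ v ∈ T, openConn a₀ v) ∩ (⋃ v ∈ T, openConn v b))
        ≤ (prodBernoulli u).real (⋃ v ∈ T, openConn v b)
          + (∑ W ∈ (Finset.univ : Finset (Finset (Fin n))).filter (fun W => Disjoint W A),
              (prodBernoulli u).real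
                  {ω : BondConfig (Fin n) | ∀ z : Fin n, (z ∈ W ↔ ω ∈ ⋃ v ∈ T, openConn v z)}
                * A.inf' ⟨b, hb⟩ (fun a => (prodBernoulli u).real (openConnIn ((W : Set (Fin n))ᶜ) a b))) →
      (∀ x' ∈ insert x T, ∀ y₀ : Fin n, (u s(x', y₀) : ℝ) ≠ 0 → ∀ a' ∈ A,
        (∀ a ∈ A, (prodBernoulli (fun e : Sym2 (Fin n) => if (∃ y ∈ e, y ∈ ({x'} : Finset (Fin n))) then (0 : unitInterval) else u e)).real (openConn a' b) ≤ (prodBernoulli (fun e : Sym2 (Fin n) => if (∃ y ∈ e, y ∈ ({x'} : Finset (Fin n))) then (0 : unitInterval) else u e)).real (openConn a b)) →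
        (prodBernoulli u).real (openConn a' b)
            + (prodBernoulli u).real ((openConn a' b)ᶜ ∩ (⋃ v ∈ insert x T, openConn a' v) ∩ (⋃ v ∈ insert x T, openConn v b))
          < (prodBernoulli u).real (openConn a₀ b)
            + (prodBernoulli u).real ((openConn a₀ b)ᶜ ∩ (⋃ v ∈ insert x T, openConn a₀ v) ∩ (⋃ v ∈ insert x T, openConn v b))) →
      (∀ x' ∈ insert x T, ∀ y₀ : Fin n, (u s(x', y₀) : ℝ) ≠ 0 → ∀ a' ∈ A,
        (∀ a ∈ A, (prodBernoulli (fun e : Sym2 (Fin n) => if (∃ y ∈ e, y ∈ ({x'} : Finset (Fin n))) then (0 : unitInterval) else u e)).real (openConn a' b) ≤ (prodBernoulli (fun e : Sym2 (Fin n) => if (∃ y ∈ e, y ∈ ({x'} : Finset (Fin n))) then (0 : unitInterval) else u e)).real (openConn a b)) →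
        (prodBernoulli u).real (openConn a' b)
          + (prodBernoulli u).real
              ((openConn a' b)ᶜ ∩ (⋃ v ∈ insert x T, openConn a' v) ∩ (⋃ v ∈ insert x T, openConn v b))
        ≤ (prodBernoulli u).real (⋃ v ∈ insert x T, openConn v b)
          + (∑ W ∈ (Finset.univ : Finset (Finset (Fin n))).filter (fun W => Disjoint W A),
              (prodBernoulli u).real
                  {ω : BondConfig (Fin n) | ∀ z : Fin n, (z ∈ W ↔ ω ∈ ⋃ v ∈ insert x T, openConn v z)}
                * A.inf' ⟨b, hb⟩ (fun a => (prodBernoulli u).real (openConnIn ((W : Set (Fin n))ᶜ) a b)))) →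
      (prodBernoulli u).real (openConn a₀ b)
          + (prodBernoulli u).real
              ((openConn a₀ b)ᶜ ∩ (⋃ v ∈ insert x T, openConn a₀ v) ∩ (⋃ v ∈ insert x T, openConn v b))
        ≤ (prodBernoulli u).real (⋃ v ∈ insert x T, openConn v b)
          + (∑ W ∈ (Finset.univ : Finset (Finset (Fin n))).filter (fun W => Disjoint W A),
              (prodBernoulli u).real
                  {ω : BondConfig (Fin n) | ∀ z : Fin n, (z ∈ W ↔ ω ∈ ⋃ v ∈ insert x T, openConn v z)}
                * A.inf' ⟨b, hb⟩ (fun a => (prodBernoulli u).real (openConnIn ((W : Set (Fin n))ᶜ) a b))) := by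
  sorry

/-- **`stub_relayLayersNoDrift_c5` (v6; LANDED p171903, Theorems/…RelayLayersNoDrift.lean — KN Lemma 5 twice + two glue identities): the RELAY-layer term of the
pocket-free certificate is non-negative at the designation `a₀` whenever `a₀` minimises the `x'`-star-killed two-point function.**
For the layer block `S' ∪ B` meeting `A` (so containing a relay `a`), in `q_B` (= `u` with the star of `x'` killed and `B` glued):
`designated(a₀) = τ_{q_B/(S'∪B)}(a₀) ≤ reach_{q_B}(S'∪B)` — `blockGrowth_glue_real_openConn` / `_iUnion` (BlockGrowth) turn both sides into
the `(S'∪B)`-glued weighting of the star-killed `u` (gluing `B ⊆ S'∪B` first changes nothing), and `stub_gluingLemma5` (GluingLemma5) applies with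
`v = a ∈ S' ∪ B` (`τ(a₀) ≤ τ(a)` in the star-killed weighting is the hypothesis); if `b ∈ S' ∪ B` the reach is `1`.
[cite: KozmaNitzan2024, §3.2 Lemma 5 p. 13] -/
theorem stub_relayLayersNoDrift_c5 :
    ∀ (n : ℕ) (u : Sym2 (Fin n) → unitInterval) (A S' B : Finset (Fin n)) (b a₀ x' : Fin n),
      b ∈ A → Disjoint S' A → a₀ ∈ A →
      (∀ a ∈ A, (prodBernoulli (fun e : Sym2 (Fin n) => if (∃ y ∈ e, y ∈ ({x'} : Finset (Fin n))) then (0 : unitInterval) else u e)).real (openConn a₀ b) ≤ (prodBernoulli (fun e : Sym2 (Fin n) => if (∃ y ∈ e, y ∈ ({x'} : Finset (Fin n))) then (0 : unitInterval) else u e)).real (openConn a b)) →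
      ¬ Disjoint (S' ∪ B) A →
      0 ≤ (prodBernoulli (fun e : Sym2 (Fin n) => if (∀ y ∈ e, y ∈ B) ∧ ¬ e.IsDiag then 1 else if (∃ y ∈ e, y ∈ ({x'} : Finset (Fin n))) then 0 else u e)).real (⋃ v ∈ (S' ∪ B), openConn v b)
              - ((prodBernoulli (fun e : Sym2 (Fin n) => if (∀ y ∈ e, y ∈ B) ∧ ¬ e.IsDiag then 1 else if (∃ y ∈ e, y ∈ ({x'} : Finset (Fin n))) then 0 else u e)).real (openConn a₀ b)
                + (prodBernoulli (fun e : Sym2 (Fin n) => if (∀ y ∈ e, y ∈ B) ∧ ¬ e.IsDiag then 1 else if (∃ y ∈ e, y ∈ ({x'} : Finset (Fin n))) then 0 else u e)).real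
                    ((openConn a₀ b)ᶜ ∩ (⋃ v ∈ (S' ∪ B), openConn a₀ v) ∩ (⋃ v ∈ (S' ∪ B), openConn v b))) :=
  Summit.CriticalPhenomena.PercolationContinuityZ3.Theorems.stub_relayLayersNoDrift_c5

/-- **STUB `stub_relayLayersAllDrift` (v6, load-bearing: the pocket-free residual in the ALL-DRIFT case).**  `stub_relayLayersPayDrift`
restricted to the case where EVERY non-isolated vertex `x'` of the block dethrones `a₀` (some relay is strictly below `a₀` in the
`x'`-star-killed two-point function).  In the complementary case the certificate holds at `a' = a₀` termwise (`stub_relayLayersNoDrift_c5`).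
Clean probabilistic form of the certificate (lab/t30, validated to 1e-15 against the layer sum): for the bystander `x'`, `S = insert x T`,
`R₁ = {some edge from x' into A is open}`, `↔'` = connection with `S` glued:
`μ_u(a₀ ↔' b) ≤ μ_u(R₁ ∩ {S ↔ b}) + μ_u(R₁ᶜ ∩ {a' ↔' b})`.
Numerics (exact, lab/t29–t37, kit j027573): 0 violations for the best `x'` in > 30 000 blocks n ≤ 8 (bad or not); in the all-drift case a
FIXED `x'` can still fail (1 instance in ≈ 160, lab/t37 seed 53: n = 6), so the existential over `x'` is essential; no selection rule among
{min τ_u, min first drift, max P(R₁), max u(x'b)} is universal (lab/t33–t35, t38).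
[cite: KozmaNitzan2024, §3.2 pp. 12–14, Question 7 & 9 p. 36] -/
theorem stub_relayLayersAllDrift :
    ∀ (n : ℕ) (u : Sym2 (Fin n) → unitInterval) (A T : Finset (Fin n)) (b a₀ x : Fin n) (hb : b ∈ A),
      Disjoint T A → T.Nonempty → x ∉ A → x ∉ T → a₀ ∈ A → 4 ≤ A.card →
      (∀ a ∈ A, (prodBernoulli u).real (openConn a₀ b) ≤ (prodBernoulli u).real (openConn a b)) →
      (∀ v ∈ insert x T, (prodBernoulli u).real (openConn v b) < (prodBernoulli u).real (openConn a₀ b)) →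
      (∀ w' : Sym2 (Fin n) → unitInterval,
        (Finset.univ.filter (fun v : Fin n => ∃ y : Fin n, 0 < (w' s(y, v) : ℝ))).card
          ≤ (Finset.univ.filter (fun v : Fin n => ∃ y : Fin n, 0 < (u s(y, v) : ℝ))).card →
        ∀ (A' : Finset (Fin n)) (o' b' : Fin n), b' ∈ A' → o' ∉ A' →
        ∀ (t : ℝ) (sel : Finset (Fin n) → Fin n), (∀ W, sel W ∈ A') →
          (∀ a ∈ A', 1 - t ≤ (prodBernoulli w').real (openConn a b')) →
          (prodBernoulli w').real ((⋃ a ∈ A', openConn o' a) ∩ (openConn o' b')ᶜ)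
            + ∑ W ∈ (Finset.univ : Finset (Finset (Fin n))).filter (fun W => o' ∈ W ∧ Disjoint W A'),
                (prodBernoulli w').real {ω : BondConfig (Fin n) | openCluster ω o' = (W : Set (Fin n))}
                  * (prodBernoulli w').real (openConnIn ((W : Set (Fin n))ᶜ) (sel W) b')ᶜ
            ≤ t) →
      (prodBernoulli u).real (openConn a₀ b)
          + (prodBernoulli u).real
              ((openConn a₀ b)ᶜ ∩ (⋃ v ∈ T, openConn a₀ v) ∩ (⋃ v ∈ T, openConn v b))
        ≤ (prodBernoulli u).real (⋃ v ∈ T, openConn v b)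
          + (∑ W ∈ (Finset.univ : Finset (Finset (Fin n))).filter (fun W => Disjoint W A),
              (prodBernoulli u).real
                  {ω : BondConfig (Fin n) | ∀ z : Fin n, (z ∈ W ↔ ω ∈ ⋃ v ∈ T, openConn v z)}
                * A.inf' ⟨b, hb⟩ (fun a => (prodBernoulli u).real (openConnIn ((W : Set (Fin n))ᶜ) a b))) →
      (∃ y₀ : Fin n, (u s(x, y₀) : ℝ) ≠ 0) →
      (∀ x' ∈ insert x T, (∃ y₀, (u s(x', y₀) : ℝ) ≠ 0) →
        ∃ a ∈ A, (prodBernoulli (fun e : Sym2 (Fin n) => if (∃ y ∈ e, y ∈ ({x'} : Finset (Fin n))) then 0 else u e)).real (openConn a b) < (prodBernoulli (fun e : Sym2 (Fin n) => if (∃ y ∈ e, y ∈ ({x'} : Finset (Fin n))) then 0 else u e)).real (openConn a₀ b)) →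
      ∃ x' ∈ insert x T, ∃ y₀ : Fin n, (u s(x', y₀) : ℝ) ≠ 0 ∧ ∃ a' ∈ A,
        (∀ a ∈ A, (prodBernoulli (fun e : Sym2 (Fin n) => if (∃ y ∈ e, y ∈ ({x'} : Finset (Fin n))) then (0 : unitInterval) else u e)).real (openConn a' b) ≤ (prodBernoulli (fun e : Sym2 (Fin n) => if (∃ y ∈ e, y ∈ ({x'} : Finset (Fin n))) then (0 : unitInterval) else u e)).real (openConn a b)) ∧
        0 ≤ ∑ B : Finset (Fin n), (prodBernoulli u).real {ω : BondConfig (Fin n) | ∀ y : Fin n, y ∈ B ↔ (y ∉ ({x'} : Finset (Fin n)) ∧ ∃ o ∈ ({x'} : Finset (Fin n)), s(o, y) ∈ ω)}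
          * (if Disjoint ((insert x T).erase x' ∪ B) A then
              ((prodBernoulli (fun e : Sym2 (Fin n) => if (∀ y ∈ e, y ∈ B) ∧ ¬ e.IsDiag then 1 else if (∃ y ∈ e, y ∈ ({x'} : Finset (Fin n))) then 0 else u e)).real (openConn a' b)
                + (prodBernoulli (fun e : Sym2 (Fin n) => if (∀ y ∈ e, y ∈ B) ∧ ¬ e.IsDiag then 1 else if (∃ y ∈ e, y ∈ ({x'} : Finset (Fin n))) then 0 else u e)).real
                    ((openConn a' b)ᶜ ∩ (⋃ v ∈ ((insert x T).erase x' ∪ B), openConn a' v) ∩ (⋃ v ∈ ((insert x T).erase x' ∪ B), openConn v b)))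
              - ((prodBernoulli (fun e : Sym2 (Fin n) => if (∀ y ∈ e, y ∈ B) ∧ ¬ e.IsDiag then 1 else if (∃ y ∈ e, y ∈ ({x'} : Finset (Fin n))) then 0 else u e)).real (openConn a₀ b)
                + (prodBernoulli (fun e : Sym2 (Fin n) => if (∀ y ∈ e, y ∈ B) ∧ ¬ e.IsDiag then 1 else if (∃ y ∈ e, y ∈ ({x'} : Finset (Fin n))) then 0 else u e)).real
                    ((openConn a₀ b)ᶜ ∩ (⋃ v ∈ ((insert x T).erase x' ∪ B), openConn a₀ v) ∩ (⋃ v ∈ ((insert x T).erase x' ∪ B), openConn v b)))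
            else
              (prodBernoulli (fun e : Sym2 (Fin n) => if (∀ y ∈ e, y ∈ B) ∧ ¬ e.IsDiag then 1 else if (∃ y ∈ e, y ∈ ({x'} : Finset (Fin n))) then 0 else u e)).real (⋃ v ∈ ((insert x T).erase x' ∪ B), openConn v b)
              - ((prodBernoulli (fun e : Sym2 (Fin n) => if (∀ y ∈ e, y ∈ B) ∧ ¬ e.IsDiag then 1 else if (∃ y ∈ e, y ∈ ({x'} : Finset (Fin n))) then 0 else u e)).real (openConn a₀ b)
                + (prodBernoulli (fun e : Sym2 (Fin n) => if (∀ y ∈ e, y ∈ B) ∧ ¬ e.IsDiag then 1 else if (∃ y ∈ e, y ∈ ({x'} : Finset (Fin n))) then 0 else u e)).real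
                    ((openConn a₀ b)ᶜ ∩ (⋃ v ∈ ((insert x T).erase x' ∪ B), openConn a₀ v) ∩ (⋃ v ∈ ((insert x T).erase x' ∪ B), openConn v b)))) := by
  sorry

/-- **STUB `stub_relayLayersPayDrift` (load-bearing, the POCKET-FREE residual; lead c5 t28–t29).**  For a bad block grown by a
non-isolated vertex there is a vertex `x'` of `insert x T` (with `u s(x', ·) ≠ 0` somewhere) and a minimiser `a'` of the `x'`-star-killed
two-point function such that the layers of `x'` satisfy: the RELAY layers' explicit `a₀`-margins (`reach − designated`, no pockets) pay the
relay-FREE layers' drift (`designated at a' − designated at a₀`), i.e. `0 ≤ Σ_B μ_u(layer_B)·c_B` with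
`c_B = [τ_{q_B}(T'∪B↔b) − τ_{q_B/(T'∪B)}(a₀)]` on layers meeting `A` and `c_B = [τ_{q_B/(T'∪B)}(a') − τ_{q_B/(T'∪B)}(a₀)]` on layers
avoiding `A` (`T' = (insert x T).erase x'`, `q_B` = `u` with the star of `x'` killed and `B` glued).  Every quantity is a probability of a
connection event — no pockets, no worst selection.  With the induction hypothesis (relay-free layer blocks are `a'`-good) and the bystander
layer lemma this implies the cone step (`conePeel_of_relayLayers`, real proof).  Numerics: 0 violations for the best `x'` in 4 499 exact bad
blocks n ≤ 7 (lab/t29, three seeds; a FIXED `x'` fails ≈ 0.3 %), incl. the 17 total-double-drift instances found (margins ≥ 0.028).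
[cite: KozmaNitzan2024, §3.2 pp. 12–14, Question 7 & 9 p. 36] -/
theorem relayLayersPayDrift_of
    (hND : ∀ (n : ℕ) (u : Sym2 (Fin n) → unitInterval) (A S' B : Finset (Fin n)) (b a₀ x' : Fin n),
        b ∈ A → Disjoint S' A → a₀ ∈ A →
        (∀ a ∈ A, (prodBernoulli (fun e : Sym2 (Fin n) => if (∃ y ∈ e, y ∈ ({x'} : Finset (Fin n))) then (0 : unitInterval) else u e)).real (openConn a₀ b) ≤ (prodBernoulli (fun e : Sym2 (Fin n) => if (∃ y ∈ e, y ∈ ({x'} : Finset (Fin n))) then (0 : unitInterval) else u e)).real (openConn a b)) →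
        ¬ Disjoint (S' ∪ B) A →
        0 ≤ (prodBernoulli (fun e : Sym2 (Fin n) => if (∀ y ∈ e, y ∈ B) ∧ ¬ e.IsDiag then 1 else if (∃ y ∈ e, y ∈ ({x'} : Finset (Fin n))) then 0 else u e)).real (⋃ v ∈ (S' ∪ B), openConn v b)
                - ((prodBernoulli (fun e : Sym2 (Fin n) => if (∀ y ∈ e, y ∈ B) ∧ ¬ e.IsDiag then 1 else if (∃ y ∈ e, y ∈ ({x'} : Finset (Fin n))) then 0 else u e)).real (openConn a₀ b)
                  + (prodBernoulli (fun e : Sym2 (Fin n) => if (∀ y ∈ e, y ∈ B) ∧ ¬ e.IsDiag then 1 else if (∃ y ∈ e, y ∈ ({x'} : Finset (Fin n))) then 0 else u e)).real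
                      ((openConn a₀ b)ᶜ ∩ (⋃ v ∈ (S' ∪ B), openConn a₀ v) ∩ (⋃ v ∈ (S' ∪ B), openConn v b))))
    (hAD : ∀ (n : ℕ) (u : Sym2 (Fin n) → unitInterval) (A T : Finset (Fin n)) (b a₀ x : Fin n) (hb : b ∈ A),
        Disjoint T A → T.Nonempty → x ∉ A → x ∉ T → a₀ ∈ A → 4 ≤ A.card →
        (∀ a ∈ A, (prodBernoulli u).real (openConn a₀ b) ≤ (prodBernoulli u).real (openConn a b)) →
        (∀ v ∈ insert x T, (prodBernoulli u).real (openConn v b) < (prodBernoulli u).real (openConn a₀ b)) →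
        (∀ w' : Sym2 (Fin n) → unitInterval,
          (Finset.univ.filter (fun v : Fin n => ∃ y : Fin n, 0 < (w' s(y, v) : ℝ))).card
            ≤ (Finset.univ.filter (fun v : Fin n => ∃ y : Fin n, 0 < (u s(y, v) : ℝ))).card →
          ∀ (A' : Finset (Fin n)) (o' b' : Fin n), b' ∈ A' → o' ∉ A' →
          ∀ (t : ℝ) (sel : Finset (Fin n) → Fin n), (∀ W, sel W ∈ A') →
            (∀ a ∈ A', 1 - t ≤ (prodBernoulli w').real (openConn a b')) →
            (prodBernoulli w').real ((⋃ a ∈ A', openConn o' a) ∩ (openConn o' b')ᶜ)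
              + ∑ W ∈ (Finset.univ : Finset (Finset (Fin n))).filter (fun W => o' ∈ W ∧ Disjoint W A'),
                  (prodBernoulli w').real {ω : BondConfig (Fin n) | openCluster ω o' = (W : Set (Fin n))}
                    * (prodBernoulli w').real (openConnIn ((W : Set (Fin n))ᶜ) (sel W) b')ᶜ
              ≤ t) →
        (prodBernoulli u).real (openConn a₀ b)
            + (prodBernoulli u).real
                ((openConn a₀ b)ᶜ ∩ (⋃ v ∈ T, openConn a₀ v) ∩ (⋃ v ∈ T, openConn v b))
          ≤ (prodBernoulli u).real (⋃ v ∈ T, openConn v b)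
            + (∑ W ∈ (Finset.univ : Finset (Finset (Fin n))).filter (fun W => Disjoint W A),
                (prodBernoulli u).real
                    {ω : BondConfig (Fin n) | ∀ z : Fin n, (z ∈ W ↔ ω ∈ ⋃ v ∈ T, openConn v z)}
                  * A.inf' ⟨b, hb⟩ (fun a => (prodBernoulli u).real (openConnIn ((W : Set (Fin n))ᶜ) a b))) →
        (∃ y₀ : Fin n, (u s(x, y₀) : ℝ) ≠ 0) →
        (∀ x' ∈ insert x T, (∃ y₀, (u s(x', y₀) : ℝ) ≠ 0) →
          ∃ a ∈ A, (prodBernoulli (fun e : Sym2 (Fin n) => if (∃ y ∈ e, y ∈ ({x'} : Finset (Fin n))) then 0 else u e)).real (openConn a b) < (prodBernoulli (fun e : Sym2 (Fin n) => if (∃ y ∈ e, y ∈ ({x'} : Finset (Fin n))) then 0 else u e)).real (openConn a₀ b)) →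
        ∃ x' ∈ insert x T, ∃ y₀ : Fin n, (u s(x', y₀) : ℝ) ≠ 0 ∧ ∃ a' ∈ A,
          (∀ a ∈ A, (prodBernoulli (fun e : Sym2 (Fin n) => if (∃ y ∈ e, y ∈ ({x'} : Finset (Fin n))) then (0 : unitInterval) else u e)).real (openConn a' b) ≤ (prodBernoulli (fun e : Sym2 (Fin n) => if (∃ y ∈ e, y ∈ ({x'} : Finset (Fin n))) then (0 : unitInterval) else u e)).real (openConn a b)) ∧
          0 ≤ ∑ B : Finset (Fin n), (prodBernoulli u).real {ω : BondConfig (Fin n) | ∀ y : Fin n, y ∈ B ↔ (y ∉ ({x'} : Finset (Fin n)) ∧ ∃ o ∈ ({x'} : Finset (Fin n)), s(o, y) ∈ ω)}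
            * (if Disjoint ((insert x T).erase x' ∪ B) A then
                ((prodBernoulli (fun e : Sym2 (Fin n) => if (∀ y ∈ e, y ∈ B) ∧ ¬ e.IsDiag then 1 else if (∃ y ∈ e, y ∈ ({x'} : Finset (Fin n))) then 0 else u e)).real (openConn a' b)
                  + (prodBernoulli (fun e : Sym2 (Fin n) => if (∀ y ∈ e, y ∈ B) ∧ ¬ e.IsDiag then 1 else if (∃ y ∈ e, y ∈ ({x'} : Finset (Fin n))) then 0 else u e)).real
                      ((openConn a' b)ᶜ ∩ (⋃ v ∈ ((insert x T).erase x' ∪ B), openConn a' v) ∩ (⋃ v ∈ ((insert x T).erase x' ∪ B), openConn v b)))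
                - ((prodBernoulli (fun e : Sym2 (Fin n) => if (∀ y ∈ e, y ∈ B) ∧ ¬ e.IsDiag then 1 else if (∃ y ∈ e, y ∈ ({x'} : Finset (Fin n))) then 0 else u e)).real (openConn a₀ b)
                  + (prodBernoulli (fun e : Sym2 (Fin n) => if (∀ y ∈ e, y ∈ B) ∧ ¬ e.IsDiag then 1 else if (∃ y ∈ e, y ∈ ({x'} : Finset (Fin n))) then 0 else u e)).real
                      ((openConn a₀ b)ᶜ ∩ (⋃ v ∈ ((insert x T).erase x' ∪ B), openConn a₀ v) ∩ (⋃ v ∈ ((insert x T).erase x' ∪ B), openConn v b)))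
              else
                (prodBernoulli (fun e : Sym2 (Fin n) => if (∀ y ∈ e, y ∈ B) ∧ ¬ e.IsDiag then 1 else if (∃ y ∈ e, y ∈ ({x'} : Finset (Fin n))) then 0 else u e)).real (⋃ v ∈ ((insert x T).erase x' ∪ B), openConn v b)
                - ((prodBernoulli (fun e : Sym2 (Fin n) => if (∀ y ∈ e, y ∈ B) ∧ ¬ e.IsDiag then 1 else if (∃ y ∈ e, y ∈ ({x'} : Finset (Fin n))) then 0 else u e)).real (openConn a₀ b)
                  + (prodBernoulli (fun e : Sym2 (Fin n) => if (∀ y ∈ e, y ∈ B) ∧ ¬ e.IsDiag then 1 else if (∃ y ∈ e, y ∈ ({x'} : Finset (Fin n))) then 0 else u e)).real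
                      ((openConn a₀ b)ᶜ ∩ (⋃ v ∈ ((insert x T).erase x' ∪ B), openConn a₀ v) ∩ (⋃ v ∈ ((insert x T).erase x' ∪ B), openConn v b))))) :
    ∀ (n : ℕ) (u : Sym2 (Fin n) → unitInterval) (A T : Finset (Fin n)) (b a₀ x : Fin n) (hb : b ∈ A),
      Disjoint T A → T.Nonempty → x ∉ A → x ∉ T → a₀ ∈ A → 4 ≤ A.card →
      (∀ a ∈ A, (prodBernoulli u).real (openConn a₀ b) ≤ (prodBernoulli u).real (openConn a b)) →
      (∀ v ∈ insert x T, (prodBernoulli u).real (openConn v b) < (prodBernoulli u).real (openConn a₀ b)) →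
      (∀ w' : Sym2 (Fin n) → unitInterval,
        (Finset.univ.filter (fun v : Fin n => ∃ y : Fin n, 0 < (w' s(y, v) : ℝ))).card
          ≤ (Finset.univ.filter (fun v : Fin n => ∃ y : Fin n, 0 < (u s(y, v) : ℝ))).card →
        ∀ (A' : Finset (Fin n)) (o' b' : Fin n), b' ∈ A' → o' ∉ A' →
        ∀ (t : ℝ) (sel : Finset (Fin n) → Fin n), (∀ W, sel W ∈ A') →
          (∀ a ∈ A', 1 - t ≤ (prodBernoulli w').real (openConn a b')) →
          (prodBernoulli w').real ((⋃ a ∈ A', openConn o' a) ∩ (openConn o' b')ᶜ)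
            + ∑ W ∈ (Finset.univ : Finset (Finset (Fin n))).filter (fun W => o' ∈ W ∧ Disjoint W A'),
                (prodBernoulli w').real {ω : BondConfig (Fin n) | openCluster ω o' = (W : Set (Fin n))}
                  * (prodBernoulli w').real (openConnIn ((W : Set (Fin n))ᶜ) (sel W) b')ᶜ
            ≤ t) →
      (prodBernoulli u).real (openConn a₀ b)
          + (prodBernoulli u).real
              ((openConn a₀ b)ᶜ ∩ (⋃ v ∈ T, openConn a₀ v) ∩ (⋃ v ∈ T, openConn v b))
        ≤ (prodBernoulli u).real (⋃ v ∈ T, openConn v b)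
          + (∑ W ∈ (Finset.univ : Finset (Finset (Fin n))).filter (fun W => Disjoint W A),
              (prodBernoulli u).real
                  {ω : BondConfig (Fin n) | ∀ z : Fin n, (z ∈ W ↔ ω ∈ ⋃ v ∈ T, openConn v z)}
                * A.inf' ⟨b, hb⟩ (fun a => (prodBernoulli u).real (openConnIn ((W : Set (Fin n))ᶜ) a b))) →
      (∃ y₀ : Fin n, (u s(x, y₀) : ℝ) ≠ 0) →
      ∃ x' ∈ insert x T, ∃ y₀ : Fin n, (u s(x', y₀) : ℝ) ≠ 0 ∧ ∃ a' ∈ A,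
        (∀ a ∈ A, (prodBernoulli (fun e : Sym2 (Fin n) => if (∃ y ∈ e, y ∈ ({x'} : Finset (Fin n))) then (0 : unitInterval) else u e)).real (openConn a' b) ≤ (prodBernoulli (fun e : Sym2 (Fin n) => if (∃ y ∈ e, y ∈ ({x'} : Finset (Fin n))) then (0 : unitInterval) else u e)).real (openConn a b)) ∧
        0 ≤ ∑ B : Finset (Fin n), (prodBernoulli u).real {ω : BondConfig (Fin n) | ∀ y : Fin n, y ∈ B ↔ (y ∉ ({x'} : Finset (Fin n)) ∧ ∃ o ∈ ({x'} : Finset (Fin n)), s(o, y) ∈ ω)}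
          * (if Disjoint ((insert x T).erase x' ∪ B) A then
              ((prodBernoulli (fun e : Sym2 (Fin n) => if (∀ y ∈ e, y ∈ B) ∧ ¬ e.IsDiag then 1 else if (∃ y ∈ e, y ∈ ({x'} : Finset (Fin n))) then 0 else u e)).real (openConn a' b)
                + (prodBernoulli (fun e : Sym2 (Fin n) => if (∀ y ∈ e, y ∈ B) ∧ ¬ e.IsDiag then 1 else if (∃ y ∈ e, y ∈ ({x'} : Finset (Fin n))) then 0 else u e)).real
                    ((openConn a' b)ᶜ ∩ (⋃ v ∈ ((insert x T).erase x' ∪ B), openConn a' v) ∩ (⋃ v ∈ ((insert x T).erase x' ∪ B), openConn v b)))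
              - ((prodBernoulli (fun e : Sym2 (Fin n) => if (∀ y ∈ e, y ∈ B) ∧ ¬ e.IsDiag then 1 else if (∃ y ∈ e, y ∈ ({x'} : Finset (Fin n))) then 0 else u e)).real (openConn a₀ b)
                + (prodBernoulli (fun e : Sym2 (Fin n) => if (∀ y ∈ e, y ∈ B) ∧ ¬ e.IsDiag then 1 else if (∃ y ∈ e, y ∈ ({x'} : Finset (Fin n))) then 0 else u e)).real
                    ((openConn a₀ b)ᶜ ∩ (⋃ v ∈ ((insert x T).erase x' ∪ B), openConn a₀ v) ∩ (⋃ v ∈ ((insert x T).erase x' ∪ B), openConn v b)))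
            else
              (prodBernoulli (fun e : Sym2 (Fin n) => if (∀ y ∈ e, y ∈ B) ∧ ¬ e.IsDiag then 1 else if (∃ y ∈ e, y ∈ ({x'} : Finset (Fin n))) then 0 else u e)).real (⋃ v ∈ ((insert x T).erase x' ∪ B), openConn v b)
              - ((prodBernoulli (fun e : Sym2 (Fin n) => if (∀ y ∈ e, y ∈ B) ∧ ¬ e.IsDiag then 1 else if (∃ y ∈ e, y ∈ ({x'} : Finset (Fin n))) then 0 else u e)).real (openConn a₀ b)
                + (prodBernoulli (fun e : Sym2 (Fin n) => if (∀ y ∈ e, y ∈ B) ∧ ¬ e.IsDiag then 1 else if (∃ y ∈ e, y ∈ ({x'} : Finset (Fin n))) then 0 else u e)).real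
                    ((openConn a₀ b)ᶜ ∩ (⋃ v ∈ ((insert x T).erase x' ∪ B), openConn a₀ v) ∩ (⋃ v ∈ ((insert x T).erase x' ∪ B), openConn v b)))) := by
  intro n u A T b a₀ x hb hTA hTne hxA hxT ha₀ hA4 hmin hbad hIH hgoodT hnon
  by_cases hcase : ∀ x' ∈ insert x T, (∃ y₀, (u s(x', y₀) : ℝ) ≠ 0) →
        ∃ a ∈ A, (prodBernoulli (fun e : Sym2 (Fin n) => if (∃ y ∈ e, y ∈ ({x'} : Finset (Fin n))) then 0 else u e)).real (openConn a b) < (prodBernoulli (fun e : Sym2 (Fin n) => if (∃ y ∈ e, y ∈ ({x'} : Finset (Fin n))) then 0 else u e)).real (openConn a₀ b)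
  · exact hAD n u A T b a₀ x hb hTA hTne hxA hxT ha₀ hA4 hmin hbad hIH hgoodT hnon hcase
  · push Not at hcase
    obtain ⟨x', hx', ⟨y₀, hy₀⟩, hmin'⟩ := hcase
    refine ⟨x', hx', y₀, hy₀, a₀, ha₀, hmin', ?_⟩
    refine Finset.sum_nonneg fun B _ => mul_nonneg measureReal_nonneg ?_
    split_ifs with hdisj
    · exact le_of_eq (sub_self _).symm
    · have hTA' : Disjoint ((insert x T).erase x') A := by
        refine Finset.disjoint_left.2 fun v hv hvA => ?_
        rcases Finset.mem_insert.1 (Finset.mem_of_mem_erase hv) with rfl | hvT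
        · exact hxA hvA
        · exact Finset.disjoint_left.1 hTA hvT hvA
      exact hND n u A ((insert x T).erase x') B b a₀ x' hb hTA' ha₀ hmin' hdisj

/-- `stub_relayLayersPayDrift` of skeleton v5, now COMPOSED from the two v6 stubs. -/
theorem stub_relayLayersPayDrift :
    ∀ (n : ℕ) (u : Sym2 (Fin n) → unitInterval) (A T : Finset (Fin n)) (b a₀ x : Fin n) (hb : b ∈ A),
      Disjoint T A → T.Nonempty → x ∉ A → x ∉ T → a₀ ∈ A → 4 ≤ A.card →
      (∀ a ∈ A, (prodBernoulli u).real (openConn a₀ b) ≤ (prodBernoulli u).real (openConn a b)) →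
      (∀ v ∈ insert x T, (prodBernoulli u).real (openConn v b) < (prodBernoulli u).real (openConn a₀ b)) →
      (∀ w' : Sym2 (Fin n) → unitInterval,
        (Finset.univ.filter (fun v : Fin n => ∃ y : Fin n, 0 < (w' s(y, v) : ℝ))).card
          ≤ (Finset.univ.filter (fun v : Fin n => ∃ y : Fin n, 0 < (u s(y, v) : ℝ))).card →
        ∀ (A' : Finset (Fin n)) (o' b' : Fin n), b' ∈ A' → o' ∉ A' →
        ∀ (t : ℝ) (sel : Finset (Fin n) → Fin n), (∀ W, sel W ∈ A') →
          (∀ a ∈ A', 1 - t ≤ (prodBernoulli w').real (openConn a b')) →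
          (prodBernoulli w').real ((⋃ a ∈ A', openConn o' a) ∩ (openConn o' b')ᶜ)
            + ∑ W ∈ (Finset.univ : Finset (Finset (Fin n))).filter (fun W => o' ∈ W ∧ Disjoint W A'),
                (prodBernoulli w').real {ω : BondConfig (Fin n) | openCluster ω o' = (W : Set (Fin n))}
                  * (prodBernoulli w').real (openConnIn ((W : Set (Fin n))ᶜ) (sel W) b')ᶜ
            ≤ t) →
      (prodBernoulli u).real (openConn a₀ b)
          + (prodBernoulli u).real
              ((openConn a₀ b)ᶜ ∩ (⋃ v ∈ T, openConn a₀ v) ∩ (⋃ v ∈ T, openConn v b))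
        ≤ (prodBernoulli u).real (⋃ v ∈ T, openConn v b)
          + (∑ W ∈ (Finset.univ : Finset (Finset (Fin n))).filter (fun W => Disjoint W A),
              (prodBernoulli u).real
                  {ω : BondConfig (Fin n) | ∀ z : Fin n, (z ∈ W ↔ ω ∈ ⋃ v ∈ T, openConn v z)}
                * A.inf' ⟨b, hb⟩ (fun a => (prodBernoulli u).real (openConnIn ((W : Set (Fin n))ᶜ) a b))) →
      (∃ y₀ : Fin n, (u s(x, y₀) : ℝ) ≠ 0) →
      ∃ x' ∈ insert x T, ∃ y₀ : Fin n, (u s(x', y₀) : ℝ) ≠ 0 ∧ ∃ a' ∈ A,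
        (∀ a ∈ A, (prodBernoulli (fun e : Sym2 (Fin n) => if (∃ y ∈ e, y ∈ ({x'} : Finset (Fin n))) then (0 : unitInterval) else u e)).real (openConn a' b) ≤ (prodBernoulli (fun e : Sym2 (Fin n) => if (∃ y ∈ e, y ∈ ({x'} : Finset (Fin n))) then (0 : unitInterval) else u e)).real (openConn a b)) ∧
        0 ≤ ∑ B : Finset (Fin n), (prodBernoulli u).real {ω : BondConfig (Fin n) | ∀ y : Fin n, y ∈ B ↔ (y ∉ ({x'} : Finset (Fin n)) ∧ ∃ o ∈ ({x'} : Finset (Fin n)), s(o, y) ∈ ω)}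
          * (if Disjoint ((insert x T).erase x' ∪ B) A then
              ((prodBernoulli (fun e : Sym2 (Fin n) => if (∀ y ∈ e, y ∈ B) ∧ ¬ e.IsDiag then 1 else if (∃ y ∈ e, y ∈ ({x'} : Finset (Fin n))) then 0 else u e)).real (openConn a' b)
                + (prodBernoulli (fun e : Sym2 (Fin n) => if (∀ y ∈ e, y ∈ B) ∧ ¬ e.IsDiag then 1 else if (∃ y ∈ e, y ∈ ({x'} : Finset (Fin n))) then 0 else u e)).real
                    ((openConn a' b)ᶜ ∩ (⋃ v ∈ ((insert x T).erase x' ∪ B), openConn a' v) ∩ (⋃ v ∈ ((insert x T).erase x' ∪ B), openConn v b)))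
              - ((prodBernoulli (fun e : Sym2 (Fin n) => if (∀ y ∈ e, y ∈ B) ∧ ¬ e.IsDiag then 1 else if (∃ y ∈ e, y ∈ ({x'} : Finset (Fin n))) then 0 else u e)).real (openConn a₀ b)
                + (prodBernoulli (fun e : Sym2 (Fin n) => if (∀ y ∈ e, y ∈ B) ∧ ¬ e.IsDiag then 1 else if (∃ y ∈ e, y ∈ ({x'} : Finset (Fin n))) then 0 else u e)).real
                    ((openConn a₀ b)ᶜ ∩ (⋃ v ∈ ((insert x T).erase x' ∪ B), openConn a₀ v) ∩ (⋃ v ∈ ((insert x T).erase x' ∪ B), openConn v b)))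
            else
              (prodBernoulli (fun e : Sym2 (Fin n) => if (∀ y ∈ e, y ∈ B) ∧ ¬ e.IsDiag then 1 else if (∃ y ∈ e, y ∈ ({x'} : Finset (Fin n))) then 0 else u e)).real (⋃ v ∈ ((insert x T).erase x' ∪ B), openConn v b)
              - ((prodBernoulli (fun e : Sym2 (Fin n) => if (∀ y ∈ e, y ∈ B) ∧ ¬ e.IsDiag then 1 else if (∃ y ∈ e, y ∈ ({x'} : Finset (Fin n))) then 0 else u e)).real (openConn a₀ b)
                + (prodBernoulli (fun e : Sym2 (Fin n) => if (∀ y ∈ e, y ∈ B) ∧ ¬ e.IsDiag then 1 else if (∃ y ∈ e, y ∈ ({x'} : Finset (Fin n))) then 0 else u e)).real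
                    ((openConn a₀ b)ᶜ ∩ (⋃ v ∈ ((insert x T).erase x' ∪ B), openConn a₀ v) ∩ (⋃ v ∈ ((insert x T).erase x' ∪ B), openConn v b)))) :=
  relayLayersPayDrift_of stub_relayLayersNoDrift_c5 stub_relayLayersAllDrift


/-- **STUB `stub_bystanderLayers_c5` (REAL since p171607: `blockGood_insert_of_layers_weighted`, Theorems/…BystanderGood.lean): if reals `c_B` have non-negative layer-weighted sum and each is at most the layer
block's `reach + pockets − designated(d)` in `q_B`, then `insert x T` is `d`-good in `u`** (three bystander σ-identities + sum algebra).
[cite: KozmaNitzan2024, §3.2 pp. 13–14] -/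
theorem stub_bystanderLayers_c5 :
    ∀ (n : ℕ) (u : Sym2 (Fin n) → unitInterval) (A T : Finset (Fin n)) (x b d : Fin n) (hb : b ∈ A)
      (c : Finset (Fin n) → ℝ),
      x ∉ T → x ∉ A → d ≠ x →
      0 ≤ ∑ B : Finset (Fin n), (prodBernoulli u).real {ω : BondConfig (Fin n) | ∀ y : Fin n, y ∈ B ↔ (y ∉ ({x} : Finset (Fin n)) ∧ ∃ o ∈ ({x} : Finset (Fin n)), s(o, y) ∈ ω)} * c B →
      (∀ B : Finset (Fin n), (prodBernoulli u).real {ω : BondConfig (Fin n) | ∀ y : Fin n, y ∈ B ↔ (y ∉ ({x} : Finset (Fin n)) ∧ ∃ o ∈ ({x} : Finset (Fin n)), s(o, y) ∈ ω)} ≠ 0 →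
        c B ≤ (prodBernoulli (fun e : Sym2 (Fin n) => if (∀ y ∈ e, y ∈ B) ∧ ¬ e.IsDiag then 1 else if (∃ y ∈ e, y ∈ ({x} : Finset (Fin n))) then 0 else u e)).real (⋃ v ∈ T ∪ B, openConn v b)
          + (∑ W ∈ (Finset.univ : Finset (Finset (Fin n))).filter (fun W => Disjoint W A),
              (prodBernoulli (fun e : Sym2 (Fin n) => if (∀ y ∈ e, y ∈ B) ∧ ¬ e.IsDiag then 1 else if (∃ y ∈ e, y ∈ ({x} : Finset (Fin n))) then 0 else u e)).real
                  {ω : BondConfig (Fin n) | ∀ z : Fin n, (z ∈ W ↔ ω ∈ ⋃ v ∈ T ∪ B, openConn v z)}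
                * A.inf' ⟨b, hb⟩ (fun a => (prodBernoulli (fun e : Sym2 (Fin n) => if (∀ y ∈ e, y ∈ B) ∧ ¬ e.IsDiag then 1 else if (∃ y ∈ e, y ∈ ({x} : Finset (Fin n))) then 0 else u e)).real (openConnIn ((W : Set (Fin n))ᶜ) a b)))
          - ((prodBernoulli (fun e : Sym2 (Fin n) => if (∀ y ∈ e, y ∈ B) ∧ ¬ e.IsDiag then 1 else if (∃ y ∈ e, y ∈ ({x} : Finset (Fin n))) then 0 else u e)).real (openConn d b)
                + (prodBernoulli (fun e : Sym2 (Fin n) => if (∀ y ∈ e, y ∈ B) ∧ ¬ e.IsDiag then 1 else if (∃ y ∈ e, y ∈ ({x} : Finset (Fin n))) then 0 else u e)).real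
                    ((openConn d b)ᶜ ∩ (⋃ v ∈ T ∪ B, openConn d v) ∩ (⋃ v ∈ T ∪ B, openConn v b)))) →
      (prodBernoulli u).real (openConn d b)
          + (prodBernoulli u).real
              ((openConn d b)ᶜ ∩ (⋃ v ∈ insert x T, openConn d v) ∩ (⋃ v ∈ insert x T, openConn v b))
        ≤ (prodBernoulli u).real (⋃ v ∈ insert x T, openConn v b)
          + (∑ W ∈ (Finset.univ : Finset (Finset (Fin n))).filter (fun W => Disjoint W A),
              (prodBernoulli u).real
                  {ω : BondConfig (Fin n) | ∀ z : Fin n, (z ∈ W ↔ ω ∈ ⋃ v ∈ insert x T, openConn v z)}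
                * A.inf' ⟨b, hb⟩ (fun a => (prodBernoulli u).real (openConnIn ((W : Set (Fin n))ᶜ) a b))) :=
  Summit.CriticalPhenomena.PercolationContinuityZ3.Theorems.stub_bystanderLayers_c5

/-- **STUB `stub_bystanderGood_c5` (REAL since p171607: `blockGood_insert_of_unglued`, Theorems/…BystanderGood.lean): bystander attachment at a fixed designation** — `insert x T` is `d`-good in `u` as soon as every layer
block `T ∪ B` of positive layer mass is `d`-good in the star-killed weighting `u − x`.
[cite: KozmaNitzan2024, §3.2 pp. 13–14] -/
theorem stub_bystanderGood_c5 :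
    ∀ (n : ℕ) (u : Sym2 (Fin n) → unitInterval) (A T : Finset (Fin n)) (x b d : Fin n) (hb : b ∈ A),
      x ∉ T → x ∉ A → d ≠ x →
      (∀ B : Finset (Fin n),
        (prodBernoulli u).real
          {ω : BondConfig (Fin n) | ∀ y : Fin n, y ∈ B ↔ (y ∉ ({x} : Finset (Fin n)) ∧
            ∃ o ∈ ({x} : Finset (Fin n)), s(o, y) ∈ ω)} ≠ 0 →
        (prodBernoulli (fun e : Sym2 (Fin n) => if (∃ y ∈ e, y ∈ ({x} : Finset (Fin n))) then (0 : unitInterval) else u e)).real (openConn d b)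
          + (prodBernoulli (fun e : Sym2 (Fin n) => if (∃ y ∈ e, y ∈ ({x} : Finset (Fin n))) then (0 : unitInterval) else u e)).real
              ((openConn d b)ᶜ ∩ (⋃ v ∈ T ∪ B, openConn d v) ∩ (⋃ v ∈ T ∪ B, openConn v b))
        ≤ (prodBernoulli (fun e : Sym2 (Fin n) => if (∃ y ∈ e, y ∈ ({x} : Finset (Fin n))) then (0 : unitInterval) else u e)).real (⋃ v ∈ T ∪ B, openConn v b)
          + (∑ W ∈ (Finset.univ : Finset (Finset (Fin n))).filter (fun W => Disjoint W A),
              (prodBernoulli (fun e : Sym2 (Fin n) => if (∃ y ∈ e, y ∈ ({x} : Finset (Fin n))) then (0 : unitInterval) else u e)).real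
                  {ω : BondConfig (Fin n) | ∀ z : Fin n, (z ∈ W ↔ ω ∈ ⋃ v ∈ T ∪ B, openConn v z)}
                * A.inf' ⟨b, hb⟩ (fun a => (prodBernoulli (fun e : Sym2 (Fin n) => if (∃ y ∈ e, y ∈ ({x} : Finset (Fin n))) then (0 : unitInterval) else u e)).real (openConnIn ((W : Set (Fin n))ᶜ) a b)))) →
      (prodBernoulli u).real (openConn d b)
          + (prodBernoulli u).real
              ((openConn d b)ᶜ ∩ (⋃ v ∈ insert x T, openConn d v) ∩ (⋃ v ∈ insert x T, openConn v b))
        ≤ (prodBernoulli u).real (⋃ v ∈ insert x T, openConn v b)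
          + (∑ W ∈ (Finset.univ : Finset (Finset (Fin n))).filter (fun W => Disjoint W A),
              (prodBernoulli u).real
                  {ω : BondConfig (Fin n) | ∀ z : Fin n, (z ∈ W ↔ ω ∈ ⋃ v ∈ insert x T, openConn v z)}
                * A.inf' ⟨b, hb⟩ (fun a => (prodBernoulli u).real (openConnIn ((W : Set (Fin n))ᶜ) a b))) :=
  Summit.CriticalPhenomena.PercolationContinuityZ3.Theorems.stub_bystanderGood_c5

/-- **STUB `stub_pairGamma` (skeleton v2's load-bearing stub, the RATIO form; kept registered — it implies `stub_conePeel` by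
`conePeel_of_pairGamma`, so a proof of either stub closes the crux).**  For a weighting `u`, relays `A ∋ b`, a minimiser `a₀` of `μ_u(· ↔ b)`
over `A` (the UN-GLUED weighting), a block `T ∋ s` of non-relays with positive glued deficit
`μ(T↔b) < μ(a₀↔b) + μ(a₀↮b, a₀↔T, T↔b)`, and a vertex `x ∉ A ∪ T`: in the glued weighting `u/T` (every pair inside `T` given weight 1)
the PAIR STEP holds for the 2-block `{s, x}` and the point `s`:  `K(s)·Z({s,x}) ≤ K({s,x})·Z(s)`, i.e.
`(τ(s) + Z(s) − τ(a₀))·Z(S) ≤ (μ(S↔b) + Z(S) − τ(a₀) − μ(a₀↮b, a₀↔S, S↔b))·Z(s)` with `Z` the dead-pocket mass with worst selection.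
One relay and `a₀ = b` are proved (`peel_oneRelay`, `pairStep_oneRelay`, `ratioMonotonePair_targetMin`); open core `3 ≤ A.card`.
[cite: KozmaNitzan2024, §3.2 Definition p. 12, Thms 4–5 pp. 12–14, Lemma 4 / (9) p. 9, Question 7 & 9 p. 36] -/
theorem stub_pairGamma :
    ∀ (n : ℕ) (u : Sym2 (Fin n) → unitInterval) (A T : Finset (Fin n)) (b a₀ x s : Fin n) (hb : b ∈ A),
      Disjoint T A → x ∉ A → x ∉ T → a₀ ∈ A → s ∈ T →
      (∀ a ∈ A, (prodBernoulli u).real (openConn a₀ b) ≤ (prodBernoulli u).real (openConn a b)) →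
      (prodBernoulli u).real (⋃ v ∈ T, openConn v b)
        < (prodBernoulli u).real (openConn a₀ b)
          + (prodBernoulli u).real ((openConn a₀ b)ᶜ ∩ (⋃ v ∈ T, openConn a₀ v) ∩ (⋃ v ∈ T, openConn v b)) →
      ((prodBernoulli (fun e : Sym2 (Fin n) => if (∀ y ∈ e, y ∈ T) ∧ ¬ e.IsDiag then 1 else u e)).real (openConn s b)
          + (∑ W ∈ (Finset.univ : Finset (Finset (Fin n))).filter (fun W => s ∈ W ∧ Disjoint W A),
              (prodBernoulli (fun e : Sym2 (Fin n) => if (∀ y ∈ e, y ∈ T) ∧ ¬ e.IsDiag then 1 else u e)).real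
                  {ω : BondConfig (Fin n) | openCluster ω s = (W : Set (Fin n))}
                * A.inf' ⟨b, hb⟩ (fun a =>
                    (prodBernoulli (fun e : Sym2 (Fin n) => if (∀ y ∈ e, y ∈ T) ∧ ¬ e.IsDiag then 1 else u e)).real
                      (openConnIn ((W : Set (Fin n))ᶜ) a b)))
          - (prodBernoulli (fun e : Sym2 (Fin n) => if (∀ y ∈ e, y ∈ T) ∧ ¬ e.IsDiag then 1 else u e)).real (openConn a₀ b))
        * (∑ W ∈ (Finset.univ : Finset (Finset (Fin n))).filter (fun W => Disjoint W A),
              (prodBernoulli (fun e : Sym2 (Fin n) => if (∀ y ∈ e, y ∈ T) ∧ ¬ e.IsDiag then 1 else u e)).real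
                  {ω : BondConfig (Fin n) | ∀ z : Fin n, (z ∈ W ↔ ω ∈ ⋃ v ∈ ({s, x} : Finset (Fin n)), openConn v z)}
                * A.inf' ⟨b, hb⟩ (fun a =>
                    (prodBernoulli (fun e : Sym2 (Fin n) => if (∀ y ∈ e, y ∈ T) ∧ ¬ e.IsDiag then 1 else u e)).real
                      (openConnIn ((W : Set (Fin n))ᶜ) a b)))
      ≤ ((prodBernoulli (fun e : Sym2 (Fin n) => if (∀ y ∈ e, y ∈ T) ∧ ¬ e.IsDiag then 1 else u e)).real
              (⋃ v ∈ ({s, x} : Finset (Fin n)), openConn v b)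
          + (∑ W ∈ (Finset.univ : Finset (Finset (Fin n))).filter (fun W => Disjoint W A),
              (prodBernoulli (fun e : Sym2 (Fin n) => if (∀ y ∈ e, y ∈ T) ∧ ¬ e.IsDiag then 1 else u e)).real
                  {ω : BondConfig (Fin n) | ∀ z : Fin n, (z ∈ W ↔ ω ∈ ⋃ v ∈ ({s, x} : Finset (Fin n)), openConn v z)}
                * A.inf' ⟨b, hb⟩ (fun a =>
                    (prodBernoulli (fun e : Sym2 (Fin n) => if (∀ y ∈ e, y ∈ T) ∧ ¬ e.IsDiag then 1 else u e)).real
                      (openConnIn ((W : Set (Fin n))ᶜ) a b)))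
          - (prodBernoulli (fun e : Sym2 (Fin n) => if (∀ y ∈ e, y ∈ T) ∧ ¬ e.IsDiag then 1 else u e)).real (openConn a₀ b)
          - (prodBernoulli (fun e : Sym2 (Fin n) => if (∀ y ∈ e, y ∈ T) ∧ ¬ e.IsDiag then 1 else u e)).real
              ((openConn a₀ b)ᶜ ∩ (⋃ v ∈ ({s, x} : Finset (Fin n)), openConn a₀ v)
                ∩ (⋃ v ∈ ({s, x} : Finset (Fin n)), openConn v b)))
        * (∑ W ∈ (Finset.univ : Finset (Finset (Fin n))).filter (fun W => s ∈ W ∧ Disjoint W A),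
              (prodBernoulli (fun e : Sym2 (Fin n) => if (∀ y ∈ e, y ∈ T) ∧ ¬ e.IsDiag then 1 else u e)).real
                  {ω : BondConfig (Fin n) | openCluster ω s = (W : Set (Fin n))}
                * A.inf' ⟨b, hb⟩ (fun a =>
                    (prodBernoulli (fun e : Sym2 (Fin n) => if (∀ y ∈ e, y ∈ T) ∧ ¬ e.IsDiag then 1 else u e)).real
                      (openConnIn ((W : Set (Fin n))ᶜ) a b))) := by
  sorry

/-! ## Real proofs -/

variable {n : ℕ}

/-- A block containing the target is good at every designation (its reach is `1`). [folklore] -/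
theorem blockGood_of_target_mem (u : Sym2 (Fin n) → unitInterval) (A S : Finset (Fin n)) (b d : Fin n) (hb : b ∈ A)
    (hbS : b ∈ S) :
    (prodBernoulli u).real (openConn d b)
          + (prodBernoulli u).real
              ((openConn d b)ᶜ ∩ (⋃ v ∈ S, openConn d v) ∩ (⋃ v ∈ S, openConn v b))
        ≤ (prodBernoulli u).real (⋃ v ∈ S, openConn v b)
          + (∑ W ∈ (Finset.univ : Finset (Finset (Fin n))).filter (fun W => Disjoint W A),
              (prodBernoulli u).real
                  {ω : BondConfig (Fin n) | ∀ z : Fin n, (z ∈ W ↔ ω ∈ ⋃ v ∈ S, openConn v z)}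
                * A.inf' ⟨b, hb⟩ (fun a => (prodBernoulli u).real (openConnIn ((W : Set (Fin n))ᶜ) a b))) := by
  have h1 : (prodBernoulli u).real (⋃ v ∈ S, openConn v b) = 1 := by
    have : (⋃ v ∈ S, (openConn v b : Set (BondConfig (Fin n)))) = Set.univ := by
      refine Set.eq_univ_of_forall fun ω => Set.mem_iUnion₂.2 ⟨b, hbS, ?_⟩
      exact (SimpleGraph.Reachable.refl b : (openGraph ω).Reachable b b)
    rw [this, probReal_univ]
  have h2 : (prodBernoulli u).real (openConn d b)
          + (prodBernoulli u).real
              ((openConn d b)ᶜ ∩ (⋃ v ∈ S, openConn d v) ∩ (⋃ v ∈ S, openConn v b)) ≤ 1 := by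
    rw [← measureReal_union (Set.disjoint_left.2 fun ω hω hω' => hω'.1.1 hω) MeasurableSet.of_discrete]
    exact measureReal_le_one
  have hinf_nonneg : ∀ W : Finset (Fin n),
      0 ≤ A.inf' ⟨b, hb⟩ (fun a => (prodBernoulli u).real (openConnIn ((W : Set (Fin n))ᶜ) a b)) :=
    fun W => Finset.le_inf' _ _ fun a _ => measureReal_nonneg
  have h3 : 0 ≤ (∑ W ∈ (Finset.univ : Finset (Finset (Fin n))).filter (fun W => Disjoint W A),
              (prodBernoulli u).real
                  {ω : BondConfig (Fin n) | ∀ z : Fin n, (z ∈ W ↔ ω ∈ ⋃ v ∈ S, openConn v z)}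
                * A.inf' ⟨b, hb⟩ (fun a => (prodBernoulli u).real (openConnIn ((W : Set (Fin n))ᶜ) a b))) :=
    Finset.sum_nonneg fun W _ => mul_nonneg measureReal_nonneg (hinf_nonneg W)
  linarith

/-- **The cone chain inside ONE weighting** (as `coneLine_blockGood`, with the cone steps of this weighting handed in): block
goodness (worst selection) of a bad block `S ∋ s` at a minimiser `a₀`, from point goodness of `s` (the induction hypothesis) and the
cone steps of `u` at `a₀`. [cite: KozmaNitzan2024, §3.2 pp. 12–14] -/
theorem coneChain_local (u : Sym2 (Fin n) → unitInterval) (A S : Finset (Fin n)) (b a₀ s : Fin n) (hb : b ∈ A)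
    (hSA : Disjoint S A) (hs : s ∈ S)
    (hmin : (∀ a ∈ A, (prodBernoulli u).real (openConn a₀ b) ≤ (prodBernoulli u).real (openConn a b)))
    (hbad : ∀ v ∈ S, (prodBernoulli u).real (openConn v b) < (prodBernoulli u).real (openConn a₀ b))
    (hIH : (∀ w' : Sym2 (Fin n) → unitInterval,
        (Finset.univ.filter (fun v : Fin n => ∃ y : Fin n, 0 < (w' s(y, v) : ℝ))).card
          ≤ (Finset.univ.filter (fun v : Fin n => ∃ y : Fin n, 0 < (u s(y, v) : ℝ))).card →
        ∀ (A' : Finset (Fin n)) (o' b' : Fin n), b' ∈ A' → o' ∉ A' →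
        ∀ (t : ℝ) (sel : Finset (Fin n) → Fin n), (∀ W, sel W ∈ A') →
          (∀ a ∈ A', 1 - t ≤ (prodBernoulli w').real (openConn a b')) →
          (prodBernoulli w').real ((⋃ a ∈ A', openConn o' a) ∩ (openConn o' b')ᶜ)
            + ∑ W ∈ (Finset.univ : Finset (Finset (Fin n))).filter (fun W => o' ∈ W ∧ Disjoint W A'),
                (prodBernoulli w').real {ω : BondConfig (Fin n) | openCluster ω o' = (W : Set (Fin n))}
                  * (prodBernoulli w').real (openConnIn ((W : Set (Fin n))ᶜ) (sel W) b')ᶜ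
            ≤ t))
    (hconeU : ∀ (T : Finset (Fin n)) (x : Fin n), Disjoint T A → T.Nonempty → x ∉ A → x ∉ T →
      (∀ v ∈ insert x T, (prodBernoulli u).real (openConn v b) < (prodBernoulli u).real (openConn a₀ b)) →
      (prodBernoulli u).real (openConn a₀ b)
          + (prodBernoulli u).real
              ((openConn a₀ b)ᶜ ∩ (⋃ v ∈ T, openConn a₀ v) ∩ (⋃ v ∈ T, openConn v b))
        ≤ (prodBernoulli u).real (⋃ v ∈ T, openConn v b)
          + (∑ W ∈ (Finset.univ : Finset (Finset (Fin n))).filter (fun W => Disjoint W A),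
              (prodBernoulli u).real
                  {ω : BondConfig (Fin n) | ∀ z : Fin n, (z ∈ W ↔ ω ∈ ⋃ v ∈ T, openConn v z)}
                * A.inf' ⟨b, hb⟩ (fun a => (prodBernoulli u).real (openConnIn ((W : Set (Fin n))ᶜ) a b))) →
      (prodBernoulli u).real (openConn a₀ b)
          + (prodBernoulli u).real
              ((openConn a₀ b)ᶜ ∩ (⋃ v ∈ insert x T, openConn a₀ v) ∩ (⋃ v ∈ insert x T, openConn v b))
        ≤ (prodBernoulli u).real (⋃ v ∈ insert x T, openConn v b)
          + (∑ W ∈ (Finset.univ : Finset (Finset (Fin n))).filter (fun W => Disjoint W A),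
              (prodBernoulli u).real
                  {ω : BondConfig (Fin n) | ∀ z : Fin n, (z ∈ W ↔ ω ∈ ⋃ v ∈ insert x T, openConn v z)}
                * A.inf' ⟨b, hb⟩ (fun a => (prodBernoulli u).real (openConnIn ((W : Set (Fin n))ᶜ) a b)))) :
    (prodBernoulli u).real (openConn a₀ b)
          + (prodBernoulli u).real
              ((openConn a₀ b)ᶜ ∩ (⋃ v ∈ S, openConn a₀ v) ∩ (⋃ v ∈ S, openConn v b))
        ≤ (prodBernoulli u).real (⋃ v ∈ S, openConn v b)
          + (∑ W ∈ (Finset.univ : Finset (Finset (Fin n))).filter (fun W => Disjoint W A),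
              (prodBernoulli u).real
                  {ω : BondConfig (Fin n) | ∀ z : Fin n, (z ∈ W ↔ ω ∈ ⋃ v ∈ S, openConn v z)}
                * A.inf' ⟨b, hb⟩ (fun a => (prodBernoulli u).real (openConnIn ((W : Set (Fin n))ᶜ) a b))) := by
  have hsA : s ∉ A := Finset.disjoint_left.1 hSA hs
  -- point goodness of `s` (worst selection) from the induction hypothesis applied to `u` itself
  have hex : ∀ W : Finset (Fin n), ∃ a, a ∈ A ∧
      A.inf' ⟨b, hb⟩ (fun a => (prodBernoulli u).real (openConnIn ((W : Set (Fin n))ᶜ) a b)) =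
        (prodBernoulli u).real (openConnIn ((W : Set (Fin n))ᶜ) a b) :=
    fun W => Finset.exists_mem_eq_inf' ⟨b, hb⟩ _
  choose selm hselmA hselm using hex
  have hpt := hIH u le_rfl A s b hb hsA (1 - (prodBernoulli u).real (openConn a₀ b)) selm hselmA
    (fun a ha => by linarith [hmin a ha])
  rw [goodStep24_functional_eq u A s b hb selm] at hpt
  have hZpt_eq : ∑ W ∈ (Finset.univ : Finset (Finset (Fin n))).filter (fun W => s ∈ W ∧ Disjoint W A),
      (prodBernoulli u).real {ω : BondConfig (Fin n) | openCluster ω s = (W : Set (Fin n))}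
        * (prodBernoulli u).real (openConnIn ((W : Set (Fin n))ᶜ) (selm W) b)
      = (∑ W ∈ (Finset.univ : Finset (Finset (Fin n))).filter (fun W => s ∈ W ∧ Disjoint W A),
          (prodBernoulli u).real {ω : BondConfig (Fin n) | openCluster ω s = (W : Set (Fin n))}
            * A.inf' ⟨b, hb⟩ (fun a => (prodBernoulli u).real (openConnIn ((W : Set (Fin n))ᶜ) a b))) := by
    refine Finset.sum_congr rfl fun W _ => ?_
    rw [hselm W]
  rw [hZpt_eq] at hpt
  have hpoint : (prodBernoulli u).real (openConn a₀ b) ≤ (prodBernoulli u).real (openConn s b)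
      + (∑ W ∈ (Finset.univ : Finset (Finset (Fin n))).filter (fun W => s ∈ W ∧ Disjoint W A),
          (prodBernoulli u).real {ω : BondConfig (Fin n) | openCluster ω s = (W : Set (Fin n))}
            * A.inf' ⟨b, hb⟩ (fun a => (prodBernoulli u).real (openConnIn ((W : Set (Fin n))ᶜ) a b))) := by
    linarith
  -- the chain over sub-blocks `T ∋ s` of `S`
  have hchain : ∀ (m : ℕ) (T : Finset (Fin n)), T ⊆ S → s ∈ T → T.card = m →
      (prodBernoulli u).real (openConn a₀ b)
          + (prodBernoulli u).real
              ((openConn a₀ b)ᶜ ∩ (⋃ v ∈ T, openConn a₀ v) ∩ (⋃ v ∈ T, openConn v b))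
        ≤ (prodBernoulli u).real (⋃ v ∈ T, openConn v b)
          + (∑ W ∈ (Finset.univ : Finset (Finset (Fin n))).filter (fun W => Disjoint W A),
              (prodBernoulli u).real
                  {ω : BondConfig (Fin n) | ∀ z : Fin n, (z ∈ W ↔ ω ∈ ⋃ v ∈ T, openConn v z)}
                * A.inf' ⟨b, hb⟩ (fun a => (prodBernoulli u).real (openConnIn ((W : Set (Fin n))ᶜ) a b))) := by
    intro m
    induction m using Nat.strong_induction_on with
    | _ m ih =>
      intro T hTS hsT hTm
      by_cases hT1 : T.card = 1
      · obtain ⟨y, hy⟩ := Finset.card_eq_one.1 hT1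
        have hys : y = s := by
          have : s ∈ ({y} : Finset (Fin n)) := hy ▸ hsT
          exact (Finset.mem_singleton.1 this).symm
        subst hys
        rw [hy]
        exact coneLine_blockGood_singleton u A b a₀ y hb hpoint
      · have hT2 : 2 ≤ T.card := by
          have h0 : 0 < T.card := Finset.card_pos.2 ⟨s, hsT⟩
          omega
        obtain ⟨x, hx⟩ : ∃ x, x ∈ T.erase s :=
          Finset.card_pos.1 (by rw [Finset.card_erase_of_mem hsT]; omega)
        have hxT : x ∈ T := Finset.mem_of_mem_erase hx
        have hxs : x ≠ s := Finset.ne_of_mem_erase hx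
        have hsub : T.erase x ⊆ S := (Finset.erase_subset x T).trans hTS
        have hsT' : s ∈ T.erase x := Finset.mem_erase.2 ⟨hxs.symm, hsT⟩
        have hcard' : (T.erase x).card = T.card - 1 := Finset.card_erase_of_mem hxT
        have IH := ih (T.card - 1) (by omega) (T.erase x) hsub hsT' hcard'
        have hTA' : Disjoint (T.erase x) A := Finset.disjoint_of_subset_left hsub hSA
        have hxA : x ∉ A := Finset.disjoint_left.1 hSA (hTS hxT)
        have hxT' : x ∉ T.erase x := Finset.notMem_erase x T
        have hins : insert x (T.erase x) = T := Finset.insert_erase hxT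
        have hbad' : ∀ v ∈ insert x (T.erase x),
            (prodBernoulli u).real (openConn v b) < (prodBernoulli u).real (openConn a₀ b) :=
          fun v hv => hbad v (hTS (hins ▸ hv))
        have h := hconeU (T.erase x) x hTA' ⟨s, hsT'⟩ hxA hxT' hbad' IH
        rw [hins] at h
        exact h
  exact hchain S.card S (subset_refl S) hs rfl

/-- **The cone step from bystander attachment and the double-drift stub** (strong induction on the number of positive-degree
vertices).  Isolated bystander: the only positive layer is `B = ∅` and `u − x = u`.  Otherwise, for EVERY non-isolated vertex `x'` of
`insert x T` and every minimiser `a'` of `μ_{u−x'}(· ↔ b)`, every layer block `((insert x T).erase x') ∪ B` is `a'`-good in `u − x'`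
(target inside: trivial; a vertex at least as reliable as `a'`: the Lemma-5 leaf; all below `a'`: the cone chain in `u − x'`, whose
steps are induction-hypothesis instances), so `insert x T` is `a'`-good in `u`; if for one such pair `τ_{u/(T∪x)}(a₀) ≤ τ_{u/(T∪x)}(a')`
we are done, else the double-drift stub applies. [cite: KozmaNitzan2024, §3.2 pp. 12–14] -/
theorem conePeel_of_doubleDrift
    (hInsert : ∀ (n : ℕ) (u : Sym2 (Fin n) → unitInterval) (A T : Finset (Fin n)) (x b d : Fin n) (hb : b ∈ A),
      x ∉ T → x ∉ A → d ≠ x →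
      (∀ B : Finset (Fin n),
        (prodBernoulli u).real
          {ω : BondConfig (Fin n) | ∀ y : Fin n, y ∈ B ↔ (y ∉ ({x} : Finset (Fin n)) ∧
            ∃ o ∈ ({x} : Finset (Fin n)), s(o, y) ∈ ω)} ≠ 0 →
        (prodBernoulli (fun e : Sym2 (Fin n) => if (∃ y ∈ e, y ∈ ({x} : Finset (Fin n))) then (0 : unitInterval) else u e)).real (openConn d b)
          + (prodBernoulli (fun e : Sym2 (Fin n) => if (∃ y ∈ e, y ∈ ({x} : Finset (Fin n))) then (0 : unitInterval) else u e)).real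
              ((openConn d b)ᶜ ∩ (⋃ v ∈ T ∪ B, openConn d v) ∩ (⋃ v ∈ T ∪ B, openConn v b))
        ≤ (prodBernoulli (fun e : Sym2 (Fin n) => if (∃ y ∈ e, y ∈ ({x} : Finset (Fin n))) then (0 : unitInterval) else u e)).real (⋃ v ∈ T ∪ B, openConn v b)
          + (∑ W ∈ (Finset.univ : Finset (Finset (Fin n))).filter (fun W => Disjoint W A),
              (prodBernoulli (fun e : Sym2 (Fin n) => if (∃ y ∈ e, y ∈ ({x} : Finset (Fin n))) then (0 : unitInterval) else u e)).real
                  {ω : BondConfig (Fin n) | ∀ z : Fin n, (z ∈ W ↔ ω ∈ ⋃ v ∈ T ∪ B, openConn v z)}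
                * A.inf' ⟨b, hb⟩ (fun a => (prodBernoulli (fun e : Sym2 (Fin n) => if (∃ y ∈ e, y ∈ ({x} : Finset (Fin n))) then (0 : unitInterval) else u e)).real (openConnIn ((W : Set (Fin n))ᶜ) a b)))) →
      (prodBernoulli u).real (openConn d b)
          + (prodBernoulli u).real
              ((openConn d b)ᶜ ∩ (⋃ v ∈ insert x T, openConn d v) ∩ (⋃ v ∈ insert x T, openConn v b))
        ≤ (prodBernoulli u).real (⋃ v ∈ insert x T, openConn v b)
          + (∑ W ∈ (Finset.univ : Finset (Finset (Fin n))).filter (fun W => Disjoint W A),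
              (prodBernoulli u).real
                  {ω : BondConfig (Fin n) | ∀ z : Fin n, (z ∈ W ↔ ω ∈ ⋃ v ∈ insert x T, openConn v z)}
                * A.inf' ⟨b, hb⟩ (fun a => (prodBernoulli u).real (openConnIn ((W : Set (Fin n))ᶜ) a b))))
    (hDD : ∀ (n : ℕ) (u : Sym2 (Fin n) → unitInterval) (A T : Finset (Fin n)) (b a₀ x : Fin n) (hb : b ∈ A),
      Disjoint T A → T.Nonempty → x ∉ A → x ∉ T → a₀ ∈ A → 4 ≤ A.card →
      (∀ a ∈ A, (prodBernoulli u).real (openConn a₀ b) ≤ (prodBernoulli u).real (openConn a b)) →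
      (∀ v ∈ insert x T, (prodBernoulli u).real (openConn v b) < (prodBernoulli u).real (openConn a₀ b)) →
      (∀ w' : Sym2 (Fin n) → unitInterval,
        (Finset.univ.filter (fun v : Fin n => ∃ y : Fin n, 0 < (w' s(y, v) : ℝ))).card
          ≤ (Finset.univ.filter (fun v : Fin n => ∃ y : Fin n, 0 < (u s(y, v) : ℝ))).card →
        ∀ (A' : Finset (Fin n)) (o' b' : Fin n), b' ∈ A' → o' ∉ A' →
        ∀ (t : ℝ) (sel : Finset (Fin n) → Fin n), (∀ W, sel W ∈ A') →
          (∀ a ∈ A', 1 - t ≤ (prodBernoulli w').real (openConn a b')) →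
          (prodBernoulli w').real ((⋃ a ∈ A', openConn o' a) ∩ (openConn o' b')ᶜ)
            + ∑ W ∈ (Finset.univ : Finset (Finset (Fin n))).filter (fun W => o' ∈ W ∧ Disjoint W A'),
                (prodBernoulli w').real {ω : BondConfig (Fin n) | openCluster ω o' = (W : Set (Fin n))}
                  * (prodBernoulli w').real (openConnIn ((W : Set (Fin n))ᶜ) (sel W) b')ᶜ
            ≤ t) →
      (prodBernoulli u).real (openConn a₀ b)
          + (prodBernoulli u).real
              ((openConn a₀ b)ᶜ ∩ (⋃ v ∈ T, openConn a₀ v) ∩ (⋃ v ∈ T, openConn v b))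
        ≤ (prodBernoulli u).real (⋃ v ∈ T, openConn v b)
          + (∑ W ∈ (Finset.univ : Finset (Finset (Fin n))).filter (fun W => Disjoint W A),
              (prodBernoulli u).real
                  {ω : BondConfig (Fin n) | ∀ z : Fin n, (z ∈ W ↔ ω ∈ ⋃ v ∈ T, openConn v z)}
                * A.inf' ⟨b, hb⟩ (fun a => (prodBernoulli u).real (openConnIn ((W : Set (Fin n))ᶜ) a b))) →
      (∀ x' ∈ insert x T, ∀ y₀ : Fin n, (u s(x', y₀) : ℝ) ≠ 0 → ∀ a' ∈ A,
        (∀ a ∈ A, (prodBernoulli (fun e : Sym2 (Fin n) => if (∃ y ∈ e, y ∈ ({x'} : Finset (Fin n))) then (0 : unitInterval) else u e)).real (openConn a' b) ≤ (prodBernoulli (fun e : Sym2 (Fin n) => if (∃ y ∈ e, y ∈ ({x'} : Finset (Fin n))) then (0 : unitInterval) else u e)).real (openConn a b)) →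
        (prodBernoulli u).real (openConn a' b)
            + (prodBernoulli u).real ((openConn a' b)ᶜ ∩ (⋃ v ∈ insert x T, openConn a' v) ∩ (⋃ v ∈ insert x T, openConn v b))
          < (prodBernoulli u).real (openConn a₀ b)
            + (prodBernoulli u).real ((openConn a₀ b)ᶜ ∩ (⋃ v ∈ insert x T, openConn a₀ v) ∩ (⋃ v ∈ insert x T, openConn v b))) →
      (∀ x' ∈ insert x T, ∀ y₀ : Fin n, (u s(x', y₀) : ℝ) ≠ 0 → ∀ a' ∈ A,
        (∀ a ∈ A, (prodBernoulli (fun e : Sym2 (Fin n) => if (∃ y ∈ e, y ∈ ({x'} : Finset (Fin n))) then (0 : unitInterval) else u e)).real (openConn a' b) ≤ (prodBernoulli (fun e : Sym2 (Fin n) => if (∃ y ∈ e, y ∈ ({x'} : Finset (Fin n))) then (0 : unitInterval) else u e)).real (openConn a b)) →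
        (prodBernoulli u).real (openConn a' b)
          + (prodBernoulli u).real
              ((openConn a' b)ᶜ ∩ (⋃ v ∈ insert x T, openConn a' v) ∩ (⋃ v ∈ insert x T, openConn v b))
        ≤ (prodBernoulli u).real (⋃ v ∈ insert x T, openConn v b)
          + (∑ W ∈ (Finset.univ : Finset (Finset (Fin n))).filter (fun W => Disjoint W A),
              (prodBernoulli u).real
                  {ω : BondConfig (Fin n) | ∀ z : Fin n, (z ∈ W ↔ ω ∈ ⋃ v ∈ insert x T, openConn v z)}
                * A.inf' ⟨b, hb⟩ (fun a => (prodBernoulli u).real (openConnIn ((W : Set (Fin n))ᶜ) a b)))) →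
      (prodBernoulli u).real (openConn a₀ b)
          + (prodBernoulli u).real
              ((openConn a₀ b)ᶜ ∩ (⋃ v ∈ insert x T, openConn a₀ v) ∩ (⋃ v ∈ insert x T, openConn v b))
        ≤ (prodBernoulli u).real (⋃ v ∈ insert x T, openConn v b)
          + (∑ W ∈ (Finset.univ : Finset (Finset (Fin n))).filter (fun W => Disjoint W A),
              (prodBernoulli u).real
                  {ω : BondConfig (Fin n) | ∀ z : Fin n, (z ∈ W ↔ ω ∈ ⋃ v ∈ insert x T, openConn v z)}
                * A.inf' ⟨b, hb⟩ (fun a => (prodBernoulli u).real (openConnIn ((W : Set (Fin n))ᶜ) a b)))) :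
    ∀ (n : ℕ) (u : Sym2 (Fin n) → unitInterval) (A T : Finset (Fin n)) (b a₀ x : Fin n) (hb : b ∈ A),
      Disjoint T A → T.Nonempty → x ∉ A → x ∉ T → a₀ ∈ A → 4 ≤ A.card →
      (∀ a ∈ A, (prodBernoulli u).real (openConn a₀ b) ≤ (prodBernoulli u).real (openConn a b)) →
      (∀ v ∈ insert x T, (prodBernoulli u).real (openConn v b) < (prodBernoulli u).real (openConn a₀ b)) →
      (∀ w' : Sym2 (Fin n) → unitInterval,
        (Finset.univ.filter (fun v : Fin n => ∃ y : Fin n, 0 < (w' s(y, v) : ℝ))).card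
          ≤ (Finset.univ.filter (fun v : Fin n => ∃ y : Fin n, 0 < (u s(y, v) : ℝ))).card →
        ∀ (A' : Finset (Fin n)) (o' b' : Fin n), b' ∈ A' → o' ∉ A' →
        ∀ (t : ℝ) (sel : Finset (Fin n) → Fin n), (∀ W, sel W ∈ A') →
          (∀ a ∈ A', 1 - t ≤ (prodBernoulli w').real (openConn a b')) →
          (prodBernoulli w').real ((⋃ a ∈ A', openConn o' a) ∩ (openConn o' b')ᶜ)
            + ∑ W ∈ (Finset.univ : Finset (Finset (Fin n))).filter (fun W => o' ∈ W ∧ Disjoint W A'),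
                (prodBernoulli w').real {ω : BondConfig (Fin n) | openCluster ω o' = (W : Set (Fin n))}
                  * (prodBernoulli w').real (openConnIn ((W : Set (Fin n))ᶜ) (sel W) b')ᶜ
            ≤ t) →
      (prodBernoulli u).real (openConn a₀ b)
          + (prodBernoulli u).real
              ((openConn a₀ b)ᶜ ∩ (⋃ v ∈ T, openConn a₀ v) ∩ (⋃ v ∈ T, openConn v b))
        ≤ (prodBernoulli u).real (⋃ v ∈ T, openConn v b)
          + (∑ W ∈ (Finset.univ : Finset (Finset (Fin n))).filter (fun W => Disjoint W A),
              (prodBernoulli u).real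
                  {ω : BondConfig (Fin n) | ∀ z : Fin n, (z ∈ W ↔ ω ∈ ⋃ v ∈ T, openConn v z)}
                * A.inf' ⟨b, hb⟩ (fun a => (prodBernoulli u).real (openConnIn ((W : Set (Fin n))ᶜ) a b))) →
      (prodBernoulli u).real (openConn a₀ b)
          + (prodBernoulli u).real
              ((openConn a₀ b)ᶜ ∩ (⋃ v ∈ insert x T, openConn a₀ v) ∩ (⋃ v ∈ insert x T, openConn v b))
        ≤ (prodBernoulli u).real (⋃ v ∈ insert x T, openConn v b)
          + (∑ W ∈ (Finset.univ : Finset (Finset (Fin n))).filter (fun W => Disjoint W A),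
              (prodBernoulli u).real
                  {ω : BondConfig (Fin n) | ∀ z : Fin n, (z ∈ W ↔ ω ∈ ⋃ v ∈ insert x T, openConn v z)}
                * A.inf' ⟨b, hb⟩ (fun a => (prodBernoulli u).real (openConnIn ((W : Set (Fin n))ᶜ) a b))) := by
  intro n
  suffices key : ∀ (N : ℕ) (u : Sym2 (Fin n) → unitInterval),
      (Finset.univ.filter (fun v : Fin n => ∃ y : Fin n, 0 < (u s(y, v) : ℝ))).card = N →
      ∀ (A T : Finset (Fin n)) (b a₀ x : Fin n) (hb : b ∈ A),
      Disjoint T A → T.Nonempty → x ∉ A → x ∉ T → a₀ ∈ A → 4 ≤ A.card →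
      (∀ a ∈ A, (prodBernoulli u).real (openConn a₀ b) ≤ (prodBernoulli u).real (openConn a b)) →
      (∀ v ∈ insert x T, (prodBernoulli u).real (openConn v b) < (prodBernoulli u).real (openConn a₀ b)) →
      (∀ w' : Sym2 (Fin n) → unitInterval,
        (Finset.univ.filter (fun v : Fin n => ∃ y : Fin n, 0 < (w' s(y, v) : ℝ))).card
          ≤ (Finset.univ.filter (fun v : Fin n => ∃ y : Fin n, 0 < (u s(y, v) : ℝ))).card →
        ∀ (A' : Finset (Fin n)) (o' b' : Fin n), b' ∈ A' → o' ∉ A' →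
        ∀ (t : ℝ) (sel : Finset (Fin n) → Fin n), (∀ W, sel W ∈ A') →
          (∀ a ∈ A', 1 - t ≤ (prodBernoulli w').real (openConn a b')) →
          (prodBernoulli w').real ((⋃ a ∈ A', openConn o' a) ∩ (openConn o' b')ᶜ)
            + ∑ W ∈ (Finset.univ : Finset (Finset (Fin n))).filter (fun W => o' ∈ W ∧ Disjoint W A'),
                (prodBernoulli w').real {ω : BondConfig (Fin n) | openCluster ω o' = (W : Set (Fin n))}
                  * (prodBernoulli w').real (openConnIn ((W : Set (Fin n))ᶜ) (sel W) b')ᶜ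
            ≤ t) →
      (prodBernoulli u).real (openConn a₀ b)
          + (prodBernoulli u).real
              ((openConn a₀ b)ᶜ ∩ (⋃ v ∈ T, openConn a₀ v) ∩ (⋃ v ∈ T, openConn v b))
        ≤ (prodBernoulli u).real (⋃ v ∈ T, openConn v b)
          + (∑ W ∈ (Finset.univ : Finset (Finset (Fin n))).filter (fun W => Disjoint W A),
              (prodBernoulli u).real
                  {ω : BondConfig (Fin n) | ∀ z : Fin n, (z ∈ W ↔ ω ∈ ⋃ v ∈ T, openConn v z)}
                * A.inf' ⟨b, hb⟩ (fun a => (prodBernoulli u).real (openConnIn ((W : Set (Fin n))ᶜ) a b))) →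
      (prodBernoulli u).real (openConn a₀ b)
          + (prodBernoulli u).real
              ((openConn a₀ b)ᶜ ∩ (⋃ v ∈ insert x T, openConn a₀ v) ∩ (⋃ v ∈ insert x T, openConn v b))
        ≤ (prodBernoulli u).real (⋃ v ∈ insert x T, openConn v b)
          + (∑ W ∈ (Finset.univ : Finset (Finset (Fin n))).filter (fun W => Disjoint W A),
              (prodBernoulli u).real
                  {ω : BondConfig (Fin n) | ∀ z : Fin n, (z ∈ W ↔ ω ∈ ⋃ v ∈ insert x T, openConn v z)}
                * A.inf' ⟨b, hb⟩ (fun a => (prodBernoulli u).real (openConnIn ((W : Set (Fin n))ᶜ) a b))) by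
    intro u A T b a₀ x hb
    exact key _ u rfl A T b a₀ x hb
  intro N
  induction N using Nat.strong_induction_on with
  | _ N ih =>
    intro u hN A T b a₀ x hb hTA hT hxA hxT ha₀ hA4 hmin hbad hIH hTgood
    obtain ⟨s₀, hs₀⟩ := hT
    have ha₀x : a₀ ≠ x := fun h => hxA (h ▸ ha₀)
    have hSA : Disjoint (insert x T) A := Finset.disjoint_insert_left.2 ⟨hxA, hTA⟩
    -- the star-killed weightings, in the two syntactic forms used by the tree
    have hvK : ∀ x' : Fin n, (fun e : Sym2 (Fin n) => if (∃ y ∈ e, y ∈ ({x'} : Finset (Fin n))) then (0 : unitInterval) else u e)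
        = fun e : Sym2 (Fin n) => if x' ∈ e then (0 : unitInterval) else u e := by
      intro x'
      funext e
      by_cases hxe : x' ∈ e
      · rw [if_pos hxe, if_pos ⟨x', hxe, Finset.mem_singleton_self x'⟩]
      · rw [if_neg hxe, if_neg]
        rintro ⟨y, hy, hyx⟩
        exact hxe ((Finset.mem_singleton.1 hyx) ▸ hy)
    -- THE BYSTANDER ROUTE through an arbitrary non-isolated vertex `x'` of the block
    have route : ∀ x' ∈ insert x T, ∀ y₀ : Fin n, (u s(x', y₀) : ℝ) ≠ 0 → ∀ a' ∈ A,
        (∀ a ∈ A, (prodBernoulli (fun e : Sym2 (Fin n) => if (∃ y ∈ e, y ∈ ({x'} : Finset (Fin n))) then (0 : unitInterval) else u e)).real (openConn a' b) ≤ (prodBernoulli (fun e : Sym2 (Fin n) => if (∃ y ∈ e, y ∈ ({x'} : Finset (Fin n))) then (0 : unitInterval) else u e)).real (openConn a b)) →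
        (prodBernoulli u).real (openConn a' b)
          + (prodBernoulli u).real
              ((openConn a' b)ᶜ ∩ (⋃ v ∈ insert x T, openConn a' v) ∩ (⋃ v ∈ insert x T, openConn v b))
        ≤ (prodBernoulli u).real (⋃ v ∈ insert x T, openConn v b)
          + (∑ W ∈ (Finset.univ : Finset (Finset (Fin n))).filter (fun W => Disjoint W A),
              (prodBernoulli u).real
                  {ω : BondConfig (Fin n) | ∀ z : Fin n, (z ∈ W ↔ ω ∈ ⋃ v ∈ insert x T, openConn v z)}
                * A.inf' ⟨b, hb⟩ (fun a => (prodBernoulli u).real (openConnIn ((W : Set (Fin n))ᶜ) a b))) := by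
      intro x' hx' y₀ hy₀ a' ha'A ha'min
      have hx'A : x' ∉ A := Finset.disjoint_left.1 hSA hx'
      have ha'x : a' ≠ x' := fun h => hx'A (h ▸ ha'A)
      have hins : insert x' ((insert x T).erase x') = insert x T := Finset.insert_erase hx'
      have hx'T' : x' ∉ (insert x T).erase x' := Finset.notMem_erase x' _
      -- a second vertex of the block
      have hT'ne : ((insert x T).erase x').Nonempty := by
        rw [← Finset.card_pos, Finset.card_erase_of_mem hx', Finset.card_insert_of_notMem hxT]
        have : 0 < T.card := Finset.card_pos.2 ⟨s₀, hs₀⟩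
        omega
      obtain ⟨s₁, hs₁⟩ := hT'ne
      have hlt : (Finset.univ.filter (fun v : Fin n => ∃ y : Fin n, 0 < ((fun e : Sym2 (Fin n) => if (∃ y ∈ e, y ∈ ({x'} : Finset (Fin n))) then (0 : unitInterval) else u e) s(y, v) : ℝ))).card
          < (Finset.univ.filter (fun v : Fin n => ∃ y : Fin n, 0 < (u s(y, v) : ℝ))).card := by
        rw [hvK x']
        exact goodStep_card_lt u hy₀
      have hIHv : ∀ w' : Sym2 (Fin n) → unitInterval,
          (Finset.univ.filter (fun v : Fin n => ∃ y : Fin n, 0 < (w' s(y, v) : ℝ))).card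
            ≤ (Finset.univ.filter (fun v : Fin n => ∃ y : Fin n, 0 < ((fun e : Sym2 (Fin n) => if (∃ y ∈ e, y ∈ ({x'} : Finset (Fin n))) then (0 : unitInterval) else u e) s(y, v) : ℝ))).card →
          ∀ (A' : Finset (Fin n)) (o' b' : Fin n), b' ∈ A' → o' ∉ A' →
          ∀ (t : ℝ) (sel : Finset (Fin n) → Fin n), (∀ W, sel W ∈ A') →
            (∀ a ∈ A', 1 - t ≤ (prodBernoulli w').real (openConn a b')) →
            (prodBernoulli w').real ((⋃ a ∈ A', openConn o' a) ∩ (openConn o' b')ᶜ)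
              + ∑ W ∈ (Finset.univ : Finset (Finset (Fin n))).filter (fun W => o' ∈ W ∧ Disjoint W A'),
                  (prodBernoulli w').real {ω : BondConfig (Fin n) | openCluster ω o' = (W : Set (Fin n))}
                    * (prodBernoulli w').real (openConnIn ((W : Set (Fin n))ᶜ) (sel W) b')ᶜ
              ≤ t :=
        fun w' hw' => hIH w' (hw'.trans hlt.le)
      -- cone steps of `u − x'` at `a'`: induction-hypothesis instances
      have hconeV : ∀ (T' : Finset (Fin n)) (x'' : Fin n), Disjoint T' A → T'.Nonempty → x'' ∉ A → x'' ∉ T' →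
          (∀ v ∈ insert x'' T', (prodBernoulli (fun e : Sym2 (Fin n) => if (∃ y ∈ e, y ∈ ({x'} : Finset (Fin n))) then (0 : unitInterval) else u e)).real (openConn v b)
            < (prodBernoulli (fun e : Sym2 (Fin n) => if (∃ y ∈ e, y ∈ ({x'} : Finset (Fin n))) then (0 : unitInterval) else u e)).real (openConn a' b)) →
          (prodBernoulli (fun e : Sym2 (Fin n) => if (∃ y ∈ e, y ∈ ({x'} : Finset (Fin n))) then (0 : unitInterval) else u e)).real (openConn a' b)
          + (prodBernoulli (fun e : Sym2 (Fin n) => if (∃ y ∈ e, y ∈ ({x'} : Finset (Fin n))) then (0 : unitInterval) else u e)).real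
              ((openConn a' b)ᶜ ∩ (⋃ v ∈ T', openConn a' v) ∩ (⋃ v ∈ T', openConn v b))
        ≤ (prodBernoulli (fun e : Sym2 (Fin n) => if (∃ y ∈ e, y ∈ ({x'} : Finset (Fin n))) then (0 : unitInterval) else u e)).real (⋃ v ∈ T', openConn v b)
          + (∑ W ∈ (Finset.univ : Finset (Finset (Fin n))).filter (fun W => Disjoint W A),
              (prodBernoulli (fun e : Sym2 (Fin n) => if (∃ y ∈ e, y ∈ ({x'} : Finset (Fin n))) then (0 : unitInterval) else u e)).real
                  {ω : BondConfig (Fin n) | ∀ z : Fin n, (z ∈ W ↔ ω ∈ ⋃ v ∈ T', openConn v z)}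
                * A.inf' ⟨b, hb⟩ (fun a => (prodBernoulli (fun e : Sym2 (Fin n) => if (∃ y ∈ e, y ∈ ({x'} : Finset (Fin n))) then (0 : unitInterval) else u e)).real (openConnIn ((W : Set (Fin n))ᶜ) a b))) →
          (prodBernoulli (fun e : Sym2 (Fin n) => if (∃ y ∈ e, y ∈ ({x'} : Finset (Fin n))) then (0 : unitInterval) else u e)).real (openConn a' b)
          + (prodBernoulli (fun e : Sym2 (Fin n) => if (∃ y ∈ e, y ∈ ({x'} : Finset (Fin n))) then (0 : unitInterval) else u e)).real
              ((openConn a' b)ᶜ ∩ (⋃ v ∈ insert x'' T', openConn a' v) ∩ (⋃ v ∈ insert x'' T', openConn v b))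
        ≤ (prodBernoulli (fun e : Sym2 (Fin n) => if (∃ y ∈ e, y ∈ ({x'} : Finset (Fin n))) then (0 : unitInterval) else u e)).real (⋃ v ∈ insert x'' T', openConn v b)
          + (∑ W ∈ (Finset.univ : Finset (Finset (Fin n))).filter (fun W => Disjoint W A),
              (prodBernoulli (fun e : Sym2 (Fin n) => if (∃ y ∈ e, y ∈ ({x'} : Finset (Fin n))) then (0 : unitInterval) else u e)).real
                  {ω : BondConfig (Fin n) | ∀ z : Fin n, (z ∈ W ↔ ω ∈ ⋃ v ∈ insert x'' T', openConn v z)}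
                * A.inf' ⟨b, hb⟩ (fun a => (prodBernoulli (fun e : Sym2 (Fin n) => if (∃ y ∈ e, y ∈ ({x'} : Finset (Fin n))) then (0 : unitInterval) else u e)).real (openConnIn ((W : Set (Fin n))ᶜ) a b))) :=
        fun T' x'' hT'A hT' hx''A hx''T' hbad' hgood' =>
          ih _ (hN ▸ hlt) _ rfl A T' b a' x'' hb hT'A hT' hx''A hx''T' ha'A hA4 ha'min hbad' hIHv hgood'
      rw [← hins]
      refine hInsert n u A ((insert x T).erase x') x' b a' hb hx'T' hx'A ha'x fun B _ => ?_
      by_cases hbTB : b ∈ (insert x T).erase x' ∪ B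
      · exact blockGood_of_target_mem _ A _ b a' hb hbTB
      by_cases hleaf : ∃ w ∈ (insert x T).erase x' ∪ B, (prodBernoulli (fun e : Sym2 (Fin n) => if (∃ y ∈ e, y ∈ ({x'} : Finset (Fin n))) then (0 : unitInterval) else u e)).real (openConn a' b)
          ≤ (prodBernoulli (fun e : Sym2 (Fin n) => if (∃ y ∈ e, y ∈ ({x'} : Finset (Fin n))) then (0 : unitInterval) else u e)).real (openConn w b)
      · obtain ⟨w, hw, hle⟩ := hleaf
        have hex : ∀ W : Finset (Fin n), ∃ a, a ∈ A ∧
            A.inf' ⟨b, hb⟩ (fun a => (prodBernoulli (fun e : Sym2 (Fin n) => if (∃ y ∈ e, y ∈ ({x'} : Finset (Fin n))) then (0 : unitInterval) else u e)).real (openConnIn ((W : Set (Fin n))ᶜ) a b)) =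
              (prodBernoulli (fun e : Sym2 (Fin n) => if (∃ y ∈ e, y ∈ ({x'} : Finset (Fin n))) then (0 : unitInterval) else u e)).real (openConnIn ((W : Set (Fin n))ᶜ) a b) :=
          fun W => Finset.exists_mem_eq_inf' ⟨b, hb⟩ _
        choose selm hselmA hselm using hex
        have h5 := blockGood_leaf_lemma5 (fun e : Sym2 (Fin n) => if (∃ y ∈ e, y ∈ ({x'} : Finset (Fin n))) then (0 : unitInterval) else u e) A ((insert x T).erase x' ∪ B) b a' w selm hw hbTB hle
        have hsum : ∑ W ∈ (Finset.univ : Finset (Finset (Fin n))).filter (fun W => Disjoint W A),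
            (prodBernoulli (fun e : Sym2 (Fin n) => if (∃ y ∈ e, y ∈ ({x'} : Finset (Fin n))) then (0 : unitInterval) else u e)).real
                {ω : BondConfig (Fin n) | ∀ z : Fin n, (z ∈ W ↔ ω ∈ ⋃ v ∈ (insert x T).erase x' ∪ B, openConn v z)}
              * (prodBernoulli (fun e : Sym2 (Fin n) => if (∃ y ∈ e, y ∈ ({x'} : Finset (Fin n))) then (0 : unitInterval) else u e)).real (openConnIn ((W : Set (Fin n))ᶜ) (selm W) b)
            = ∑ W ∈ (Finset.univ : Finset (Finset (Fin n))).filter (fun W => Disjoint W A),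
                (prodBernoulli (fun e : Sym2 (Fin n) => if (∃ y ∈ e, y ∈ ({x'} : Finset (Fin n))) then (0 : unitInterval) else u e)).real
                    {ω : BondConfig (Fin n) | ∀ z : Fin n, (z ∈ W ↔ ω ∈ ⋃ v ∈ (insert x T).erase x' ∪ B, openConn v z)}
                  * A.inf' ⟨b, hb⟩ (fun a => (prodBernoulli (fun e : Sym2 (Fin n) => if (∃ y ∈ e, y ∈ ({x'} : Finset (Fin n))) then (0 : unitInterval) else u e)).real (openConnIn ((W : Set (Fin n))ᶜ) a b)) := by
          refine Finset.sum_congr rfl fun W _ => ?_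
          rw [hselm W]
        rw [hsum] at h5
        exact h5
      · push Not at hleaf
        have hdisj : Disjoint ((insert x T).erase x' ∪ B) A :=
          Finset.disjoint_left.2 fun w hw hwA => absurd (ha'min w hwA) (not_le.2 (hleaf w hw))
        exact coneChain_local _ A _ b a' s₁ hb hdisj (Finset.mem_union_left B hs₁) ha'min hleaf hIHv hconeV
    by_cases hiso : ∀ y : Fin n, (u s(x, y) : ℝ) = 0
    · -- isolated bystander: `u − x = u`, and the only layer of positive mass is `B = ∅`
      have hvu : (fun e : Sym2 (Fin n) => if (∃ y ∈ e, y ∈ ({x} : Finset (Fin n))) then (0 : unitInterval) else u e) = u := by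
        rw [hvK x]
        funext e
        by_cases hxe : x ∈ e
        · rw [if_pos hxe]
          obtain ⟨y, rfl⟩ := Sym2.mem_iff_exists.1 hxe
          exact (Set.Icc.coe_eq_zero.1 (hiso y)).symm
        · rw [if_neg hxe]
      refine hInsert n u A T x b a₀ hb hxT hxA ha₀x fun B hB0 => ?_
      have hBempty : B = ∅ := by
        by_contra hne
        obtain ⟨y, hy⟩ := Finset.nonempty_iff_ne_empty.2 hne
        obtain ⟨-, o, ho, hne0⟩ := sigmaRec_posLayer u u {x} B (fun _ _ _ => rfl) hB0 y hy
        rw [Finset.mem_singleton] at ho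
        subst ho
        exact hne0 (Set.Icc.coe_eq_zero.1 (hiso y))
      subst hBempty
      rw [Finset.union_empty, hvu]
      exact hTgood
    · -- a genuine bystander: try every vertex of the block as the bystander, else the double-drift residual
      push Not at hiso
      obtain ⟨y₀, hy₀⟩ := hiso
      by_cases hgood : ∃ x' ∈ insert x T, ∃ y₁ : Fin n, (u s(x', y₁) : ℝ) ≠ 0 ∧ ∃ a' ∈ A,
          (∀ a ∈ A, (prodBernoulli (fun e : Sym2 (Fin n) => if (∃ y ∈ e, y ∈ ({x'} : Finset (Fin n))) then (0 : unitInterval) else u e)).real (openConn a' b) ≤ (prodBernoulli (fun e : Sym2 (Fin n) => if (∃ y ∈ e, y ∈ ({x'} : Finset (Fin n))) then (0 : unitInterval) else u e)).real (openConn a b)) ∧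
          (prodBernoulli u).real (openConn a₀ b)
            + (prodBernoulli u).real ((openConn a₀ b)ᶜ ∩ (⋃ v ∈ insert x T, openConn a₀ v) ∩ (⋃ v ∈ insert x T, openConn v b))
          ≤ (prodBernoulli u).real (openConn a' b)
            + (prodBernoulli u).real ((openConn a' b)ᶜ ∩ (⋃ v ∈ insert x T, openConn a' v) ∩ (⋃ v ∈ insert x T, openConn v b))
      · obtain ⟨x', hx', y₁, hy₁, a', ha'A, ha'min, hle⟩ := hgood
        have := route x' hx' y₁ hy₁ a' ha'A ha'min
        linarith
      · push Not at hgood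
        exact hDD n u A T b a₀ x hb hTA ⟨s₀, hs₀⟩ hxA hxT ha₀ hA4 hmin hbad hIH hTgood
          (fun x' hx' y₁ hy₁ a' ha'A ha'min => hgood x' hx' y₁ hy₁ a' ha'A ha'min) route

/-- The star-killed-and-glued layer weighting `q_B` is the gluing of `B` in the star-killed weighting `u − x`. [folklore] -/
theorem bystG_qB_eq' (u : Sym2 (Fin n) → unitInterval) (B : Finset (Fin n)) (x : Fin n) :
    (fun e : Sym2 (Fin n) => if (∀ y ∈ e, y ∈ B) ∧ ¬ e.IsDiag then (1 : unitInterval) else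
        if (∃ y ∈ e, y ∈ ({x} : Finset (Fin n))) then 0 else u e)
      = (fun e : Sym2 (Fin n) => if (∀ y ∈ e, y ∈ B) ∧ ¬ e.IsDiag then (1 : unitInterval) else
          (fun e : Sym2 (Fin n) => if (∃ y ∈ e, y ∈ ({x} : Finset (Fin n))) then (0 : unitInterval) else u e) e) := rfl

/-- **Layer goodness from un-glued goodness.**  `d`-goodness of the block `T ∪ B` in the star-killed weighting `u − x` gives the
hypothesis `hB` of `blockGood_insert_of_layers` (the same inequality in `q_B` = `(u − x)/B`): gluing `B ⊆ T ∪ B` changes neither the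
block's reach, nor its cluster law, nor the pocket factors, nor the glued designation reliability. [cite: KozmaNitzan2024, §3.1 Remark p. 5] -/
theorem bystG_layer_of_unglued' (u : Sym2 (Fin n) → unitInterval) (A T B : Finset (Fin n)) (x b d : Fin n) (hb : b ∈ A)
    (h : (prodBernoulli (fun e : Sym2 (Fin n) => if (∃ y ∈ e, y ∈ ({x} : Finset (Fin n))) then (0 : unitInterval) else u e)).real
          (openConn d b)
        + (prodBernoulli (fun e : Sym2 (Fin n) => if (∃ y ∈ e, y ∈ ({x} : Finset (Fin n))) then (0 : unitInterval) else u e)).real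
            ((openConn d b)ᶜ ∩ (⋃ v ∈ T ∪ B, openConn d v) ∩ (⋃ v ∈ T ∪ B, openConn v b))
      ≤ (prodBernoulli (fun e : Sym2 (Fin n) => if (∃ y ∈ e, y ∈ ({x} : Finset (Fin n))) then (0 : unitInterval) else u e)).real
          (⋃ v ∈ T ∪ B, openConn v b)
        + ∑ W ∈ (Finset.univ : Finset (Finset (Fin n))).filter (fun W => Disjoint W A),
            (prodBernoulli (fun e : Sym2 (Fin n) => if (∃ y ∈ e, y ∈ ({x} : Finset (Fin n))) then (0 : unitInterval) else u e)).real
                {ω : BondConfig (Fin n) | ∀ z : Fin n, (z ∈ W ↔ ω ∈ ⋃ v ∈ T ∪ B, openConn v z)}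
              * A.inf' ⟨b, hb⟩ (fun a =>
                (prodBernoulli (fun e : Sym2 (Fin n) => if (∃ y ∈ e, y ∈ ({x} : Finset (Fin n))) then (0 : unitInterval) else u e)).real
                  (openConnIn ((W : Set (Fin n))ᶜ) a b))) :
    (prodBernoulli (fun e : Sym2 (Fin n) =>
        if (∀ y ∈ e, y ∈ B) ∧ ¬ e.IsDiag then 1 else
          if (∃ y ∈ e, y ∈ ({x} : Finset (Fin n))) then 0 else u e)).real (openConn d b)
      + (prodBernoulli (fun e : Sym2 (Fin n) =>
        if (∀ y ∈ e, y ∈ B) ∧ ¬ e.IsDiag then 1 else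
          if (∃ y ∈ e, y ∈ ({x} : Finset (Fin n))) then 0 else u e)).real
          ((openConn d b)ᶜ ∩ (⋃ v ∈ T ∪ B, openConn d v) ∩ (⋃ v ∈ T ∪ B, openConn v b))
    ≤ (prodBernoulli (fun e : Sym2 (Fin n) =>
        if (∀ y ∈ e, y ∈ B) ∧ ¬ e.IsDiag then 1 else
          if (∃ y ∈ e, y ∈ ({x} : Finset (Fin n))) then 0 else u e)).real (⋃ v ∈ T ∪ B, openConn v b)
      + ∑ W ∈ (Finset.univ : Finset (Finset (Fin n))).filter (fun W => Disjoint W A),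
          (prodBernoulli (fun e : Sym2 (Fin n) =>
              if (∀ y ∈ e, y ∈ B) ∧ ¬ e.IsDiag then 1 else
                if (∃ y ∈ e, y ∈ ({x} : Finset (Fin n))) then 0 else u e)).real
              {ω : BondConfig (Fin n) | ∀ z : Fin n, (z ∈ W ↔ ω ∈ ⋃ v ∈ T ∪ B, openConn v z)}
            * A.inf' ⟨b, hb⟩ (fun a => (prodBernoulli (fun e : Sym2 (Fin n) =>
                if (∀ y ∈ e, y ∈ B) ∧ ¬ e.IsDiag then 1 else
                  if (∃ y ∈ e, y ∈ ({x} : Finset (Fin n))) then 0 else u e)).real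
                (openConnIn ((W : Set (Fin n))ᶜ) a b)) := by
  set v : Sym2 (Fin n) → unitInterval :=
    fun e => if (∃ y ∈ e, y ∈ ({x} : Finset (Fin n))) then (0 : unitInterval) else u e with hv
  have hBS : B ⊆ T ∪ B := Finset.subset_union_right
  rw [bystG_qB_eq' u B x]
  -- reach and cluster law of the super-block `T ∪ B` are glue-invariant; so are the pocket factors
  rw [peelGlue_real_iUnion_superset v B (T ∪ B) hBS b]
  have hP : ∀ W, (prodBernoulli (fun e : Sym2 (Fin n) => if (∀ y ∈ e, y ∈ B) ∧ ¬ e.IsDiag then 1 else v e)).real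
        {ω : BondConfig (Fin n) | ∀ z : Fin n, (z ∈ W ↔ ω ∈ ⋃ v ∈ T ∪ B, openConn v z)}
      = (prodBernoulli v).real {ω : BondConfig (Fin n) | ∀ z : Fin n, (z ∈ W ↔ ω ∈ ⋃ v ∈ T ∪ B, openConn v z)} :=
    fun W => peelGlue_real_pocket_superset v B (T ∪ B) W hBS
  rw [peelGlue_pocketSum_eq v A B (T ∪ B) hBS b hb _ hP]
  -- the glued designation reliability: `(v/B)/(T ∪ B) = v/(T ∪ B)`
  have hglue : (fun e : Sym2 (Fin n) => if (∀ y ∈ e, y ∈ T ∪ B) ∧ ¬ e.IsDiag then (1 : unitInterval) else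
        (fun e : Sym2 (Fin n) => if (∀ y ∈ e, y ∈ B) ∧ ¬ e.IsDiag then (1 : unitInterval) else v e) e)
      = (fun e : Sym2 (Fin n) => if (∀ y ∈ e, y ∈ T ∪ B) ∧ ¬ e.IsDiag then (1 : unitInterval) else v e) := by
    funext e
    dsimp only
    by_cases h1 : (∀ y ∈ e, y ∈ T ∪ B) ∧ ¬ e.IsDiag
    · rw [if_pos h1, if_pos h1]
    · rw [if_neg h1, if_neg h1, if_neg]
      rintro ⟨hin, hd⟩
      exact h1 ⟨fun y hy => hBS (hin y hy), hd⟩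
  have hdes : (prodBernoulli (fun e : Sym2 (Fin n) => if (∀ y ∈ e, y ∈ B) ∧ ¬ e.IsDiag then 1 else v e)).real (openConn d b)
      + (prodBernoulli (fun e : Sym2 (Fin n) => if (∀ y ∈ e, y ∈ B) ∧ ¬ e.IsDiag then 1 else v e)).real
          ((openConn d b)ᶜ ∩ (⋃ v ∈ T ∪ B, openConn d v) ∩ (⋃ v ∈ T ∪ B, openConn v b))
      = (prodBernoulli v).real (openConn d b)
        + (prodBernoulli v).real ((openConn d b)ᶜ ∩ (⋃ v ∈ T ∪ B, openConn d v) ∩ (⋃ v ∈ T ∪ B, openConn v b)) := by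
    rw [← blockGrowth_glue_real_openConn, ← blockGrowth_glue_real_openConn, hglue]
  rw [hdes]
  exact h

/-- **The cone step from the bystander layer lemma and the relay-layers stub** (strong induction on the number of positive-degree
vertices).  Isolated `x`: layers of `x` are trivial and `hTgood` closes (the layer lemma with `c = 0`).  Otherwise the stub provides a
vertex `x'` of the block, a minimiser `a'` of `μ_{u−x'}(· ↔ b)` and the certificate `Σ_B μ(layer_B)·c_B ≥ 0`; each `c_B` is at most the
layer block's `reach + pockets − designated(a₀)` in `q_B`: on relay-free layers because the layer block is `a'`-good in `u − x'` (leaf or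
the local cone chain of the smaller weighting, induction-hypothesis instances), on relay layers because pockets are non-negative.
[cite: KozmaNitzan2024, §3.2 pp. 12–14] -/
theorem conePeel_of_relayLayers
    (hLayers : ∀ (n : ℕ) (u : Sym2 (Fin n) → unitInterval) (A T : Finset (Fin n)) (x b d : Fin n) (hb : b ∈ A)
      (c : Finset (Fin n) → ℝ),
      x ∉ T → x ∉ A → d ≠ x →
      0 ≤ ∑ B : Finset (Fin n), (prodBernoulli u).real {ω : BondConfig (Fin n) | ∀ y : Fin n, y ∈ B ↔ (y ∉ ({x} : Finset (Fin n)) ∧ ∃ o ∈ ({x} : Finset (Fin n)), s(o, y) ∈ ω)} * c B →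
      (∀ B : Finset (Fin n), (prodBernoulli u).real {ω : BondConfig (Fin n) | ∀ y : Fin n, y ∈ B ↔ (y ∉ ({x} : Finset (Fin n)) ∧ ∃ o ∈ ({x} : Finset (Fin n)), s(o, y) ∈ ω)} ≠ 0 →
        c B ≤ (prodBernoulli (fun e : Sym2 (Fin n) => if (∀ y ∈ e, y ∈ B) ∧ ¬ e.IsDiag then 1 else if (∃ y ∈ e, y ∈ ({x} : Finset (Fin n))) then 0 else u e)).real (⋃ v ∈ T ∪ B, openConn v b)
          + (∑ W ∈ (Finset.univ : Finset (Finset (Fin n))).filter (fun W => Disjoint W A),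
              (prodBernoulli (fun e : Sym2 (Fin n) => if (∀ y ∈ e, y ∈ B) ∧ ¬ e.IsDiag then 1 else if (∃ y ∈ e, y ∈ ({x} : Finset (Fin n))) then 0 else u e)).real
                  {ω : BondConfig (Fin n) | ∀ z : Fin n, (z ∈ W ↔ ω ∈ ⋃ v ∈ T ∪ B, openConn v z)}
                * A.inf' ⟨b, hb⟩ (fun a => (prodBernoulli (fun e : Sym2 (Fin n) => if (∀ y ∈ e, y ∈ B) ∧ ¬ e.IsDiag then 1 else if (∃ y ∈ e, y ∈ ({x} : Finset (Fin n))) then 0 else u e)).real (openConnIn ((W : Set (Fin n))ᶜ) a b)))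
          - ((prodBernoulli (fun e : Sym2 (Fin n) => if (∀ y ∈ e, y ∈ B) ∧ ¬ e.IsDiag then 1 else if (∃ y ∈ e, y ∈ ({x} : Finset (Fin n))) then 0 else u e)).real (openConn d b)
                + (prodBernoulli (fun e : Sym2 (Fin n) => if (∀ y ∈ e, y ∈ B) ∧ ¬ e.IsDiag then 1 else if (∃ y ∈ e, y ∈ ({x} : Finset (Fin n))) then 0 else u e)).real
                    ((openConn d b)ᶜ ∩ (⋃ v ∈ T ∪ B, openConn d v) ∩ (⋃ v ∈ T ∪ B, openConn v b)))) →
      (prodBernoulli u).real (openConn d b)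
          + (prodBernoulli u).real
              ((openConn d b)ᶜ ∩ (⋃ v ∈ insert x T, openConn d v) ∩ (⋃ v ∈ insert x T, openConn v b))
        ≤ (prodBernoulli u).real (⋃ v ∈ insert x T, openConn v b)
          + (∑ W ∈ (Finset.univ : Finset (Finset (Fin n))).filter (fun W => Disjoint W A),
              (prodBernoulli u).real
                  {ω : BondConfig (Fin n) | ∀ z : Fin n, (z ∈ W ↔ ω ∈ ⋃ v ∈ insert x T, openConn v z)}
                * A.inf' ⟨b, hb⟩ (fun a => (prodBernoulli u).real (openConnIn ((W : Set (Fin n))ᶜ) a b))))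
    (hRL : ∀ (n : ℕ) (u : Sym2 (Fin n) → unitInterval) (A T : Finset (Fin n)) (b a₀ x : Fin n) (hb : b ∈ A),
      Disjoint T A → T.Nonempty → x ∉ A → x ∉ T → a₀ ∈ A → 4 ≤ A.card →
      (∀ a ∈ A, (prodBernoulli u).real (openConn a₀ b) ≤ (prodBernoulli u).real (openConn a b)) →
      (∀ v ∈ insert x T, (prodBernoulli u).real (openConn v b) < (prodBernoulli u).real (openConn a₀ b)) →
      (∀ w' : Sym2 (Fin n) → unitInterval,
        (Finset.univ.filter (fun v : Fin n => ∃ y : Fin n, 0 < (w' s(y, v) : ℝ))).card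
          ≤ (Finset.univ.filter (fun v : Fin n => ∃ y : Fin n, 0 < (u s(y, v) : ℝ))).card →
        ∀ (A' : Finset (Fin n)) (o' b' : Fin n), b' ∈ A' → o' ∉ A' →
        ∀ (t : ℝ) (sel : Finset (Fin n) → Fin n), (∀ W, sel W ∈ A') →
          (∀ a ∈ A', 1 - t ≤ (prodBernoulli w').real (openConn a b')) →
          (prodBernoulli w').real ((⋃ a ∈ A', openConn o' a) ∩ (openConn o' b')ᶜ)
            + ∑ W ∈ (Finset.univ : Finset (Finset (Fin n))).filter (fun W => o' ∈ W ∧ Disjoint W A'),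
                (prodBernoulli w').real {ω : BondConfig (Fin n) | openCluster ω o' = (W : Set (Fin n))}
                  * (prodBernoulli w').real (openConnIn ((W : Set (Fin n))ᶜ) (sel W) b')ᶜ
            ≤ t) →
      (prodBernoulli u).real (openConn a₀ b)
          + (prodBernoulli u).real
              ((openConn a₀ b)ᶜ ∩ (⋃ v ∈ T, openConn a₀ v) ∩ (⋃ v ∈ T, openConn v b))
        ≤ (prodBernoulli u).real (⋃ v ∈ T, openConn v b)
          + (∑ W ∈ (Finset.univ : Finset (Finset (Fin n))).filter (fun W => Disjoint W A),
              (prodBernoulli u).real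
                  {ω : BondConfig (Fin n) | ∀ z : Fin n, (z ∈ W ↔ ω ∈ ⋃ v ∈ T, openConn v z)}
                * A.inf' ⟨b, hb⟩ (fun a => (prodBernoulli u).real (openConnIn ((W : Set (Fin n))ᶜ) a b))) →
      (∃ y₀ : Fin n, (u s(x, y₀) : ℝ) ≠ 0) →
      ∃ x' ∈ insert x T, ∃ y₀ : Fin n, (u s(x', y₀) : ℝ) ≠ 0 ∧ ∃ a' ∈ A,
        (∀ a ∈ A, (prodBernoulli (fun e : Sym2 (Fin n) => if (∃ y ∈ e, y ∈ ({x'} : Finset (Fin n))) then (0 : unitInterval) else u e)).real (openConn a' b) ≤ (prodBernoulli (fun e : Sym2 (Fin n) => if (∃ y ∈ e, y ∈ ({x'} : Finset (Fin n))) then (0 : unitInterval) else u e)).real (openConn a b)) ∧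
        0 ≤ ∑ B : Finset (Fin n), (prodBernoulli u).real {ω : BondConfig (Fin n) | ∀ y : Fin n, y ∈ B ↔ (y ∉ ({x'} : Finset (Fin n)) ∧ ∃ o ∈ ({x'} : Finset (Fin n)), s(o, y) ∈ ω)}
          * (if Disjoint ((insert x T).erase x' ∪ B) A then
              ((prodBernoulli (fun e : Sym2 (Fin n) => if (∀ y ∈ e, y ∈ B) ∧ ¬ e.IsDiag then 1 else if (∃ y ∈ e, y ∈ ({x'} : Finset (Fin n))) then 0 else u e)).real (openConn a' b)
                + (prodBernoulli (fun e : Sym2 (Fin n) => if (∀ y ∈ e, y ∈ B) ∧ ¬ e.IsDiag then 1 else if (∃ y ∈ e, y ∈ ({x'} : Finset (Fin n))) then 0 else u e)).real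
                    ((openConn a' b)ᶜ ∩ (⋃ v ∈ ((insert x T).erase x' ∪ B), openConn a' v) ∩ (⋃ v ∈ ((insert x T).erase x' ∪ B), openConn v b)))
              - ((prodBernoulli (fun e : Sym2 (Fin n) => if (∀ y ∈ e, y ∈ B) ∧ ¬ e.IsDiag then 1 else if (∃ y ∈ e, y ∈ ({x'} : Finset (Fin n))) then 0 else u e)).real (openConn a₀ b)
                + (prodBernoulli (fun e : Sym2 (Fin n) => if (∀ y ∈ e, y ∈ B) ∧ ¬ e.IsDiag then 1 else if (∃ y ∈ e, y ∈ ({x'} : Finset (Fin n))) then 0 else u e)).real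
                    ((openConn a₀ b)ᶜ ∩ (⋃ v ∈ ((insert x T).erase x' ∪ B), openConn a₀ v) ∩ (⋃ v ∈ ((insert x T).erase x' ∪ B), openConn v b)))
            else
              (prodBernoulli (fun e : Sym2 (Fin n) => if (∀ y ∈ e, y ∈ B) ∧ ¬ e.IsDiag then 1 else if (∃ y ∈ e, y ∈ ({x'} : Finset (Fin n))) then 0 else u e)).real (⋃ v ∈ ((insert x T).erase x' ∪ B), openConn v b)
              - ((prodBernoulli (fun e : Sym2 (Fin n) => if (∀ y ∈ e, y ∈ B) ∧ ¬ e.IsDiag then 1 else if (∃ y ∈ e, y ∈ ({x'} : Finset (Fin n))) then 0 else u e)).real (openConn a₀ b)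
                + (prodBernoulli (fun e : Sym2 (Fin n) => if (∀ y ∈ e, y ∈ B) ∧ ¬ e.IsDiag then 1 else if (∃ y ∈ e, y ∈ ({x'} : Finset (Fin n))) then 0 else u e)).real
                    ((openConn a₀ b)ᶜ ∩ (⋃ v ∈ ((insert x T).erase x' ∪ B), openConn a₀ v) ∩ (⋃ v ∈ ((insert x T).erase x' ∪ B), openConn v b))))) :
    ∀ (n : ℕ) (u : Sym2 (Fin n) → unitInterval) (A T : Finset (Fin n)) (b a₀ x : Fin n) (hb : b ∈ A),
      Disjoint T A → T.Nonempty → x ∉ A → x ∉ T → a₀ ∈ A → 4 ≤ A.card →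
      (∀ a ∈ A, (prodBernoulli u).real (openConn a₀ b) ≤ (prodBernoulli u).real (openConn a b)) →
      (∀ v ∈ insert x T, (prodBernoulli u).real (openConn v b) < (prodBernoulli u).real (openConn a₀ b)) →
      (∀ w' : Sym2 (Fin n) → unitInterval,
        (Finset.univ.filter (fun v : Fin n => ∃ y : Fin n, 0 < (w' s(y, v) : ℝ))).card
          ≤ (Finset.univ.filter (fun v : Fin n => ∃ y : Fin n, 0 < (u s(y, v) : ℝ))).card →
        ∀ (A' : Finset (Fin n)) (o' b' : Fin n), b' ∈ A' → o' ∉ A' →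
        ∀ (t : ℝ) (sel : Finset (Fin n) → Fin n), (∀ W, sel W ∈ A') →
          (∀ a ∈ A', 1 - t ≤ (prodBernoulli w').real (openConn a b')) →
          (prodBernoulli w').real ((⋃ a ∈ A', openConn o' a) ∩ (openConn o' b')ᶜ)
            + ∑ W ∈ (Finset.univ : Finset (Finset (Fin n))).filter (fun W => o' ∈ W ∧ Disjoint W A'),
                (prodBernoulli w').real {ω : BondConfig (Fin n) | openCluster ω o' = (W : Set (Fin n))}
                  * (prodBernoulli w').real (openConnIn ((W : Set (Fin n))ᶜ) (sel W) b')ᶜ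
            ≤ t) →
      (prodBernoulli u).real (openConn a₀ b)
          + (prodBernoulli u).real
              ((openConn a₀ b)ᶜ ∩ (⋃ v ∈ T, openConn a₀ v) ∩ (⋃ v ∈ T, openConn v b))
        ≤ (prodBernoulli u).real (⋃ v ∈ T, openConn v b)
          + (∑ W ∈ (Finset.univ : Finset (Finset (Fin n))).filter (fun W => Disjoint W A),
              (prodBernoulli u).real
                  {ω : BondConfig (Fin n) | ∀ z : Fin n, (z ∈ W ↔ ω ∈ ⋃ v ∈ T, openConn v z)}
                * A.inf' ⟨b, hb⟩ (fun a => (prodBernoulli u).real (openConnIn ((W : Set (Fin n))ᶜ) a b))) →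
      (prodBernoulli u).real (openConn a₀ b)
          + (prodBernoulli u).real
              ((openConn a₀ b)ᶜ ∩ (⋃ v ∈ insert x T, openConn a₀ v) ∩ (⋃ v ∈ insert x T, openConn v b))
        ≤ (prodBernoulli u).real (⋃ v ∈ insert x T, openConn v b)
          + (∑ W ∈ (Finset.univ : Finset (Finset (Fin n))).filter (fun W => Disjoint W A),
              (prodBernoulli u).real
                  {ω : BondConfig (Fin n) | ∀ z : Fin n, (z ∈ W ↔ ω ∈ ⋃ v ∈ insert x T, openConn v z)}
                * A.inf' ⟨b, hb⟩ (fun a => (prodBernoulli u).real (openConnIn ((W : Set (Fin n))ᶜ) a b))) := by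
  intro n
  suffices key : ∀ (N : ℕ) (u : Sym2 (Fin n) → unitInterval),
      (Finset.univ.filter (fun v : Fin n => ∃ y : Fin n, 0 < (u s(y, v) : ℝ))).card = N →
      ∀ (A T : Finset (Fin n)) (b a₀ x : Fin n) (hb : b ∈ A),
      Disjoint T A → T.Nonempty → x ∉ A → x ∉ T → a₀ ∈ A → 4 ≤ A.card →
      (∀ a ∈ A, (prodBernoulli u).real (openConn a₀ b) ≤ (prodBernoulli u).real (openConn a b)) →
      (∀ v ∈ insert x T, (prodBernoulli u).real (openConn v b) < (prodBernoulli u).real (openConn a₀ b)) →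
      (∀ w' : Sym2 (Fin n) → unitInterval,
        (Finset.univ.filter (fun v : Fin n => ∃ y : Fin n, 0 < (w' s(y, v) : ℝ))).card
          ≤ (Finset.univ.filter (fun v : Fin n => ∃ y : Fin n, 0 < (u s(y, v) : ℝ))).card →
        ∀ (A' : Finset (Fin n)) (o' b' : Fin n), b' ∈ A' → o' ∉ A' →
        ∀ (t : ℝ) (sel : Finset (Fin n) → Fin n), (∀ W, sel W ∈ A') →
          (∀ a ∈ A', 1 - t ≤ (prodBernoulli w').real (openConn a b')) →
          (prodBernoulli w').real ((⋃ a ∈ A', openConn o' a) ∩ (openConn o' b')ᶜ)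
            + ∑ W ∈ (Finset.univ : Finset (Finset (Fin n))).filter (fun W => o' ∈ W ∧ Disjoint W A'),
                (prodBernoulli w').real {ω : BondConfig (Fin n) | openCluster ω o' = (W : Set (Fin n))}
                  * (prodBernoulli w').real (openConnIn ((W : Set (Fin n))ᶜ) (sel W) b')ᶜ
            ≤ t) →
      (prodBernoulli u).real (openConn a₀ b)
          + (prodBernoulli u).real
              ((openConn a₀ b)ᶜ ∩ (⋃ v ∈ T, openConn a₀ v) ∩ (⋃ v ∈ T, openConn v b))
        ≤ (prodBernoulli u).real (⋃ v ∈ T, openConn v b)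
          + (∑ W ∈ (Finset.univ : Finset (Finset (Fin n))).filter (fun W => Disjoint W A),
              (prodBernoulli u).real
                  {ω : BondConfig (Fin n) | ∀ z : Fin n, (z ∈ W ↔ ω ∈ ⋃ v ∈ T, openConn v z)}
                * A.inf' ⟨b, hb⟩ (fun a => (prodBernoulli u).real (openConnIn ((W : Set (Fin n))ᶜ) a b))) →
      (prodBernoulli u).real (openConn a₀ b)
          + (prodBernoulli u).real
              ((openConn a₀ b)ᶜ ∩ (⋃ v ∈ insert x T, openConn a₀ v) ∩ (⋃ v ∈ insert x T, openConn v b))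
        ≤ (prodBernoulli u).real (⋃ v ∈ insert x T, openConn v b)
          + (∑ W ∈ (Finset.univ : Finset (Finset (Fin n))).filter (fun W => Disjoint W A),
              (prodBernoulli u).real
                  {ω : BondConfig (Fin n) | ∀ z : Fin n, (z ∈ W ↔ ω ∈ ⋃ v ∈ insert x T, openConn v z)}
                * A.inf' ⟨b, hb⟩ (fun a => (prodBernoulli u).real (openConnIn ((W : Set (Fin n))ᶜ) a b))) by
    intro u A T b a₀ x hb
    exact key _ u rfl A T b a₀ x hb
  intro N
  induction N using Nat.strong_induction_on with
  | _ N ih =>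
    intro u hN A T b a₀ x hb hTA hT hxA hxT ha₀ hA4 hmin hbad hIH hTgood
    obtain ⟨s₀, hs₀⟩ := hT
    have ha₀x : a₀ ≠ x := fun h => hxA (h ▸ ha₀)
    have hSA : Disjoint (insert x T) A := Finset.disjoint_insert_left.2 ⟨hxA, hTA⟩
    have hvK : ∀ x' : Fin n, (fun e : Sym2 (Fin n) => if (∃ y ∈ e, y ∈ ({x'} : Finset (Fin n))) then (0 : unitInterval) else u e)
        = fun e : Sym2 (Fin n) => if x' ∈ e then (0 : unitInterval) else u e := by
      intro x'
      funext e
      by_cases hxe : x' ∈ e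
      · rw [if_pos hxe, if_pos ⟨x', hxe, Finset.mem_singleton_self x'⟩]
      · rw [if_neg hxe, if_neg]
        rintro ⟨y, hy, hyx⟩
        exact hxe ((Finset.mem_singleton.1 hyx) ▸ hy)
    have hinf_nonneg : ∀ (p : Sym2 (Fin n) → unitInterval) (W : Finset (Fin n)),
        0 ≤ A.inf' ⟨b, hb⟩ (fun a => (prodBernoulli p).real (openConnIn ((W : Set (Fin n))ᶜ) a b)) :=
      fun p W => Finset.le_inf' _ _ fun a _ => measureReal_nonneg
    by_cases hiso : ∀ y : Fin n, (u s(x, y) : ℝ) = 0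
    · -- isolated bystander: `u − x = u`, the only positive layer of `x` is `B = ∅`; the layer lemma with `c = 0`
      have hvu : (fun e : Sym2 (Fin n) => if (∃ y ∈ e, y ∈ ({x} : Finset (Fin n))) then (0 : unitInterval) else u e) = u := by
        rw [hvK x]
        funext e
        by_cases hxe : x ∈ e
        · rw [if_pos hxe]
          obtain ⟨y, rfl⟩ := Sym2.mem_iff_exists.1 hxe
          exact (Set.Icc.coe_eq_zero.1 (hiso y)).symm
        · rw [if_neg hxe]
      refine hLayers n u A T x b a₀ hb (fun _ => 0) hxT hxA ha₀x (by simp) fun B hB0 => ?_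
      have hBempty : B = ∅ := by
        by_contra hne
        obtain ⟨y, hy⟩ := Finset.nonempty_iff_ne_empty.2 hne
        obtain ⟨-, o, ho, hne0⟩ := sigmaRec_posLayer u u {x} B (fun _ _ _ => rfl) hB0 y hy
        rw [Finset.mem_singleton] at ho
        subst ho
        exact hne0 (Set.Icc.coe_eq_zero.1 (hiso y))
      subst hBempty
      have h := bystG_layer_of_unglued' u A T ∅ x b a₀ hb (by rw [Finset.union_empty, hvu]; exact hTgood)
      linarith [h]
    · push Not at hiso
      obtain ⟨x', hx', y₀, hy₀, a', ha'A, ha'min, hsum⟩ :=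
        hRL n u A T b a₀ x hb hTA ⟨s₀, hs₀⟩ hxA hxT ha₀ hA4 hmin hbad hIH hTgood hiso
      have hx'A : x' ∉ A := Finset.disjoint_left.1 hSA hx'
      have ha'x : a' ≠ x' := fun h => hx'A (h ▸ ha'A)
      have hins : insert x' ((insert x T).erase x') = insert x T := Finset.insert_erase hx'
      have hx'T' : x' ∉ (insert x T).erase x' := Finset.notMem_erase x' _
      have hT'ne : ((insert x T).erase x').Nonempty := by
        rw [← Finset.card_pos, Finset.card_erase_of_mem hx', Finset.card_insert_of_notMem hxT]
        have : 0 < T.card := Finset.card_pos.2 ⟨s₀, hs₀⟩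
        omega
      obtain ⟨s₁, hs₁⟩ := hT'ne
      have hlt : (Finset.univ.filter (fun v : Fin n => ∃ y : Fin n, 0 < ((fun e : Sym2 (Fin n) => if (∃ y ∈ e, y ∈ ({x'} : Finset (Fin n))) then (0 : unitInterval) else u e) s(y, v) : ℝ))).card
          < (Finset.univ.filter (fun v : Fin n => ∃ y : Fin n, 0 < (u s(y, v) : ℝ))).card := by
        rw [hvK x']
        exact goodStep_card_lt u hy₀
      have hIHv : ∀ w' : Sym2 (Fin n) → unitInterval,
          (Finset.univ.filter (fun v : Fin n => ∃ y : Fin n, 0 < (w' s(y, v) : ℝ))).card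
            ≤ (Finset.univ.filter (fun v : Fin n => ∃ y : Fin n, 0 < ((fun e : Sym2 (Fin n) => if (∃ y ∈ e, y ∈ ({x'} : Finset (Fin n))) then (0 : unitInterval) else u e) s(y, v) : ℝ))).card →
          ∀ (A' : Finset (Fin n)) (o' b' : Fin n), b' ∈ A' → o' ∉ A' →
          ∀ (t : ℝ) (sel : Finset (Fin n) → Fin n), (∀ W, sel W ∈ A') →
            (∀ a ∈ A', 1 - t ≤ (prodBernoulli w').real (openConn a b')) →
            (prodBernoulli w').real ((⋃ a ∈ A', openConn o' a) ∩ (openConn o' b')ᶜ)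
              + ∑ W ∈ (Finset.univ : Finset (Finset (Fin n))).filter (fun W => o' ∈ W ∧ Disjoint W A'),
                  (prodBernoulli w').real {ω : BondConfig (Fin n) | openCluster ω o' = (W : Set (Fin n))}
                    * (prodBernoulli w').real (openConnIn ((W : Set (Fin n))ᶜ) (sel W) b')ᶜ
              ≤ t :=
        fun w' hw' => hIH w' (hw'.trans hlt.le)
      have hconeV : ∀ (T' : Finset (Fin n)) (x'' : Fin n), Disjoint T' A → T'.Nonempty → x'' ∉ A → x'' ∉ T' →
          (∀ v ∈ insert x'' T', (prodBernoulli (fun e : Sym2 (Fin n) => if (∃ y ∈ e, y ∈ ({x'} : Finset (Fin n))) then (0 : unitInterval) else u e)).real (openConn v b)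
            < (prodBernoulli (fun e : Sym2 (Fin n) => if (∃ y ∈ e, y ∈ ({x'} : Finset (Fin n))) then (0 : unitInterval) else u e)).real (openConn a' b)) →
          (prodBernoulli (fun e : Sym2 (Fin n) => if (∃ y ∈ e, y ∈ ({x'} : Finset (Fin n))) then (0 : unitInterval) else u e)).real (openConn a' b)
          + (prodBernoulli (fun e : Sym2 (Fin n) => if (∃ y ∈ e, y ∈ ({x'} : Finset (Fin n))) then (0 : unitInterval) else u e)).real
              ((openConn a' b)ᶜ ∩ (⋃ v ∈ T', openConn a' v) ∩ (⋃ v ∈ T', openConn v b))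
        ≤ (prodBernoulli (fun e : Sym2 (Fin n) => if (∃ y ∈ e, y ∈ ({x'} : Finset (Fin n))) then (0 : unitInterval) else u e)).real (⋃ v ∈ T', openConn v b)
          + (∑ W ∈ (Finset.univ : Finset (Finset (Fin n))).filter (fun W => Disjoint W A),
              (prodBernoulli (fun e : Sym2 (Fin n) => if (∃ y ∈ e, y ∈ ({x'} : Finset (Fin n))) then (0 : unitInterval) else u e)).real
                  {ω : BondConfig (Fin n) | ∀ z : Fin n, (z ∈ W ↔ ω ∈ ⋃ v ∈ T', openConn v z)}
                * A.inf' ⟨b, hb⟩ (fun a => (prodBernoulli (fun e : Sym2 (Fin n) => if (∃ y ∈ e, y ∈ ({x'} : Finset (Fin n))) then (0 : unitInterval) else u e)).real (openConnIn ((W : Set (Fin n))ᶜ) a b))) →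
          (prodBernoulli (fun e : Sym2 (Fin n) => if (∃ y ∈ e, y ∈ ({x'} : Finset (Fin n))) then (0 : unitInterval) else u e)).real (openConn a' b)
          + (prodBernoulli (fun e : Sym2 (Fin n) => if (∃ y ∈ e, y ∈ ({x'} : Finset (Fin n))) then (0 : unitInterval) else u e)).real
              ((openConn a' b)ᶜ ∩ (⋃ v ∈ insert x'' T', openConn a' v) ∩ (⋃ v ∈ insert x'' T', openConn v b))
        ≤ (prodBernoulli (fun e : Sym2 (Fin n) => if (∃ y ∈ e, y ∈ ({x'} : Finset (Fin n))) then (0 : unitInterval) else u e)).real (⋃ v ∈ insert x'' T', openConn v b)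
          + (∑ W ∈ (Finset.univ : Finset (Finset (Fin n))).filter (fun W => Disjoint W A),
              (prodBernoulli (fun e : Sym2 (Fin n) => if (∃ y ∈ e, y ∈ ({x'} : Finset (Fin n))) then (0 : unitInterval) else u e)).real
                  {ω : BondConfig (Fin n) | ∀ z : Fin n, (z ∈ W ↔ ω ∈ ⋃ v ∈ insert x'' T', openConn v z)}
                * A.inf' ⟨b, hb⟩ (fun a => (prodBernoulli (fun e : Sym2 (Fin n) => if (∃ y ∈ e, y ∈ ({x'} : Finset (Fin n))) then (0 : unitInterval) else u e)).real (openConnIn ((W : Set (Fin n))ᶜ) a b))) :=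
        fun T' x'' hT'A hT' hx''A hx''T' hbad' hgood' =>
          ih _ (hN ▸ hlt) _ rfl A T' b a' x'' hb hT'A hT' hx''A hx''T' ha'A hA4 ha'min hbad' hIHv hgood'
      -- relay-free layer blocks are `a'`-good in `u − x'`
      have hU : ∀ B : Finset (Fin n), Disjoint ((insert x T).erase x' ∪ B) A →
          (prodBernoulli (fun e : Sym2 (Fin n) => if (∃ y ∈ e, y ∈ ({x'} : Finset (Fin n))) then (0 : unitInterval) else u e)).real (openConn a' b)
          + (prodBernoulli (fun e : Sym2 (Fin n) => if (∃ y ∈ e, y ∈ ({x'} : Finset (Fin n))) then (0 : unitInterval) else u e)).real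
              ((openConn a' b)ᶜ ∩ (⋃ v ∈ ((insert x T).erase x' ∪ B), openConn a' v) ∩ (⋃ v ∈ ((insert x T).erase x' ∪ B), openConn v b))
        ≤ (prodBernoulli (fun e : Sym2 (Fin n) => if (∃ y ∈ e, y ∈ ({x'} : Finset (Fin n))) then (0 : unitInterval) else u e)).real (⋃ v ∈ ((insert x T).erase x' ∪ B), openConn v b)
          + (∑ W ∈ (Finset.univ : Finset (Finset (Fin n))).filter (fun W => Disjoint W A),
              (prodBernoulli (fun e : Sym2 (Fin n) => if (∃ y ∈ e, y ∈ ({x'} : Finset (Fin n))) then (0 : unitInterval) else u e)).real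
                  {ω : BondConfig (Fin n) | ∀ z : Fin n, (z ∈ W ↔ ω ∈ ⋃ v ∈ ((insert x T).erase x' ∪ B), openConn v z)}
                * A.inf' ⟨b, hb⟩ (fun a => (prodBernoulli (fun e : Sym2 (Fin n) => if (∃ y ∈ e, y ∈ ({x'} : Finset (Fin n))) then (0 : unitInterval) else u e)).real (openConnIn ((W : Set (Fin n))ᶜ) a b))) := by
        intro B hdisj
        have hbTB : b ∉ ((insert x T).erase x' ∪ B) := fun h => Finset.disjoint_left.1 hdisj h hb
        by_cases hleaf : ∃ w ∈ ((insert x T).erase x' ∪ B), (prodBernoulli (fun e : Sym2 (Fin n) => if (∃ y ∈ e, y ∈ ({x'} : Finset (Fin n))) then (0 : unitInterval) else u e)).real (openConn a' b)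
            ≤ (prodBernoulli (fun e : Sym2 (Fin n) => if (∃ y ∈ e, y ∈ ({x'} : Finset (Fin n))) then (0 : unitInterval) else u e)).real (openConn w b)
        · obtain ⟨w, hw, hle⟩ := hleaf
          have hex : ∀ W : Finset (Fin n), ∃ a, a ∈ A ∧
              A.inf' ⟨b, hb⟩ (fun a => (prodBernoulli (fun e : Sym2 (Fin n) => if (∃ y ∈ e, y ∈ ({x'} : Finset (Fin n))) then (0 : unitInterval) else u e)).real (openConnIn ((W : Set (Fin n))ᶜ) a b)) =
                (prodBernoulli (fun e : Sym2 (Fin n) => if (∃ y ∈ e, y ∈ ({x'} : Finset (Fin n))) then (0 : unitInterval) else u e)).real (openConnIn ((W : Set (Fin n))ᶜ) a b) :=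
            fun W => Finset.exists_mem_eq_inf' ⟨b, hb⟩ _
          choose selm hselmA hselm using hex
          have h5 := blockGood_leaf_lemma5 (fun e : Sym2 (Fin n) => if (∃ y ∈ e, y ∈ ({x'} : Finset (Fin n))) then (0 : unitInterval) else u e) A ((insert x T).erase x' ∪ B) b a' w selm hw hbTB hle
          have hsum' : ∑ W ∈ (Finset.univ : Finset (Finset (Fin n))).filter (fun W => Disjoint W A),
              (prodBernoulli (fun e : Sym2 (Fin n) => if (∃ y ∈ e, y ∈ ({x'} : Finset (Fin n))) then (0 : unitInterval) else u e)).real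
                  {ω : BondConfig (Fin n) | ∀ z : Fin n, (z ∈ W ↔ ω ∈ ⋃ v ∈ ((insert x T).erase x' ∪ B), openConn v z)}
                * (prodBernoulli (fun e : Sym2 (Fin n) => if (∃ y ∈ e, y ∈ ({x'} : Finset (Fin n))) then (0 : unitInterval) else u e)).real (openConnIn ((W : Set (Fin n))ᶜ) (selm W) b)
              = ∑ W ∈ (Finset.univ : Finset (Finset (Fin n))).filter (fun W => Disjoint W A),
                  (prodBernoulli (fun e : Sym2 (Fin n) => if (∃ y ∈ e, y ∈ ({x'} : Finset (Fin n))) then (0 : unitInterval) else u e)).real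
                      {ω : BondConfig (Fin n) | ∀ z : Fin n, (z ∈ W ↔ ω ∈ ⋃ v ∈ ((insert x T).erase x' ∪ B), openConn v z)}
                    * A.inf' ⟨b, hb⟩ (fun a => (prodBernoulli (fun e : Sym2 (Fin n) => if (∃ y ∈ e, y ∈ ({x'} : Finset (Fin n))) then (0 : unitInterval) else u e)).real (openConnIn ((W : Set (Fin n))ᶜ) a b)) := by
            refine Finset.sum_congr rfl fun W _ => ?_
            rw [hselm W]
          rw [hsum'] at h5
          exact h5
        · push Not at hleaf
          exact coneChain_local _ A _ b a' s₁ hb hdisj (Finset.mem_union_left B hs₁) ha'min hleaf hIHv hconeV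
      -- conclude with the layer lemma at `d := a₀` and the certificate `c`
      rw [← hins]
      refine hLayers n u A ((insert x T).erase x') x' b a₀ hb _ hx'T' hx'A (fun h => hx'A (h ▸ ha₀)) hsum fun B _ => ?_
      by_cases hdisj : Disjoint ((insert x T).erase x' ∪ B) A
      · rw [if_pos hdisj]
        have h := bystG_layer_of_unglued' u A ((insert x T).erase x') B x' b a' hb (hU B hdisj)
        linarith [h]
      · rw [if_neg hdisj]
        have hZ : 0 ≤ (∑ W ∈ (Finset.univ : Finset (Finset (Fin n))).filter (fun W => Disjoint W A),
              (prodBernoulli (fun e : Sym2 (Fin n) => if (∀ y ∈ e, y ∈ B) ∧ ¬ e.IsDiag then 1 else if (∃ y ∈ e, y ∈ ({x'} : Finset (Fin n))) then 0 else u e)).real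
                  {ω : BondConfig (Fin n) | ∀ z : Fin n, (z ∈ W ↔ ω ∈ ⋃ v ∈ ((insert x T).erase x' ∪ B), openConn v z)}
                * A.inf' ⟨b, hb⟩ (fun a => (prodBernoulli (fun e : Sym2 (Fin n) => if (∀ y ∈ e, y ∈ B) ∧ ¬ e.IsDiag then 1 else if (∃ y ∈ e, y ∈ ({x'} : Finset (Fin n))) then 0 else u e)).real (openConnIn ((W : Set (Fin n))ᶜ) a b))) :=
          Finset.sum_nonneg fun W _ => mul_nonneg measureReal_nonneg (hinf_nonneg _ W)
        linarith

/-- **The crux BY NAME** from the registered stubs of v5's pocket-free route (bystander layer lemma — real once the pocket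
identity has built — and the relay-layers certificate), through the landed cone assembly `coneLine_additiveGluing_of`. -/
theorem additiveGluing_closed :
    Summit.CriticalPhenomena.PercolationContinuityZ3.Theses.PercNearOneGluing.AdditiveGluing :=
  coneLine_additiveGluing_of (conePeel_of_relayLayers stub_bystanderLayers_c5 stub_relayLayersPayDrift)

/-- The crux BY NAME from v4's route (bystander attachment + the double-drift residual). -/
theorem additiveGluing_closed' :
    Summit.CriticalPhenomena.PercolationContinuityZ3.Theses.PercNearOneGluing.AdditiveGluing :=
  coneLine_additiveGluing_of (conePeel_of_doubleDrift stub_bystanderGood_c5 stub_coneDoubleDrift)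

/-- The crux BY NAME from the registered RATIO stub of skeleton v2 (all real but the stub). -/
theorem additiveGluing_closed'' :
    Summit.CriticalPhenomena.PercolationContinuityZ3.Theses.PercNearOneGluing.AdditiveGluing :=
  coneLine_additiveGluing_of (coneLine_of_pairGamma stub_pairGamma)


/-! ## Skeleton v7 (lead c5, cycle 6): the WHOLE-BLOCK CERTIFICATE route

Un-glue the WHOLE block `S` at once (KN's Theorem 4/5 pattern with the block as observer): the layers are the open outer
boundaries `N` of `S` (law under `u/S`), and on the layer `N` the block becomes `N` in `q_N` (= `u` with every star of `S`
killed and `N` glued).  Exact corner identity `K_u(S, a₀) = Σ_N μ_{u/S}(L_N)·K_{q_N}(N, a₀)` (three σ-identities with hub set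
`O = S`, registered separately as stub_wholeBlockReach_c5 / stub_wholeBlockDesignated_c5 / stub_wholeBlockPockets_c5 — the landed
`stub_sigmaLaw` / `stub_sigmaGeometry` are already stated for a general hub set), then the leaves: relay layers
`K ≥ reach − designated` (pockets ≥ 0), relay-free layers `K_{q_N}(N, a₀) ≥ τ_{q_N}(d ↔ b) − τ_{q_N}(a₀ ↔ b)` by block goodness of
`N` in the STAR-KILLED weighting at ITS OWN minimiser `d ∈ argmin_A τ_{u−S}` (strictly fewer positive-degree vertices: the
strengthened induction hypothesis `HBLK`, supplied by the new assembly stub_cone7Assembly_c5), `N = ∅` exactly.  What is left is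
the FIXED, badness-free, existential-free inequality `stub_wholeBlockCert` (closed form:
`μ_u(a₀ ↔' b) ≤ μ_u(R ∩ {S ↔ b}) + μ_u(Rᶜ ∩ {d ↔' b})`, `R` = "some edge between S and A is open", `↔'` = glued-S connection).
Numerics (lab/t48–t52, kit j027935): 0 violations in ≈ 9 000 random blocks n ≤ 8 (bad or not, |A| ≤ 6) and under simulated
annealing on the edge weights (≈ 400 starts, margins → 1e-7 but never negative), while every nearby variant is FALSE under the same
search (GO: glued order `τ'(d) ≥ τ'(a₀)`; C2: per-layer glued minimiser; selection rules for a single bystander).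
-/


/-- **STUB `stub_wholeBlockKernel_c5` (v7 infrastructure, PROVABLE from the three whole-block σ-identities + glue invariance +
`HBLK`): the corner identity and the leaf bounds — a non-negative whole-block certificate makes the block `a₀`-good.**
[cite: KozmaNitzan2024, §3.2 pp. 12–14] -/
theorem stub_wholeBlockKernel_c5 :
    ∀ (n : ℕ) (u : Sym2 (Fin n) → unitInterval) (A S : Finset (Fin n)) (b a₀ d : Fin n) (hb : b ∈ A),
      Disjoint S A → a₀ ∈ A → d ∈ A →
      (∀ a ∈ A, (prodBernoulli u).real (openConn a₀ b) ≤ (prodBernoulli u).real (openConn a b)) →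
      (∀ a ∈ A, (prodBernoulli (fun e : Sym2 (Fin n) => if (∃ y ∈ e, y ∈ S) then (0 : unitInterval) else u e)).real (openConn d b) ≤ (prodBernoulli (fun e : Sym2 (Fin n) => if (∃ y ∈ e, y ∈ S) then (0 : unitInterval) else u e)).real (openConn a b)) →
      (∀ w' : Sym2 (Fin n) → unitInterval,
        (Finset.univ.filter (fun v : Fin n => ∃ y : Fin n, 0 < (w' s(y, v) : ℝ))).card
          < (Finset.univ.filter (fun v : Fin n => ∃ y : Fin n, 0 < (u s(y, v) : ℝ))).card →
        ∀ (A' S' : Finset (Fin n)) (b' d' : Fin n) (hb' : b' ∈ A'), Disjoint S' A' → d' ∈ A' →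
        (∀ a ∈ A', (prodBernoulli w').real (openConn d' b') ≤ (prodBernoulli w').real (openConn a b')) →
        (prodBernoulli w').real (openConn d' b')
          + (prodBernoulli w').real
              ((openConn d' b')ᶜ ∩ (⋃ v ∈ S', openConn d' v) ∩ (⋃ v ∈ S', openConn v b'))
        ≤ (prodBernoulli w').real (⋃ v ∈ S', openConn v b')
          + (∑ W ∈ (Finset.univ : Finset (Finset (Fin n))).filter (fun W => Disjoint W A'),
              (prodBernoulli w').real
                  {ω : BondConfig (Fin n) | ∀ z : Fin n, (z ∈ W ↔ ω ∈ ⋃ v ∈ S', openConn v z)}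
                * A'.inf' ⟨b', hb'⟩ (fun a => (prodBernoulli w').real (openConnIn ((W : Set (Fin n))ᶜ) a b')))) →
      0 ≤ ∑ N : Finset (Fin n), (prodBernoulli (fun e : Sym2 (Fin n) => if (∀ y ∈ e, y ∈ S) ∧ ¬ e.IsDiag then 1 else u e)).real {ω : BondConfig (Fin n) | ∀ y : Fin n, y ∈ N ↔ (y ∉ S ∧ ∃ o ∈ S, s(o, y) ∈ ω)}
          * (if Disjoint N A then
              (prodBernoulli (fun e : Sym2 (Fin n) => if (∀ y ∈ e, y ∈ N) ∧ ¬ e.IsDiag then 1 else if (∃ y ∈ e, y ∈ S) then 0 else u e)).real (openConn d b) - (prodBernoulli (fun e : Sym2 (Fin n) => if (∀ y ∈ e, y ∈ N) ∧ ¬ e.IsDiag then 1 else if (∃ y ∈ e, y ∈ S) then 0 else u e)).real (openConn a₀ b)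
            else
              (prodBernoulli (fun e : Sym2 (Fin n) => if (∀ y ∈ e, y ∈ N) ∧ ¬ e.IsDiag then 1 else if (∃ y ∈ e, y ∈ S) then 0 else u e)).real (⋃ v ∈ N, openConn v b) - (prodBernoulli (fun e : Sym2 (Fin n) => if (∀ y ∈ e, y ∈ N) ∧ ¬ e.IsDiag then 1 else if (∃ y ∈ e, y ∈ S) then 0 else u e)).real (openConn a₀ b)) →
      (prodBernoulli u).real (openConn a₀ b)
          + (prodBernoulli u).real
              ((openConn a₀ b)ᶜ ∩ (⋃ v ∈ S, openConn a₀ v) ∩ (⋃ v ∈ S, openConn v b))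
        ≤ (prodBernoulli u).real (⋃ v ∈ S, openConn v b)
          + (∑ W ∈ (Finset.univ : Finset (Finset (Fin n))).filter (fun W => Disjoint W A),
              (prodBernoulli u).real
                  {ω : BondConfig (Fin n) | ∀ z : Fin n, (z ∈ W ↔ ω ∈ ⋃ v ∈ S, openConn v z)}
                * A.inf' ⟨b, hb⟩ (fun a => (prodBernoulli u).real (openConnIn ((W : Set (Fin n))ᶜ) a b))) :=
  Summit.CriticalPhenomena.PercolationContinuityZ3.Theorems.stub_wholeBlockKernel_c5

/-- **STUB `stub_cone7Assembly_c5` (v7 infrastructure, PROVABLE by re-running the landed cone assembly `coneLine_good_all` /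
`coneLine_additiveGluing_of` with block goodness supplied by strong induction on the number of positive-degree vertices instead of
the cone chain): the v7 cone statement (block goodness from `HBLK`) implies `AdditiveGluing`.** [cite: KozmaNitzan2024, §3.2] -/
theorem stub_cone7Assembly_c5 :
    (∀ (n : ℕ) (u : Sym2 (Fin n) → unitInterval) (A S : Finset (Fin n)) (b a₀ : Fin n) (hb : b ∈ A),
        Disjoint S A → a₀ ∈ A →
        (∀ a ∈ A, (prodBernoulli u).real (openConn a₀ b) ≤ (prodBernoulli u).real (openConn a b)) →
        (∀ w' : Sym2 (Fin n) → unitInterval,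
          (Finset.univ.filter (fun v : Fin n => ∃ y : Fin n, 0 < (w' s(y, v) : ℝ))).card
            < (Finset.univ.filter (fun v : Fin n => ∃ y : Fin n, 0 < (u s(y, v) : ℝ))).card →
          ∀ (A' S' : Finset (Fin n)) (b' d' : Fin n) (hb' : b' ∈ A'), Disjoint S' A' → d' ∈ A' →
          (∀ a ∈ A', (prodBernoulli w').real (openConn d' b') ≤ (prodBernoulli w').real (openConn a b')) →
          (prodBernoulli w').real (openConn d' b')
            + (prodBernoulli w').real
                ((openConn d' b')ᶜ ∩ (⋃ v ∈ S', openConn d' v) ∩ (⋃ v ∈ S', openConn v b'))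
          ≤ (prodBernoulli w').real (⋃ v ∈ S', openConn v b')
            + (∑ W ∈ (Finset.univ : Finset (Finset (Fin n))).filter (fun W => Disjoint W A'),
                (prodBernoulli w').real
                    {ω : BondConfig (Fin n) | ∀ z : Fin n, (z ∈ W ↔ ω ∈ ⋃ v ∈ S', openConn v z)}
                  * A'.inf' ⟨b', hb'⟩ (fun a => (prodBernoulli w').real (openConnIn ((W : Set (Fin n))ᶜ) a b')))) →
        (prodBernoulli u).real (openConn a₀ b)
            + (prodBernoulli u).real
                ((openConn a₀ b)ᶜ ∩ (⋃ v ∈ S, openConn a₀ v) ∩ (⋃ v ∈ S, openConn v b))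
          ≤ (prodBernoulli u).real (⋃ v ∈ S, openConn v b)
            + (∑ W ∈ (Finset.univ : Finset (Finset (Fin n))).filter (fun W => Disjoint W A),
                (prodBernoulli u).real
                    {ω : BondConfig (Fin n) | ∀ z : Fin n, (z ∈ W ↔ ω ∈ ⋃ v ∈ S, openConn v z)}
                  * A.inf' ⟨b, hb⟩ (fun a => (prodBernoulli u).real (openConnIn ((W : Set (Fin n))ᶜ) a b)))) →
      ∀ (n : ℕ) (w : Sym2 (Fin n) → unitInterval) (A : Finset (Fin n)) (o b : Fin n) (t : ℝ), 0 ≤ t →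
      (∀ a ∈ A, 1 - t ≤ (prodBernoulli w).real (openConn a b)) →
      (prodBernoulli w).real (⋃ a ∈ A, openConn o a) - t ≤ (prodBernoulli w).real (openConn o b) :=
  Summit.CriticalPhenomena.PercolationContinuityZ3.Theorems.stub_cone7Assembly_c5

/-- The v7 cone statement from the kernel and the whole-block certificate (real glue). -/
theorem cone7_of_wholeBlock
    (hK : ∀ (n : ℕ) (u : Sym2 (Fin n) → unitInterval) (A S : Finset (Fin n)) (b a₀ d : Fin n) (hb : b ∈ A),
        Disjoint S A → a₀ ∈ A → d ∈ A →
        (∀ a ∈ A, (prodBernoulli u).real (openConn a₀ b) ≤ (prodBernoulli u).real (openConn a b)) →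
        (∀ a ∈ A, (prodBernoulli (fun e : Sym2 (Fin n) => if (∃ y ∈ e, y ∈ S) then (0 : unitInterval) else u e)).real (openConn d b) ≤ (prodBernoulli (fun e : Sym2 (Fin n) => if (∃ y ∈ e, y ∈ S) then (0 : unitInterval) else u e)).real (openConn a b)) →
        (∀ w' : Sym2 (Fin n) → unitInterval,
          (Finset.univ.filter (fun v : Fin n => ∃ y : Fin n, 0 < (w' s(y, v) : ℝ))).card
            < (Finset.univ.filter (fun v : Fin n => ∃ y : Fin n, 0 < (u s(y, v) : ℝ))).card →
          ∀ (A' S' : Finset (Fin n)) (b' d' : Fin n) (hb' : b' ∈ A'), Disjoint S' A' → d' ∈ A' →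
          (∀ a ∈ A', (prodBernoulli w').real (openConn d' b') ≤ (prodBernoulli w').real (openConn a b')) →
          (prodBernoulli w').real (openConn d' b')
            + (prodBernoulli w').real
                ((openConn d' b')ᶜ ∩ (⋃ v ∈ S', openConn d' v) ∩ (⋃ v ∈ S', openConn v b'))
          ≤ (prodBernoulli w').real (⋃ v ∈ S', openConn v b')
            + (∑ W ∈ (Finset.univ : Finset (Finset (Fin n))).filter (fun W => Disjoint W A'),
                (prodBernoulli w').real
                    {ω : BondConfig (Fin n) | ∀ z : Fin n, (z ∈ W ↔ ω ∈ ⋃ v ∈ S', openConn v z)}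
                  * A'.inf' ⟨b', hb'⟩ (fun a => (prodBernoulli w').real (openConnIn ((W : Set (Fin n))ᶜ) a b')))) →
        0 ≤ ∑ N : Finset (Fin n), (prodBernoulli (fun e : Sym2 (Fin n) => if (∀ y ∈ e, y ∈ S) ∧ ¬ e.IsDiag then 1 else u e)).real {ω : BondConfig (Fin n) | ∀ y : Fin n, y ∈ N ↔ (y ∉ S ∧ ∃ o ∈ S, s(o, y) ∈ ω)}
            * (if Disjoint N A then
                (prodBernoulli (fun e : Sym2 (Fin n) => if (∀ y ∈ e, y ∈ N) ∧ ¬ e.IsDiag then 1 else if (∃ y ∈ e, y ∈ S) then 0 else u e)).real (openConn d b) - (prodBernoulli (fun e : Sym2 (Fin n) => if (∀ y ∈ e, y ∈ N) ∧ ¬ e.IsDiag then 1 else if (∃ y ∈ e, y ∈ S) then 0 else u e)).real (openConn a₀ b)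
              else
                (prodBernoulli (fun e : Sym2 (Fin n) => if (∀ y ∈ e, y ∈ N) ∧ ¬ e.IsDiag then 1 else if (∃ y ∈ e, y ∈ S) then 0 else u e)).real (⋃ v ∈ N, openConn v b) - (prodBernoulli (fun e : Sym2 (Fin n) => if (∀ y ∈ e, y ∈ N) ∧ ¬ e.IsDiag then 1 else if (∃ y ∈ e, y ∈ S) then 0 else u e)).real (openConn a₀ b)) →
        (prodBernoulli u).real (openConn a₀ b)
            + (prodBernoulli u).real
                ((openConn a₀ b)ᶜ ∩ (⋃ v ∈ S, openConn a₀ v) ∩ (⋃ v ∈ S, openConn v b))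
          ≤ (prodBernoulli u).real (⋃ v ∈ S, openConn v b)
            + (∑ W ∈ (Finset.univ : Finset (Finset (Fin n))).filter (fun W => Disjoint W A),
                (prodBernoulli u).real
                    {ω : BondConfig (Fin n) | ∀ z : Fin n, (z ∈ W ↔ ω ∈ ⋃ v ∈ S, openConn v z)}
                  * A.inf' ⟨b, hb⟩ (fun a => (prodBernoulli u).real (openConnIn ((W : Set (Fin n))ᶜ) a b))))
    (hWB : ∀ (n : ℕ) (u : Sym2 (Fin n) → unitInterval) (A S : Finset (Fin n)) (b a₀ : Fin n),
        b ∈ A → Disjoint S A → a₀ ∈ A →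
        (∀ a ∈ A, (prodBernoulli u).real (openConn a₀ b) ≤ (prodBernoulli u).real (openConn a b)) →
        ∃ d ∈ A, (∀ a ∈ A, (prodBernoulli (fun e : Sym2 (Fin n) => if (∃ y ∈ e, y ∈ S) then (0 : unitInterval) else u e)).real (openConn d b) ≤ (prodBernoulli (fun e : Sym2 (Fin n) => if (∃ y ∈ e, y ∈ S) then (0 : unitInterval) else u e)).real (openConn a b)) ∧
          0 ≤ ∑ N : Finset (Fin n), (prodBernoulli (fun e : Sym2 (Fin n) => if (∀ y ∈ e, y ∈ S) ∧ ¬ e.IsDiag then 1 else u e)).real {ω : BondConfig (Fin n) | ∀ y : Fin n, y ∈ N ↔ (y ∉ S ∧ ∃ o ∈ S, s(o, y) ∈ ω)}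
            * (if Disjoint N A then
                (prodBernoulli (fun e : Sym2 (Fin n) => if (∀ y ∈ e, y ∈ N) ∧ ¬ e.IsDiag then 1 else if (∃ y ∈ e, y ∈ S) then 0 else u e)).real (openConn d b) - (prodBernoulli (fun e : Sym2 (Fin n) => if (∀ y ∈ e, y ∈ N) ∧ ¬ e.IsDiag then 1 else if (∃ y ∈ e, y ∈ S) then 0 else u e)).real (openConn a₀ b)
              else
                (prodBernoulli (fun e : Sym2 (Fin n) => if (∀ y ∈ e, y ∈ N) ∧ ¬ e.IsDiag then 1 else if (∃ y ∈ e, y ∈ S) then 0 else u e)).real (⋃ v ∈ N, openConn v b) - (prodBernoulli (fun e : Sym2 (Fin n) => if (∀ y ∈ e, y ∈ N) ∧ ¬ e.IsDiag then 1 else if (∃ y ∈ e, y ∈ S) then 0 else u e)).real (openConn a₀ b))) :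
    ∀ (n : ℕ) (u : Sym2 (Fin n) → unitInterval) (A S : Finset (Fin n)) (b a₀ : Fin n) (hb : b ∈ A),
      Disjoint S A → a₀ ∈ A →
      (∀ a ∈ A, (prodBernoulli u).real (openConn a₀ b) ≤ (prodBernoulli u).real (openConn a b)) →
      (∀ w' : Sym2 (Fin n) → unitInterval,
        (Finset.univ.filter (fun v : Fin n => ∃ y : Fin n, 0 < (w' s(y, v) : ℝ))).card
          < (Finset.univ.filter (fun v : Fin n => ∃ y : Fin n, 0 < (u s(y, v) : ℝ))).card →
        ∀ (A' S' : Finset (Fin n)) (b' d' : Fin n) (hb' : b' ∈ A'), Disjoint S' A' → d' ∈ A' →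
        (∀ a ∈ A', (prodBernoulli w').real (openConn d' b') ≤ (prodBernoulli w').real (openConn a b')) →
        (prodBernoulli w').real (openConn d' b')
          + (prodBernoulli w').real
              ((openConn d' b')ᶜ ∩ (⋃ v ∈ S', openConn d' v) ∩ (⋃ v ∈ S', openConn v b'))
        ≤ (prodBernoulli w').real (⋃ v ∈ S', openConn v b')
          + (∑ W ∈ (Finset.univ : Finset (Finset (Fin n))).filter (fun W => Disjoint W A'),
              (prodBernoulli w').real
                  {ω : BondConfig (Fin n) | ∀ z : Fin n, (z ∈ W ↔ ω ∈ ⋃ v ∈ S', openConn v z)}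
                * A'.inf' ⟨b', hb'⟩ (fun a => (prodBernoulli w').real (openConnIn ((W : Set (Fin n))ᶜ) a b')))) →
      (prodBernoulli u).real (openConn a₀ b)
          + (prodBernoulli u).real
              ((openConn a₀ b)ᶜ ∩ (⋃ v ∈ S, openConn a₀ v) ∩ (⋃ v ∈ S, openConn v b))
        ≤ (prodBernoulli u).real (⋃ v ∈ S, openConn v b)
          + (∑ W ∈ (Finset.univ : Finset (Finset (Fin n))).filter (fun W => Disjoint W A),
              (prodBernoulli u).real
                  {ω : BondConfig (Fin n) | ∀ z : Fin n, (z ∈ W ↔ ω ∈ ⋃ v ∈ S, openConn v z)}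
                * A.inf' ⟨b, hb⟩ (fun a => (prodBernoulli u).real (openConnIn ((W : Set (Fin n))ᶜ) a b))) := by
  intro n u A S b a₀ hb hSA ha₀ hmin hblk
  obtain ⟨d, hdA, hdmin, hsum⟩ := hWB n u A S b a₀ hb hSA ha₀ hmin
  exact hK n u A S b a₀ d hb hSA ha₀ hdA hmin hdmin hblk hsum

/-- The v7 whole-block route as an IMPLICATION (record only): the whole-block certificate `WB` would close the crux through the landed
kernel and assembly — but `WB` is REFUTED (n = 7 bad-block witness, Cruxes/…/WB-refuted-c5.md), so this theorem is kept only to document the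
(valid) reduction; it is not a route. -/
theorem additiveGluing_of_wholeBlockCert
    (hWB : ∀ (n : ℕ) (u : Sym2 (Fin n) → unitInterval) (A S : Finset (Fin n)) (b a₀ : Fin n),
        b ∈ A → Disjoint S A → a₀ ∈ A →
        (∀ a ∈ A, (prodBernoulli u).real (openConn a₀ b) ≤ (prodBernoulli u).real (openConn a b)) →
        ∃ d ∈ A, (∀ a ∈ A, (prodBernoulli (fun e : Sym2 (Fin n) => if (∃ y ∈ e, y ∈ S) then (0 : unitInterval) else u e)).real (openConn d b) ≤ (prodBernoulli (fun e : Sym2 (Fin n) => if (∃ y ∈ e, y ∈ S) then (0 : unitInterval) else u e)).real (openConn a b)) ∧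
          0 ≤ ∑ N : Finset (Fin n), (prodBernoulli (fun e : Sym2 (Fin n) => if (∀ y ∈ e, y ∈ S) ∧ ¬ e.IsDiag then 1 else u e)).real {ω : BondConfig (Fin n) | ∀ y : Fin n, y ∈ N ↔ (y ∉ S ∧ ∃ o ∈ S, s(o, y) ∈ ω)}
            * (if Disjoint N A then
                (prodBernoulli (fun e : Sym2 (Fin n) => if (∀ y ∈ e, y ∈ N) ∧ ¬ e.IsDiag then 1 else if (∃ y ∈ e, y ∈ S) then 0 else u e)).real (openConn d b) - (prodBernoulli (fun e : Sym2 (Fin n) => if (∀ y ∈ e, y ∈ N) ∧ ¬ e.IsDiag then 1 else if (∃ y ∈ e, y ∈ S) then 0 else u e)).real (openConn a₀ b)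
              else
                (prodBernoulli (fun e : Sym2 (Fin n) => if (∀ y ∈ e, y ∈ N) ∧ ¬ e.IsDiag then 1 else if (∃ y ∈ e, y ∈ S) then 0 else u e)).real (⋃ v ∈ N, openConn v b) - (prodBernoulli (fun e : Sym2 (Fin n) => if (∀ y ∈ e, y ∈ N) ∧ ¬ e.IsDiag then 1 else if (∃ y ∈ e, y ∈ S) then 0 else u e)).real (openConn a₀ b))) :
    Summit.CriticalPhenomena.PercolationContinuityZ3.Theses.PercNearOneGluing.AdditiveGluing :=
  stub_cone7Assembly_c5 (cone7_of_wholeBlock stub_wholeBlockKernel_c5 hWB)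


/-! ## Skeleton v8 (lead c5, cycle 6c): the BYSTANDER-EXISTS certificate with `HBLK` — v7's whole-block certificate is REFUTED

`stub_wholeBlockCert` (v7) is FALSE: n = 7 bad-block witness with the unique star-killed minimiser (WB = −0.000764, Cruxes/…/WB-refuted-c5.md;
also an n = 6 non-bad witness).  The v7 INFRASTRUCTURE survives and is reused: the assembly with the strengthened induction hypothesis
(`stub_cone7Assembly_c5`, LANDED p174103) and the isolated block (`stub_isolatedBlock_c5`, LANDED p173624).  v8 closes the v7 cone statement
from a SINGLE-bystander certificate chosen existentially (the v5/v6 certificate, which survives every witness and every annealing run so far),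
with the relay-free layer blocks made good by `HBLK` in the star-killed weighting instead of the cone chain — so NO badness, NO `4 ≤ |A|`,
NO goodness of the smaller block is needed: `stub_bystanderKernel_c5` (PROVED, work/BystanderKernel.lean rc 0: the landed weighted bystander
lemma + glue invariance + HBLK) and the residual `stub_bystanderCert_c5` (= `stub_relayLayersPayDrift` with the cone hypotheses dropped).
-/

/-- **STUB `stub_bystanderCert_c5` (v8, LOAD-BEARING).**  For a block `S` (disjoint from `A ∋ b`) with a positive-weight edge and a minimiser `a₀`
of `μ_u(· ↔ b)` over `A`: SOME vertex `x' ∈ S` with a positive-weight edge and SOME minimiser `a'` of the `x'`-star-killed two-point function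
give a non-negative layer certificate `0 ≤ Σ_B μ_u(open star of x' = B)·c_B`, `c_B = designated(a') − designated(a₀)` of the layer block
`S∖x' ∪ B` in `q_B` on layers avoiding `A`, `c_B = reach − designated(a₀)` on layers meeting `A`.  Closed form for the bystander `x'`:
`τ_{u/S}(a₀) ≤ μ_u(R₁ ∩ {S↔b}) + μ_u(R₁ᶜ ∩ {a' ↔_{u/S} b})`, `R₁` = "some edge x'–A open".  `|S| = 1` and the no-drift case `a' = a₀` are
"argmin + KN Lemma 5" (landed: `stub_relayLayersNoDrift_c5`).  Numerics: 0 violations in ≈ 50 000 exact blocks n ≤ 8 (bad or not, dense and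
sparse), incl. both whole-block witnesses, and under simulated annealing (lab/t47, t66; kit j028221); every FIXED choice (a fixed bystander,
the whole block, any selection rule) is refuted.  [cite: KozmaNitzan2024, §3.2 pp. 12–14, Question 9 p. 36] -/
theorem stub_bystanderCert_c5 :
    ∀ (n : ℕ) (u : Sym2 (Fin n) → unitInterval) (A S : Finset (Fin n)) (b a₀ : Fin n),
      b ∈ A → Disjoint S A → a₀ ∈ A →
      (∀ a ∈ A, (prodBernoulli u).real (openConn a₀ b) ≤ (prodBernoulli u).real (openConn a b)) →
      (∃ x ∈ S, ∃ y : Fin n, (u s(x, y) : ℝ) ≠ 0) →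
      ∃ x' ∈ S, (∃ y : Fin n, (u s(x', y) : ℝ) ≠ 0) ∧ ∃ a' ∈ A,
        (∀ a ∈ A, (prodBernoulli (fun e : Sym2 (Fin n) => if (∃ y ∈ e, y ∈ ({x'} : Finset (Fin n))) then (0 : unitInterval) else u e)).real (openConn a' b) ≤ (prodBernoulli (fun e : Sym2 (Fin n) => if (∃ y ∈ e, y ∈ ({x'} : Finset (Fin n))) then (0 : unitInterval) else u e)).real (openConn a b)) ∧
        0 ≤ ∑ B : Finset (Fin n), (prodBernoulli u).real {ω : BondConfig (Fin n) | ∀ y : Fin n, y ∈ B ↔ (y ∉ ({x'} : Finset (Fin n)) ∧ ∃ o ∈ ({x'} : Finset (Fin n)), s(o, y) ∈ ω)}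
          * (if Disjoint (S.erase x' ∪ B) A then
              ((prodBernoulli (fun e : Sym2 (Fin n) => if (∀ y ∈ e, y ∈ B) ∧ ¬ e.IsDiag then 1 else if (∃ y ∈ e, y ∈ ({x'} : Finset (Fin n))) then 0 else u e)).real (openConn a' b) + (prodBernoulli (fun e : Sym2 (Fin n) => if (∀ y ∈ e, y ∈ B) ∧ ¬ e.IsDiag then 1 else if (∃ y ∈ e, y ∈ ({x'} : Finset (Fin n))) then 0 else u e)).real ((openConn a' b)ᶜ ∩ (⋃ v ∈ (S.erase x' ∪ B), openConn a' v) ∩ (⋃ v ∈ (S.erase x' ∪ B), openConn v b)))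
              - ((prodBernoulli (fun e : Sym2 (Fin n) => if (∀ y ∈ e, y ∈ B) ∧ ¬ e.IsDiag then 1 else if (∃ y ∈ e, y ∈ ({x'} : Finset (Fin n))) then 0 else u e)).real (openConn a₀ b) + (prodBernoulli (fun e : Sym2 (Fin n) => if (∀ y ∈ e, y ∈ B) ∧ ¬ e.IsDiag then 1 else if (∃ y ∈ e, y ∈ ({x'} : Finset (Fin n))) then 0 else u e)).real ((openConn a₀ b)ᶜ ∩ (⋃ v ∈ (S.erase x' ∪ B), openConn a₀ v) ∩ (⋃ v ∈ (S.erase x' ∪ B), openConn v b)))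
            else
              (prodBernoulli (fun e : Sym2 (Fin n) => if (∀ y ∈ e, y ∈ B) ∧ ¬ e.IsDiag then 1 else if (∃ y ∈ e, y ∈ ({x'} : Finset (Fin n))) then 0 else u e)).real (⋃ v ∈ (S.erase x' ∪ B), openConn v b)
              - ((prodBernoulli (fun e : Sym2 (Fin n) => if (∀ y ∈ e, y ∈ B) ∧ ¬ e.IsDiag then 1 else if (∃ y ∈ e, y ∈ ({x'} : Finset (Fin n))) then 0 else u e)).real (openConn a₀ b) + (prodBernoulli (fun e : Sym2 (Fin n) => if (∀ y ∈ e, y ∈ B) ∧ ¬ e.IsDiag then 1 else if (∃ y ∈ e, y ∈ ({x'} : Finset (Fin n))) then 0 else u e)).real ((openConn a₀ b)ᶜ ∩ (⋃ v ∈ (S.erase x' ∪ B), openConn a₀ v) ∩ (⋃ v ∈ (S.erase x' ∪ B), openConn v b)))) := by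
  sorry

/-- **`stub_bystanderKernel_c5` (v8 infrastructure; PROVED in work/BystanderKernel.lean, lands `--supports`): the bystander kernel with
`HBLK`.** [cite: KozmaNitzan2024, §3.2 pp. 12–14] -/
theorem stub_bystanderKernel_c5 :
    ∀ (n : ℕ) (u : Sym2 (Fin n) → unitInterval) (A S : Finset (Fin n)) (b a₀ x' a' : Fin n) (hb : b ∈ A),
      Disjoint S A → a₀ ∈ A → x' ∈ S → a' ∈ A →
      (∀ a ∈ A, (prodBernoulli u).real (openConn a₀ b) ≤ (prodBernoulli u).real (openConn a b)) →
      (∀ a ∈ A, (prodBernoulli (fun e : Sym2 (Fin n) => if (∃ y ∈ e, y ∈ ({x'} : Finset (Fin n))) then (0 : unitInterval) else u e)).real (openConn a' b) ≤ (prodBernoulli (fun e : Sym2 (Fin n) => if (∃ y ∈ e, y ∈ ({x'} : Finset (Fin n))) then (0 : unitInterval) else u e)).real (openConn a b)) →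
      (∀ w' : Sym2 (Fin n) → unitInterval,
        (Finset.univ.filter (fun v : Fin n => ∃ y : Fin n, 0 < (w' s(y, v) : ℝ))).card
          < (Finset.univ.filter (fun v : Fin n => ∃ y : Fin n, 0 < (u s(y, v) : ℝ))).card →
        ∀ (A' S' : Finset (Fin n)) (b' d' : Fin n) (hb' : b' ∈ A'), Disjoint S' A' → d' ∈ A' →
        (∀ a ∈ A', (prodBernoulli w').real (openConn d' b') ≤ (prodBernoulli w').real (openConn a b')) →
        (prodBernoulli w').real (openConn d' b')
          + (prodBernoulli w').real
              ((openConn d' b')ᶜ ∩ (⋃ v ∈ S', openConn d' v) ∩ (⋃ v ∈ S', openConn v b'))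
        ≤ (prodBernoulli w').real (⋃ v ∈ S', openConn v b')
          + (∑ W ∈ (Finset.univ : Finset (Finset (Fin n))).filter (fun W => Disjoint W A'),
              (prodBernoulli w').real
                  {ω : BondConfig (Fin n) | ∀ z : Fin n, (z ∈ W ↔ ω ∈ ⋃ v ∈ S', openConn v z)}
                * A'.inf' ⟨b', hb'⟩ (fun a => (prodBernoulli w').real (openConnIn ((W : Set (Fin n))ᶜ) a b')))) →
      (∃ y : Fin n, (u s(x', y) : ℝ) ≠ 0) →
      0 ≤ ∑ B : Finset (Fin n), (prodBernoulli u).real {ω : BondConfig (Fin n) | ∀ y : Fin n, y ∈ B ↔ (y ∉ ({x'} : Finset (Fin n)) ∧ ∃ o ∈ ({x'} : Finset (Fin n)), s(o, y) ∈ ω)}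
          * (if Disjoint (S.erase x' ∪ B) A then
              ((prodBernoulli (fun e : Sym2 (Fin n) => if (∀ y ∈ e, y ∈ B) ∧ ¬ e.IsDiag then 1 else if (∃ y ∈ e, y ∈ ({x'} : Finset (Fin n))) then 0 else u e)).real (openConn a' b) + (prodBernoulli (fun e : Sym2 (Fin n) => if (∀ y ∈ e, y ∈ B) ∧ ¬ e.IsDiag then 1 else if (∃ y ∈ e, y ∈ ({x'} : Finset (Fin n))) then 0 else u e)).real ((openConn a' b)ᶜ ∩ (⋃ v ∈ (S.erase x' ∪ B), openConn a' v) ∩ (⋃ v ∈ (S.erase x' ∪ B), openConn v b)))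
              - ((prodBernoulli (fun e : Sym2 (Fin n) => if (∀ y ∈ e, y ∈ B) ∧ ¬ e.IsDiag then 1 else if (∃ y ∈ e, y ∈ ({x'} : Finset (Fin n))) then 0 else u e)).real (openConn a₀ b) + (prodBernoulli (fun e : Sym2 (Fin n) => if (∀ y ∈ e, y ∈ B) ∧ ¬ e.IsDiag then 1 else if (∃ y ∈ e, y ∈ ({x'} : Finset (Fin n))) then 0 else u e)).real ((openConn a₀ b)ᶜ ∩ (⋃ v ∈ (S.erase x' ∪ B), openConn a₀ v) ∩ (⋃ v ∈ (S.erase x' ∪ B), openConn v b)))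
            else
              (prodBernoulli (fun e : Sym2 (Fin n) => if (∀ y ∈ e, y ∈ B) ∧ ¬ e.IsDiag then 1 else if (∃ y ∈ e, y ∈ ({x'} : Finset (Fin n))) then 0 else u e)).real (⋃ v ∈ (S.erase x' ∪ B), openConn v b)
              - ((prodBernoulli (fun e : Sym2 (Fin n) => if (∀ y ∈ e, y ∈ B) ∧ ¬ e.IsDiag then 1 else if (∃ y ∈ e, y ∈ ({x'} : Finset (Fin n))) then 0 else u e)).real (openConn a₀ b) + (prodBernoulli (fun e : Sym2 (Fin n) => if (∀ y ∈ e, y ∈ B) ∧ ¬ e.IsDiag then 1 else if (∃ y ∈ e, y ∈ ({x'} : Finset (Fin n))) then 0 else u e)).real ((openConn a₀ b)ᶜ ∩ (⋃ v ∈ (S.erase x' ∪ B), openConn a₀ v) ∩ (⋃ v ∈ (S.erase x' ∪ B), openConn v b)))) →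
      (prodBernoulli u).real (openConn a₀ b)
          + (prodBernoulli u).real
              ((openConn a₀ b)ᶜ ∩ (⋃ v ∈ S, openConn a₀ v) ∩ (⋃ v ∈ S, openConn v b))
        ≤ (prodBernoulli u).real (⋃ v ∈ S, openConn v b)
          + (∑ W ∈ (Finset.univ : Finset (Finset (Fin n))).filter (fun W => Disjoint W A),
              (prodBernoulli u).real
                  {ω : BondConfig (Fin n) | ∀ z : Fin n, (z ∈ W ↔ ω ∈ ⋃ v ∈ S, openConn v z)}
                * A.inf' ⟨b, hb⟩ (fun a => (prodBernoulli u).real (openConnIn ((W : Set (Fin n))ᶜ) a b))) :=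
  Summit.CriticalPhenomena.PercolationContinuityZ3.Theorems.stub_bystanderKernel_c5

/-- `stub_isolatedBlock_c5` (LANDED p173624, Theorems/…IsolatedBlock.lean; restated here only until the farm has built that module):
an all-isolated block is good. [cite: KozmaNitzan2024, §3.2] -/
theorem stub_isolatedBlock_c5 :
    ∀ (n : ℕ) (u : Sym2 (Fin n) → unitInterval) (A S : Finset (Fin n)) (b a₀ : Fin n) (hb : b ∈ A),
      Disjoint S A → a₀ ∈ A →
      (∀ a ∈ A, (prodBernoulli u).real (openConn a₀ b) ≤ (prodBernoulli u).real (openConn a b)) →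
      (∀ v ∈ S, ∀ y : Fin n, (u s(y, v) : ℝ) = 0) →
      (prodBernoulli u).real (openConn a₀ b)
          + (prodBernoulli u).real
              ((openConn a₀ b)ᶜ ∩ (⋃ v ∈ S, openConn a₀ v) ∩ (⋃ v ∈ S, openConn v b))
        ≤ (prodBernoulli u).real (⋃ v ∈ S, openConn v b)
          + (∑ W ∈ (Finset.univ : Finset (Finset (Fin n))).filter (fun W => Disjoint W A),
              (prodBernoulli u).real
                  {ω : BondConfig (Fin n) | ∀ z : Fin n, (z ∈ W ↔ ω ∈ ⋃ v ∈ S, openConn v z)}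
                * A.inf' ⟨b, hb⟩ (fun a => (prodBernoulli u).real (openConnIn ((W : Set (Fin n))ᶜ) a b))) :=
  Summit.CriticalPhenomena.PercolationContinuityZ3.Theorems.stub_isolatedBlock_c5

/-- The v7 cone statement from the bystander kernel, the bystander certificate and the isolated block (real glue). -/
theorem cone7_of_bystander
    (hK : ∀ (n : ℕ) (u : Sym2 (Fin n) → unitInterval) (A S : Finset (Fin n)) (b a₀ x' a' : Fin n) (hb : b ∈ A),
        Disjoint S A → a₀ ∈ A → x' ∈ S → a' ∈ A →
        (∀ a ∈ A, (prodBernoulli u).real (openConn a₀ b) ≤ (prodBernoulli u).real (openConn a b)) →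
        (∀ a ∈ A, (prodBernoulli (fun e : Sym2 (Fin n) => if (∃ y ∈ e, y ∈ ({x'} : Finset (Fin n))) then (0 : unitInterval) else u e)).real (openConn a' b) ≤ (prodBernoulli (fun e : Sym2 (Fin n) => if (∃ y ∈ e, y ∈ ({x'} : Finset (Fin n))) then (0 : unitInterval) else u e)).real (openConn a b)) →
        (∀ w' : Sym2 (Fin n) → unitInterval,
          (Finset.univ.filter (fun v : Fin n => ∃ y : Fin n, 0 < (w' s(y, v) : ℝ))).card
            < (Finset.univ.filter (fun v : Fin n => ∃ y : Fin n, 0 < (u s(y, v) : ℝ))).card →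
          ∀ (A' S' : Finset (Fin n)) (b' d' : Fin n) (hb' : b' ∈ A'), Disjoint S' A' → d' ∈ A' →
          (∀ a ∈ A', (prodBernoulli w').real (openConn d' b') ≤ (prodBernoulli w').real (openConn a b')) →
          (prodBernoulli w').real (openConn d' b')
            + (prodBernoulli w').real
                ((openConn d' b')ᶜ ∩ (⋃ v ∈ S', openConn d' v) ∩ (⋃ v ∈ S', openConn v b'))
          ≤ (prodBernoulli w').real (⋃ v ∈ S', openConn v b')
            + (∑ W ∈ (Finset.univ : Finset (Finset (Fin n))).filter (fun W => Disjoint W A'),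
                (prodBernoulli w').real
                    {ω : BondConfig (Fin n) | ∀ z : Fin n, (z ∈ W ↔ ω ∈ ⋃ v ∈ S', openConn v z)}
                  * A'.inf' ⟨b', hb'⟩ (fun a => (prodBernoulli w').real (openConnIn ((W : Set (Fin n))ᶜ) a b')))) →
        (∃ y : Fin n, (u s(x', y) : ℝ) ≠ 0) →
        0 ≤ ∑ B : Finset (Fin n), (prodBernoulli u).real {ω : BondConfig (Fin n) | ∀ y : Fin n, y ∈ B ↔ (y ∉ ({x'} : Finset (Fin n)) ∧ ∃ o ∈ ({x'} : Finset (Fin n)), s(o, y) ∈ ω)}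
            * (if Disjoint (S.erase x' ∪ B) A then
                ((prodBernoulli (fun e : Sym2 (Fin n) => if (∀ y ∈ e, y ∈ B) ∧ ¬ e.IsDiag then 1 else if (∃ y ∈ e, y ∈ ({x'} : Finset (Fin n))) then 0 else u e)).real (openConn a' b) + (prodBernoulli (fun e : Sym2 (Fin n) => if (∀ y ∈ e, y ∈ B) ∧ ¬ e.IsDiag then 1 else if (∃ y ∈ e, y ∈ ({x'} : Finset (Fin n))) then 0 else u e)).real ((openConn a' b)ᶜ ∩ (⋃ v ∈ (S.erase x' ∪ B), openConn a' v) ∩ (⋃ v ∈ (S.erase x' ∪ B), openConn v b)))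
                - ((prodBernoulli (fun e : Sym2 (Fin n) => if (∀ y ∈ e, y ∈ B) ∧ ¬ e.IsDiag then 1 else if (∃ y ∈ e, y ∈ ({x'} : Finset (Fin n))) then 0 else u e)).real (openConn a₀ b) + (prodBernoulli (fun e : Sym2 (Fin n) => if (∀ y ∈ e, y ∈ B) ∧ ¬ e.IsDiag then 1 else if (∃ y ∈ e, y ∈ ({x'} : Finset (Fin n))) then 0 else u e)).real ((openConn a₀ b)ᶜ ∩ (⋃ v ∈ (S.erase x' ∪ B), openConn a₀ v) ∩ (⋃ v ∈ (S.erase x' ∪ B), openConn v b)))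
              else
                (prodBernoulli (fun e : Sym2 (Fin n) => if (∀ y ∈ e, y ∈ B) ∧ ¬ e.IsDiag then 1 else if (∃ y ∈ e, y ∈ ({x'} : Finset (Fin n))) then 0 else u e)).real (⋃ v ∈ (S.erase x' ∪ B), openConn v b)
                - ((prodBernoulli (fun e : Sym2 (Fin n) => if (∀ y ∈ e, y ∈ B) ∧ ¬ e.IsDiag then 1 else if (∃ y ∈ e, y ∈ ({x'} : Finset (Fin n))) then 0 else u e)).real (openConn a₀ b) + (prodBernoulli (fun e : Sym2 (Fin n) => if (∀ y ∈ e, y ∈ B) ∧ ¬ e.IsDiag then 1 else if (∃ y ∈ e, y ∈ ({x'} : Finset (Fin n))) then 0 else u e)).real ((openConn a₀ b)ᶜ ∩ (⋃ v ∈ (S.erase x' ∪ B), openConn a₀ v) ∩ (⋃ v ∈ (S.erase x' ∪ B), openConn v b)))) →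
        (prodBernoulli u).real (openConn a₀ b)
            + (prodBernoulli u).real
                ((openConn a₀ b)ᶜ ∩ (⋃ v ∈ S, openConn a₀ v) ∩ (⋃ v ∈ S, openConn v b))
          ≤ (prodBernoulli u).real (⋃ v ∈ S, openConn v b)
            + (∑ W ∈ (Finset.univ : Finset (Finset (Fin n))).filter (fun W => Disjoint W A),
                (prodBernoulli u).real
                    {ω : BondConfig (Fin n) | ∀ z : Fin n, (z ∈ W ↔ ω ∈ ⋃ v ∈ S, openConn v z)}
                  * A.inf' ⟨b, hb⟩ (fun a => (prodBernoulli u).real (openConnIn ((W : Set (Fin n))ᶜ) a b))))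
    (hC : ∀ (n : ℕ) (u : Sym2 (Fin n) → unitInterval) (A S : Finset (Fin n)) (b a₀ : Fin n),
        b ∈ A → Disjoint S A → a₀ ∈ A →
        (∀ a ∈ A, (prodBernoulli u).real (openConn a₀ b) ≤ (prodBernoulli u).real (openConn a b)) →
        (∃ x ∈ S, ∃ y : Fin n, (u s(x, y) : ℝ) ≠ 0) →
        ∃ x' ∈ S, (∃ y : Fin n, (u s(x', y) : ℝ) ≠ 0) ∧ ∃ a' ∈ A,
          (∀ a ∈ A, (prodBernoulli (fun e : Sym2 (Fin n) => if (∃ y ∈ e, y ∈ ({x'} : Finset (Fin n))) then (0 : unitInterval) else u e)).real (openConn a' b) ≤ (prodBernoulli (fun e : Sym2 (Fin n) => if (∃ y ∈ e, y ∈ ({x'} : Finset (Fin n))) then (0 : unitInterval) else u e)).real (openConn a b)) ∧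
          0 ≤ ∑ B : Finset (Fin n), (prodBernoulli u).real {ω : BondConfig (Fin n) | ∀ y : Fin n, y ∈ B ↔ (y ∉ ({x'} : Finset (Fin n)) ∧ ∃ o ∈ ({x'} : Finset (Fin n)), s(o, y) ∈ ω)}
            * (if Disjoint (S.erase x' ∪ B) A then
                ((prodBernoulli (fun e : Sym2 (Fin n) => if (∀ y ∈ e, y ∈ B) ∧ ¬ e.IsDiag then 1 else if (∃ y ∈ e, y ∈ ({x'} : Finset (Fin n))) then 0 else u e)).real (openConn a' b) + (prodBernoulli (fun e : Sym2 (Fin n) => if (∀ y ∈ e, y ∈ B) ∧ ¬ e.IsDiag then 1 else if (∃ y ∈ e, y ∈ ({x'} : Finset (Fin n))) then 0 else u e)).real ((openConn a' b)ᶜ ∩ (⋃ v ∈ (S.erase x' ∪ B), openConn a' v) ∩ (⋃ v ∈ (S.erase x' ∪ B), openConn v b)))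
                - ((prodBernoulli (fun e : Sym2 (Fin n) => if (∀ y ∈ e, y ∈ B) ∧ ¬ e.IsDiag then 1 else if (∃ y ∈ e, y ∈ ({x'} : Finset (Fin n))) then 0 else u e)).real (openConn a₀ b) + (prodBernoulli (fun e : Sym2 (Fin n) => if (∀ y ∈ e, y ∈ B) ∧ ¬ e.IsDiag then 1 else if (∃ y ∈ e, y ∈ ({x'} : Finset (Fin n))) then 0 else u e)).real ((openConn a₀ b)ᶜ ∩ (⋃ v ∈ (S.erase x' ∪ B), openConn a₀ v) ∩ (⋃ v ∈ (S.erase x' ∪ B), openConn v b)))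
              else
                (prodBernoulli (fun e : Sym2 (Fin n) => if (∀ y ∈ e, y ∈ B) ∧ ¬ e.IsDiag then 1 else if (∃ y ∈ e, y ∈ ({x'} : Finset (Fin n))) then 0 else u e)).real (⋃ v ∈ (S.erase x' ∪ B), openConn v b)
                - ((prodBernoulli (fun e : Sym2 (Fin n) => if (∀ y ∈ e, y ∈ B) ∧ ¬ e.IsDiag then 1 else if (∃ y ∈ e, y ∈ ({x'} : Finset (Fin n))) then 0 else u e)).real (openConn a₀ b) + (prodBernoulli (fun e : Sym2 (Fin n) => if (∀ y ∈ e, y ∈ B) ∧ ¬ e.IsDiag then 1 else if (∃ y ∈ e, y ∈ ({x'} : Finset (Fin n))) then 0 else u e)).real ((openConn a₀ b)ᶜ ∩ (⋃ v ∈ (S.erase x' ∪ B), openConn a₀ v) ∩ (⋃ v ∈ (S.erase x' ∪ B), openConn v b)))))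
    (hI : ∀ (n : ℕ) (u : Sym2 (Fin n) → unitInterval) (A S : Finset (Fin n)) (b a₀ : Fin n) (hb : b ∈ A),
        Disjoint S A → a₀ ∈ A →
        (∀ a ∈ A, (prodBernoulli u).real (openConn a₀ b) ≤ (prodBernoulli u).real (openConn a b)) →
        (∀ v ∈ S, ∀ y : Fin n, (u s(y, v) : ℝ) = 0) →
        (prodBernoulli u).real (openConn a₀ b)
            + (prodBernoulli u).real
                ((openConn a₀ b)ᶜ ∩ (⋃ v ∈ S, openConn a₀ v) ∩ (⋃ v ∈ S, openConn v b))
          ≤ (prodBernoulli u).real (⋃ v ∈ S, openConn v b)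
            + (∑ W ∈ (Finset.univ : Finset (Finset (Fin n))).filter (fun W => Disjoint W A),
                (prodBernoulli u).real
                    {ω : BondConfig (Fin n) | ∀ z : Fin n, (z ∈ W ↔ ω ∈ ⋃ v ∈ S, openConn v z)}
                  * A.inf' ⟨b, hb⟩ (fun a => (prodBernoulli u).real (openConnIn ((W : Set (Fin n))ᶜ) a b)))) :
    ∀ (n : ℕ) (u : Sym2 (Fin n) → unitInterval) (A S : Finset (Fin n)) (b a₀ : Fin n) (hb : b ∈ A),
      Disjoint S A → a₀ ∈ A →
      (∀ a ∈ A, (prodBernoulli u).real (openConn a₀ b) ≤ (prodBernoulli u).real (openConn a b)) →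
      (∀ w' : Sym2 (Fin n) → unitInterval,
        (Finset.univ.filter (fun v : Fin n => ∃ y : Fin n, 0 < (w' s(y, v) : ℝ))).card
          < (Finset.univ.filter (fun v : Fin n => ∃ y : Fin n, 0 < (u s(y, v) : ℝ))).card →
        ∀ (A' S' : Finset (Fin n)) (b' d' : Fin n) (hb' : b' ∈ A'), Disjoint S' A' → d' ∈ A' →
        (∀ a ∈ A', (prodBernoulli w').real (openConn d' b') ≤ (prodBernoulli w').real (openConn a b')) →
        (prodBernoulli w').real (openConn d' b')
          + (prodBernoulli w').real
              ((openConn d' b')ᶜ ∩ (⋃ v ∈ S', openConn d' v) ∩ (⋃ v ∈ S', openConn v b'))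
        ≤ (prodBernoulli w').real (⋃ v ∈ S', openConn v b')
          + (∑ W ∈ (Finset.univ : Finset (Finset (Fin n))).filter (fun W => Disjoint W A'),
              (prodBernoulli w').real
                  {ω : BondConfig (Fin n) | ∀ z : Fin n, (z ∈ W ↔ ω ∈ ⋃ v ∈ S', openConn v z)}
                * A'.inf' ⟨b', hb'⟩ (fun a => (prodBernoulli w').real (openConnIn ((W : Set (Fin n))ᶜ) a b')))) →
      (prodBernoulli u).real (openConn a₀ b)
          + (prodBernoulli u).real
              ((openConn a₀ b)ᶜ ∩ (⋃ v ∈ S, openConn a₀ v) ∩ (⋃ v ∈ S, openConn v b))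
        ≤ (prodBernoulli u).real (⋃ v ∈ S, openConn v b)
          + (∑ W ∈ (Finset.univ : Finset (Finset (Fin n))).filter (fun W => Disjoint W A),
              (prodBernoulli u).real
                  {ω : BondConfig (Fin n) | ∀ z : Fin n, (z ∈ W ↔ ω ∈ ⋃ v ∈ S, openConn v z)}
                * A.inf' ⟨b, hb⟩ (fun a => (prodBernoulli u).real (openConnIn ((W : Set (Fin n))ᶜ) a b))) := by
  intro n u A S b a₀ hb hSA ha₀ hmin hblk
  by_cases hex : ∃ x ∈ S, ∃ y : Fin n, (u s(x, y) : ℝ) ≠ 0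
  · obtain ⟨x', hx', hy, a', ha', hmin', hsum⟩ := hC n u A S b a₀ hb hSA ha₀ hmin hex
    exact hK n u A S b a₀ x' a' hb hSA ha₀ hx' ha' hmin hmin' hblk hy hsum
  · push Not at hex
    refine hI n u A S b a₀ hb hSA ha₀ hmin fun v hv y => ?_
    rw [Sym2.eq_swap]
    exact hex v hv y

/-- **The crux BY NAME along the v8 route** (assembly with HBLK ∘ bystander kernel ∘ bystander certificate). -/
theorem additiveGluing_closed_v8 :
    Summit.CriticalPhenomena.PercolationContinuityZ3.Theses.PercNearOneGluing.AdditiveGluing :=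
  stub_cone7Assembly_c5 (cone7_of_bystander stub_bystanderKernel_c5 stub_bystanderCert_c5 stub_isolatedBlock_c5)

end

end Summit.CriticalPhenomena.PercolationContinuityZ3.Cruxes.AdditiveGluing.Peel
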